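import Summits.ValiantsHypothesis.ValiantsHypothesis.Theses.LacunarySymmetroid
import Summits.ValiantsHypothesis.ValiantsHypothesis.Theorems.LacunarySymmetroidMatrixDescartesCensusDoorA26Link
import Summits.ValiantsHypothesis.ValiantsHypothesis.Theorems.LacunarySymmetroidMatrixDescartesCensusChamberReduction
import Summits.ValiantsHypothesis.ValiantsHypothesis.Theorems.LacunarySymmetroidMatrixDescartesCensusWindowFourRule

/-!
# Line `census` for the crux `DoorA26` (stmt-ValiantsHypothesis-19979) — chamber census + the window-4 band law

Crux (FIXED, the route's decl): `Summit.ValiantsHypothesis.ValiantsHypothesis.Theses.LacunarySymmetroid.DoorA26`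
(support item, rank 9, of `route-ValiantsHypothesis-LacunarySymmetroid`; `= PosRootLawAt 2 6 19` unfolded, `Census.doorA26_item_iff`;
OPEN, typed, never asserted): every six-term real symmetric `2 × 2` pencil `det (∑ₗ X^{dₗ} Sₗ)` has at most `19 = D(2,6) − 1` distinct
positive roots.  Content of this line drafted by the pub-symmetroid desk (lead g21, `HOME/lead/g21/lines/DoorA26-census-LINE.md`,
sha16 1f6f5d772524ff82, D-0145); typed and registered by the crux-plan seat `cruxplan-stmt-ValiantsHypothesis-19979-census` (2026-08-27).

WHY THIS LINE.  A `(2,6)` symmetric pencil determinant is a 21-nomial (monomials `X^{dᵢ+dⱼ}`, `i ≤ j`); twenty positive roots force it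
to be DESCARTES-SHARP, so all 21 pair sums are distinct (a collision costs a monomial: `Census.posRootLawOn_of_pairSum_collision`), the
coefficients strictly alternate, and the support lies in ONE of finitely many CHAMBERS = order types of the 21 pair sums on the cone
`0 = d₀ < d₁ < ⋯ < d₅`.  The tree already has the reduction `Census.doorA26_iff_forall_chamberOrder` / `Census.posRootLawOn_of_chamberRows`
(door A ⇔ the chamber-uniform row `∀ d, StrictMono ((fun p => d p.1 + d p.2) ∘ σ) → PosRootLawOn 2 6 19 d` for every covering order
`σ : Fin 21 → Fin 6 × Fin 6`).  This line makes the order set EXPLICIT and FINITE — the table `Census.chamber : ℕ → (Fin 21 → Fin 6 × Fin 6)` of the 2 608 chambers of record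
(theory g6, exact; count `2 608 = |χ_𝒜(−1)|/6!` confirmed by theory-2 via Zaslavsky + 21 good primes, CHAMBERS-COUNT-t2.md §2; the figure
«2 652» circulating in desk texts since R1842 is a transcription slip for this 2 608) — and splits the work into
* `stub_chamberCover` (finite combinatorics): every sorted generic support realises a LISTED order;
* `stub_easyChambers` (large, routine per chamber): every listed NON-hard chamber carries the door-A row — 931 of them are ALREADY kernel
  theorems `Census.doorA26_on_chamber<n>` (desk census 2026-08-27T19:55Z, `HOME/lead/g21/census/chambers_byfile.txt`), by sign-class
  parity / L-tri / Λ / Π certificates and magnitude leaves (newton-cone rows P/T/G3, AM–GM, domination dom2/dom3/dom-frac, row-assisted and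
  piecewise domination, mirror transport `…ChamberSymmetry`; composable instrument `Census.posRootLawOn_of_chamber_cell`);
* `stub_w4Band` — the WINDOW-4 BAND LAW, typed here in witness-free algebraic form (see `W4BandLaw`): the exact extra content of «three
  positive roots in a window of four consecutive monomials» beyond the two Newton-cone (C25) rows of the window;
* `stub_hardChambers` (THE CRUX OF THE LINE): the HARD chambers `[1, 954, 1706, 1709]` (index list inlined in the two chamber stubs) — the mirror pair 1706 / 954 carries the
  three KERNEL PSEUDO-TWENTIES of record (`…CensusPseudoTwenty000203081933` p549496 on `(0,2,3,8,19,33)⁺` ∈ chamber 1706;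
  `…PseudoTwenty001324282931` p551561 and `…PseudoTwenty001222262729` p551757, both in chamber 954): explicit integer symmetric pencils whose
  21 coefficients strictly alternate and satisfy ALL 1 330 Newton-cone triples strictly (with the recorded Gram rows) while the determinant
  has 2 resp. 4 positive roots — so NO certificate whose root-side input is signs + C25 (+ pencil-valid Gram/rank rows) kills those cells
  (door-p1 g8, desk words R2128/R2159 «METHOD BARRIER AT C25 DEPTH (kernel)»); chamber 1709 carries the located-exact tall-flag
  pseudo-twenty `(0,2,3,9,100,400)⁺` (door-p1 g8, `exp/pseudo20_0_2_3_9_100_400_int.json`, not filed) and 1 is its mirror.  These rows must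
  use a ROOT-SIDE input beyond C25 — the band law — together with the M4/Gram rows (door-p1 g9: the apex zone `σ₉ ≤ 1.28e-3` of
  `(0,2,3,8,19,33)⁺` is located-dead by M4 term domination; above it the W4 bands bite).
SHAPE (layer invariant): each stub is a precise named `Prop` `Stmt.stub_<name>` + a registered `theorem stub_<name> : Stmt.stub_<name> :=
sorry`; the composition `DoorA26_of : Stmt.stub_chamberCover → Stmt.stub_easyChambers → Stmt.stub_w4Band → Stmt.stub_hardChambers → DoorA26`
(`doorA26_item_of ∘ doorA26_iff_strictMono.mpr`, then `posRootLawOn_of_chamberRows` support by support, the cover, and the hard/easy case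
split on the chamber index) is kernel-checked with no `sorry` of its own; `DoorA26_proof : DoorA26 := DoorA26_of stub_… ` depends on exactly
the four stub `sorry`s and becomes the crux proof when the last stub is discharged (provers land `Stmt.stub_<name>` verbatim in `Theorems/`).

RESHAPING RULE (for the lead).  The easy/hard cut is organisational: both chamber stubs have the same shape, and once `stub_w4Band` is a
tree theorem it may be used anywhere.  A chamber found immune to the landed certificate classes moves from `stub_easyChambers` to
`stub_hardChambers` by re-publishing this file with a longer hard list in `Stmt.stub_easyChambers` / `Stmt.stub_hardChambers` / `DoorA26_of`
(same stub names; re-register with `ledger skeleton check`).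

WHY NOVEL (search-before-claim, this seat, 2026-08-27; details and hit ids in `Lines/census.md`).  Matrix Descartes at a FIXED format decided
by a finite chamber census with kernel certificates per chamber, plus a witness-free band form of the 4-nomial three-root criterion usable
as LP rows; no literature treats `ζ_sym(2,6)`; nearest prior art = fewnomial / Descartes-type bounds for structured polynomials (see card).

CHEAPEST FALSIFIER.  ONE real symmetric `(2,6)` pencil with 20 distinct positive det-roots (`Census.not_doorA26_iff`) kills the crux, the
item and this line at once; census freeze of record: maximum 18 on 228 supports, never > 18; the kernel pseudo-twenties say where to look
(chambers 1706⁺ / 954⁺; door-p1 g9 runs the negative side on the stratum chain `(3,3,6) → … → F₀`).  For `stub_chamberCover` alone: sample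
sorted integer supports and look their order up in the table (done: all 11 946 394 generic supports with `d₅ ≤ 80` realise exactly these
2 608 orders, theory g6 `boxmin.py`).  For `W4BandLaw` alone: random alternating 4-nomials with three positive roots against the two
row families at random `t` (door-p2 g7's `w4band.py` self-test is the same check in band coordinates, 400/400).

HONEST FRAMING.  A skeleton: four `sorry`s (the registered stubs), one kernel-checked composition, and `DoorA26_proof` resting on those
four `sorry`s — nothing here is asserted or proved; the file is never imported.  `DoorA26` / `DoorA34` OPEN;
registers unchanged `ζ_sym(2,6) ∈ {18,19,20}` (18 attained, never > 18); nothing here bears on `MatrixDescartes`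
(stmt-ValiantsHypothesis-18050) or on `VP ≠ VNP` — the summit is NOT moved by this file.
-/

-- `Summit.ValiantsHypothesis.ValiantsHypothesis.…` repeats a component by the D-0017 layout
-- (single-conjunct summit), which the `dupNamespace` linter flags; the name is mandated.
set_option linter.dupNamespace false

/-! ## TABLE BLOCK — verbatim the body of the Theorems-ready definitions file `…Theorems/LacunarySymmetroidMatrixDescartesCensusChamberTable.lean`
(attached as evidence on stmt-ValiantsHypothesis-19979 and filed as a definition item by this seat; a door seat lands it `--supports
stmt-ValiantsHypothesis-19979`).  It is declared HERE, in the THEOREMS namespace `…Theorems.LacunarySymmetroidMatrixDescartes.Census`, so that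
the registered stub signatures already carry the final names `Census.chamber` / `Census.W4BandLaw` and provers can restate them in
`Theorems/` files once the table file has landed.  MAINTENANCE (lead): when `…CensusChamberTable.lean` is in the tree, DELETE this block
(from here to its `end …Census`), add `import Summits.ValiantsHypothesis.ValiantsHypothesis.Theorems.LacunarySymmetroidMatrixDescartesCensusChamberTable`,
and re-publish — the stubs, their registered signatures and `DoorA26_of` are unchanged by that switch. -/

namespace Summit.ValiantsHypothesis.ValiantsHypothesis.Theorems.LacunarySymmetroidMatrixDescartes.Census

/-! ### The 21 canonical pairs `(i, j)`, `i ≤ j`, as ONE-LETTER abbreviations in lexicographic order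
`a b c d e f g h i j k l m n o p q r s t u = (0,0) (0,1) (0,2) (0,3) (0,4) (0,5) (1,1) (1,2) (1,3) (1,4) (1,5) (2,2) (2,3) (2,4) (2,5)
(3,3) (3,4) (3,5) (4,4) (4,5) (5,5)` (compact table leaves — the gate caps a crux workfile at 200 000 bytes; `ChamberTable.i` unfolds
to `(1, 3)` by `rfl`; kept in their own namespace, opened only inside `chamberBlock`, so nothing else sees them). [folklore] -/
namespace ChamberTable

/-- `(0, 0)` [folklore] -/ abbrev a : Fin 6 × Fin 6 := (0, 0)
/-- `(0, 1)` [folklore] -/ abbrev b : Fin 6 × Fin 6 := (0, 1)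
/-- `(0, 2)` [folklore] -/ abbrev c : Fin 6 × Fin 6 := (0, 2)
/-- `(0, 3)` [folklore] -/ abbrev d : Fin 6 × Fin 6 := (0, 3)
/-- `(0, 4)` [folklore] -/ abbrev e : Fin 6 × Fin 6 := (0, 4)
/-- `(0, 5)` [folklore] -/ abbrev f : Fin 6 × Fin 6 := (0, 5)
/-- `(1, 1)` [folklore] -/ abbrev g : Fin 6 × Fin 6 := (1, 1)
/-- `(1, 2)` [folklore] -/ abbrev h : Fin 6 × Fin 6 := (1, 2)
/-- `(1, 3)` [folklore] -/ abbrev i : Fin 6 × Fin 6 := (1, 3)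
/-- `(1, 4)` [folklore] -/ abbrev j : Fin 6 × Fin 6 := (1, 4)
/-- `(1, 5)` [folklore] -/ abbrev k : Fin 6 × Fin 6 := (1, 5)
/-- `(2, 2)` [folklore] -/ abbrev l : Fin 6 × Fin 6 := (2, 2)
/-- `(2, 3)` [folklore] -/ abbrev m : Fin 6 × Fin 6 := (2, 3)
/-- `(2, 4)` [folklore] -/ abbrev n : Fin 6 × Fin 6 := (2, 4)
/-- `(2, 5)` [folklore] -/ abbrev o : Fin 6 × Fin 6 := (2, 5)
/-- `(3, 3)` [folklore] -/ abbrev p : Fin 6 × Fin 6 := (3, 3)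
/-- `(3, 4)` [folklore] -/ abbrev q : Fin 6 × Fin 6 := (3, 4)
/-- `(3, 5)` [folklore] -/ abbrev r : Fin 6 × Fin 6 := (3, 5)
/-- `(4, 4)` [folklore] -/ abbrev s : Fin 6 × Fin 6 := (4, 4)
/-- `(4, 5)` [folklore] -/ abbrev t : Fin 6 × Fin 6 := (4, 5)
/-- `(5, 5)` [folklore] -/ abbrev u : Fin 6 × Fin 6 := (5, 5)
end ChamberTable

set_option maxHeartbeats 4000000 in
open ChamberTable in
/-- **The 2 608 pair-sum chambers of `(2,6)`, in 163 blocks of 16** (bookkeeping definition, nothing asserted; source of record: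
theory g6 `HOME/theory/g6/chambers/chambers_2-6.jsonl`, sha256 45597a475e93750a…, ids `0 … 2607`; block `k` lists chambers
`16k … 16k+15`, four per line; balanced `if`-tree of depth 8 on the block index `N`, junk past the end = block 162).  See `chamber`. [folklore] -/
noncomputable def chamberBlock (N : ℕ) : List (Fin 21 → Fin 6 × Fin 6) :=
 if N < 81 then
 if N < 40 then
 if N < 20 then
 if N < 10 then
 if N < 5 then
 if N < 2 then
 if N < 1 then
 [ -- block 0: chambers 0…15, four per line
 ![a,b,c,d,e,f,g,h,i,j,k,l,m,n,o,p,q,r,s,t,u], ![a,b,c,d,e,f,g,h,i,j,k,l,m,n,o,p,q,s,r,t,u], ![a,b,c,d,e,f,g,h,i,j,k,l,m,n,p,o,q,r,s,t,u], ![a,b,c,d,e,f,g,h,i,j,k,l,m,n,p,o,q,s,r,t,u],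
 ![a,b,c,d,e,f,g,h,i,j,k,l,m,n,p,q,o,s,r,t,u], ![a,b,c,d,e,f,g,h,i,j,k,l,m,n,p,q,s,o,r,t,u], ![a,b,c,d,e,f,g,h,i,j,k,l,m,p,n,o,q,r,s,t,u], ![a,b,c,d,e,f,g,h,i,j,k,l,m,p,n,q,o,r,s,t,u],
 ![a,b,c,d,e,f,g,h,i,j,k,l,m,p,n,q,o,s,r,t,u], ![a,b,c,d,e,f,g,h,i,j,k,l,m,p,n,q,s,o,r,t,u], ![a,b,c,d,e,f,g,h,i,j,l,k,m,n,o,p,q,r,s,t,u], ![a,b,c,d,e,f,g,h,i,j,l,k,m,n,o,p,q,s,r,t,u],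
 ![a,b,c,d,e,f,g,h,i,j,l,k,m,n,p,o,q,r,s,t,u], ![a,b,c,d,e,f,g,h,i,j,l,k,m,n,p,o,q,s,r,t,u], ![a,b,c,d,e,f,g,h,i,j,l,k,m,n,p,q,o,s,r,t,u], ![a,b,c,d,e,f,g,h,i,j,l,k,m,n,p,q,s,o,r,t,u] ]
 else
 [ -- block 1: chambers 16…31, four per line
 ![a,b,c,d,e,f,g,h,i,j,l,k,m,p,n,o,q,r,s,t,u], ![a,b,c,d,e,f,g,h,i,j,l,k,m,p,n,q,o,r,s,t,u], ![a,b,c,d,e,f,g,h,i,j,l,k,m,p,n,q,o,s,r,t,u], ![a,b,c,d,e,f,g,h,i,j,l,k,m,p,n,q,s,o,r,t,u],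
 ![a,b,c,d,e,f,g,h,i,j,l,m,k,n,p,q,o,s,r,t,u], ![a,b,c,d,e,f,g,h,i,j,l,m,k,n,p,q,s,o,r,t,u], ![a,b,c,d,e,f,g,h,i,j,l,m,k,p,n,q,o,r,s,t,u], ![a,b,c,d,e,f,g,h,i,j,l,m,k,p,n,q,o,s,r,t,u],
 ![a,b,c,d,e,f,g,h,i,j,l,m,k,p,n,q,s,o,r,t,u], ![a,b,c,d,e,f,g,h,i,j,l,m,n,k,p,q,s,o,r,t,u], ![a,b,c,d,e,f,g,h,i,j,l,m,n,p,k,q,s,o,r,t,u], ![a,b,c,d,e,f,g,h,i,j,l,m,n,p,q,k,s,o,r,t,u],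
 ![a,b,c,d,e,f,g,h,i,j,l,m,n,p,q,s,k,o,r,t,u], ![a,b,c,d,e,f,g,h,i,j,l,m,p,k,n,q,o,r,s,t,u], ![a,b,c,d,e,f,g,h,i,j,l,m,p,k,n,q,o,s,r,t,u], ![a,b,c,d,e,f,g,h,i,j,l,m,p,k,n,q,s,o,r,t,u] ]
 else
 if N < 3 then
 [ -- block 2: chambers 32…47, four per line
 ![a,b,c,d,e,f,g,h,i,j,l,m,p,n,k,q,s,o,r,t,u], ![a,b,c,d,e,f,g,h,i,j,l,m,p,n,q,k,s,o,r,t,u], ![a,b,c,d,e,f,g,h,i,j,l,m,p,n,q,s,k,o,r,t,u], ![a,b,c,d,e,f,g,h,i,l,j,k,m,n,o,p,q,r,s,t,u],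
 ![a,b,c,d,e,f,g,h,i,l,j,k,m,n,o,p,q,s,r,t,u], ![a,b,c,d,e,f,g,h,i,l,j,k,m,n,p,o,q,r,s,t,u], ![a,b,c,d,e,f,g,h,i,l,j,k,m,n,p,o,q,s,r,t,u], ![a,b,c,d,e,f,g,h,i,l,j,k,m,p,n,o,q,r,s,t,u],
 ![a,b,c,d,e,f,g,h,i,l,j,m,k,n,p,o,q,r,s,t,u], ![a,b,c,d,e,f,g,h,i,l,j,m,k,n,p,o,q,s,r,t,u], ![a,b,c,d,e,f,g,h,i,l,j,m,k,n,p,q,o,s,r,t,u], ![a,b,c,d,e,f,g,h,i,l,j,m,k,p,n,o,q,r,s,t,u],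
 ![a,b,c,d,e,f,g,h,i,l,j,m,k,p,n,q,o,r,s,t,u], ![a,b,c,d,e,f,g,h,i,l,j,m,k,p,n,q,o,s,r,t,u], ![a,b,c,d,e,f,g,h,i,l,j,m,n,k,p,q,o,s,r,t,u], ![a,b,c,d,e,f,g,h,i,l,j,m,n,k,p,q,s,o,r,t,u] ]
 else
 if N < 4 then
 [ -- block 3: chambers 48…63, four per line
 ![a,b,c,d,e,f,g,h,i,l,j,m,n,p,k,q,o,s,r,t,u], ![a,b,c,d,e,f,g,h,i,l,j,m,n,p,k,q,s,o,r,t,u], ![a,b,c,d,e,f,g,h,i,l,j,m,n,p,q,k,s,o,r,t,u], ![a,b,c,d,e,f,g,h,i,l,j,m,n,p,q,s,k,o,r,t,u],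
 ![a,b,c,d,e,f,g,h,i,l,j,m,p,k,n,q,o,r,s,t,u], ![a,b,c,d,e,f,g,h,i,l,j,m,p,k,n,q,o,s,r,t,u], ![a,b,c,d,e,f,g,h,i,l,j,m,p,n,k,q,o,s,r,t,u], ![a,b,c,d,e,f,g,h,i,l,j,m,p,n,k,q,s,o,r,t,u],
 ![a,b,c,d,e,f,g,h,i,l,j,m,p,n,q,k,s,o,r,t,u], ![a,b,c,d,e,f,g,h,i,l,j,m,p,n,q,s,k,o,r,t,u], ![a,b,c,d,e,f,g,h,i,l,m,j,k,p,n,o,q,r,s,t,u], ![a,b,c,d,e,f,g,h,i,l,m,j,p,k,n,o,q,r,s,t,u],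
 ![a,b,c,d,e,f,g,h,i,l,m,j,p,k,n,q,o,r,s,t,u], ![a,b,c,d,e,f,g,h,i,l,m,j,p,n,k,q,o,r,s,t,u], ![a,b,c,d,e,f,g,h,i,l,m,j,p,n,k,q,o,s,r,t,u], ![a,b,c,d,e,f,g,h,i,l,m,j,p,n,q,k,o,s,r,t,u] ]
 else
 [ -- block 4: chambers 64…79, four per line
 ![a,b,c,d,e,f,g,h,i,l,m,j,p,n,q,k,s,o,r,t,u], ![a,b,c,d,e,f,g,h,i,l,m,j,p,n,q,s,k,o,r,t,u], ![a,b,c,d,e,f,g,h,i,l,m,p,j,k,n,o,q,r,s,t,u], ![a,b,c,d,e,f,g,h,i,l,m,p,j,k,n,q,o,r,s,t,u],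
 ![a,b,c,d,e,f,g,h,i,l,m,p,j,n,k,q,o,r,s,t,u], ![a,b,c,d,e,f,g,h,i,l,m,p,j,n,q,k,o,r,s,t,u], ![a,b,c,d,e,f,g,h,i,l,m,p,j,n,q,k,o,s,r,t,u], ![a,b,c,d,e,f,g,h,i,l,m,p,j,n,q,k,s,o,r,t,u],
 ![a,b,c,d,e,f,g,h,i,l,m,p,j,n,q,s,k,o,r,t,u], ![a,b,c,d,e,f,g,h,l,i,j,k,m,n,o,p,q,r,s,t,u], ![a,b,c,d,e,f,g,h,l,i,j,k,m,n,o,p,q,s,r,t,u], ![a,b,c,d,e,f,g,h,l,i,j,m,k,n,o,p,q,r,s,t,u],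
 ![a,b,c,d,e,f,g,h,l,i,j,m,k,n,o,p,q,s,r,t,u], ![a,b,c,d,e,f,g,h,l,i,j,m,k,n,p,o,q,r,s,t,u], ![a,b,c,d,e,f,g,h,l,i,j,m,k,n,p,o,q,s,r,t,u], ![a,b,c,d,e,f,g,h,l,i,j,m,n,k,o,p,q,s,r,t,u] ]
 else
 if N < 7 then
 if N < 6 then
 [ -- block 5: chambers 80…95, four per line
 ![a,b,c,d,e,f,g,h,l,i,j,m,n,k,p,o,q,s,r,t,u], ![a,b,c,d,e,f,g,h,l,i,j,m,n,k,p,q,o,s,r,t,u], ![a,b,c,d,e,f,g,h,l,i,j,m,n,k,p,q,s,o,r,t,u], ![a,b,c,d,e,f,g,h,l,i,j,m,n,p,k,q,o,s,r,t,u],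
 ![a,b,c,d,e,f,g,h,l,i,j,m,n,p,k,q,s,o,r,t,u], ![a,b,c,d,e,f,g,h,l,i,j,m,n,p,q,k,s,o,r,t,u], ![a,b,c,d,e,f,g,h,l,i,j,m,n,p,q,s,k,o,r,t,u], ![a,b,c,d,e,f,g,h,l,i,m,j,k,n,o,p,q,r,s,t,u],
 ![a,b,c,d,e,f,g,h,l,i,m,j,k,n,p,o,q,r,s,t,u], ![a,b,c,d,e,f,g,h,l,i,m,j,k,p,n,o,q,r,s,t,u], ![a,b,c,d,e,f,g,h,l,i,m,j,n,k,o,p,q,r,s,t,u], ![a,b,c,d,e,f,g,h,l,i,m,j,n,k,o,p,q,s,r,t,u],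
 ![a,b,c,d,e,f,g,h,l,i,m,j,n,k,p,o,q,r,s,t,u], ![a,b,c,d,e,f,g,h,l,i,m,j,n,k,p,o,q,s,r,t,u], ![a,b,c,d,e,f,g,h,l,i,m,j,n,p,k,o,q,r,s,t,u], ![a,b,c,d,e,f,g,h,l,i,m,j,n,p,k,o,q,s,r,t,u] ]
 else
 [ -- block 6: chambers 96…111, four per line
 ![a,b,c,d,e,f,g,h,l,i,m,j,n,p,k,q,o,s,r,t,u], ![a,b,c,d,e,f,g,h,l,i,m,j,n,p,q,k,o,s,r,t,u], ![a,b,c,d,e,f,g,h,l,i,m,j,n,p,q,k,s,o,r,t,u], ![a,b,c,d,e,f,g,h,l,i,m,j,n,p,q,s,k,o,r,t,u],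
 ![a,b,c,d,e,f,g,h,l,i,m,j,p,k,n,o,q,r,s,t,u], ![a,b,c,d,e,f,g,h,l,i,m,j,p,n,k,o,q,r,s,t,u], ![a,b,c,d,e,f,g,h,l,i,m,j,p,n,k,q,o,r,s,t,u], ![a,b,c,d,e,f,g,h,l,i,m,j,p,n,k,q,o,s,r,t,u],
 ![a,b,c,d,e,f,g,h,l,i,m,j,p,n,q,k,o,s,r,t,u], ![a,b,c,d,e,f,g,h,l,i,m,j,p,n,q,k,s,o,r,t,u], ![a,b,c,d,e,f,g,h,l,i,m,j,p,n,q,s,k,o,r,t,u], ![a,b,c,d,e,f,g,h,l,i,m,p,j,k,n,o,q,r,s,t,u],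
 ![a,b,c,d,e,f,g,h,l,i,m,p,j,n,k,o,q,r,s,t,u], ![a,b,c,d,e,f,g,h,l,i,m,p,j,n,k,q,o,r,s,t,u], ![a,b,c,d,e,f,g,h,l,i,m,p,j,n,q,k,o,r,s,t,u], ![a,b,c,d,e,f,g,h,l,i,m,p,j,n,q,k,o,s,r,t,u] ]
 else
 if N < 8 then
 [ -- block 7: chambers 112…127, four per line
 ![a,b,c,d,e,f,g,h,l,i,m,p,j,n,q,k,s,o,r,t,u], ![a,b,c,d,e,f,g,h,l,i,m,p,j,n,q,s,k,o,r,t,u], ![a,b,c,d,e,g,f,h,i,j,k,l,m,n,o,p,q,r,s,t,u], ![a,b,c,d,e,g,f,h,i,j,k,l,m,n,o,p,q,s,r,t,u],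
 ![a,b,c,d,e,g,f,h,i,j,k,l,m,n,p,o,q,r,s,t,u], ![a,b,c,d,e,g,f,h,i,j,k,l,m,n,p,o,q,s,r,t,u], ![a,b,c,d,e,g,f,h,i,j,k,l,m,n,p,q,o,s,r,t,u], ![a,b,c,d,e,g,f,h,i,j,k,l,m,n,p,q,s,o,r,t,u],
 ![a,b,c,d,e,g,f,h,i,j,k,l,m,p,n,o,q,r,s,t,u], ![a,b,c,d,e,g,f,h,i,j,k,l,m,p,n,q,o,r,s,t,u], ![a,b,c,d,e,g,f,h,i,j,k,l,m,p,n,q,o,s,r,t,u], ![a,b,c,d,e,g,f,h,i,j,k,l,m,p,n,q,s,o,r,t,u],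
 ![a,b,c,d,e,g,f,h,i,j,l,k,m,n,o,p,q,r,s,t,u], ![a,b,c,d,e,g,f,h,i,j,l,k,m,n,o,p,q,s,r,t,u], ![a,b,c,d,e,g,f,h,i,j,l,k,m,n,p,o,q,r,s,t,u], ![a,b,c,d,e,g,f,h,i,j,l,k,m,n,p,o,q,s,r,t,u] ]
 else
 if N < 9 then
 [ -- block 8: chambers 128…143, four per line
 ![a,b,c,d,e,g,f,h,i,j,l,k,m,n,p,q,o,s,r,t,u], ![a,b,c,d,e,g,f,h,i,j,l,k,m,n,p,q,s,o,r,t,u], ![a,b,c,d,e,g,f,h,i,j,l,k,m,p,n,o,q,r,s,t,u], ![a,b,c,d,e,g,f,h,i,j,l,k,m,p,n,q,o,r,s,t,u],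
 ![a,b,c,d,e,g,f,h,i,j,l,k,m,p,n,q,o,s,r,t,u], ![a,b,c,d,e,g,f,h,i,j,l,k,m,p,n,q,s,o,r,t,u], ![a,b,c,d,e,g,f,h,i,j,l,m,k,n,p,q,o,s,r,t,u], ![a,b,c,d,e,g,f,h,i,j,l,m,k,n,p,q,s,o,r,t,u],
 ![a,b,c,d,e,g,f,h,i,j,l,m,k,p,n,q,o,r,s,t,u], ![a,b,c,d,e,g,f,h,i,j,l,m,k,p,n,q,o,s,r,t,u], ![a,b,c,d,e,g,f,h,i,j,l,m,k,p,n,q,s,o,r,t,u], ![a,b,c,d,e,g,f,h,i,j,l,m,n,k,p,q,s,o,r,t,u],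
 ![a,b,c,d,e,g,f,h,i,j,l,m,n,p,k,q,s,o,r,t,u], ![a,b,c,d,e,g,f,h,i,j,l,m,n,p,q,k,s,o,r,t,u], ![a,b,c,d,e,g,f,h,i,j,l,m,n,p,q,s,k,o,r,t,u], ![a,b,c,d,e,g,f,h,i,j,l,m,p,k,n,q,o,r,s,t,u] ]
 else
 [ -- block 9: chambers 144…159, four per line
 ![a,b,c,d,e,g,f,h,i,j,l,m,p,k,n,q,o,s,r,t,u], ![a,b,c,d,e,g,f,h,i,j,l,m,p,k,n,q,s,o,r,t,u], ![a,b,c,d,e,g,f,h,i,j,l,m,p,n,k,q,s,o,r,t,u], ![a,b,c,d,e,g,f,h,i,j,l,m,p,n,q,k,s,o,r,t,u],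
 ![a,b,c,d,e,g,f,h,i,j,l,m,p,n,q,s,k,o,r,t,u], ![a,b,c,d,e,g,f,h,i,l,j,k,m,n,o,p,q,r,s,t,u], ![a,b,c,d,e,g,f,h,i,l,j,k,m,n,o,p,q,s,r,t,u], ![a,b,c,d,e,g,f,h,i,l,j,k,m,n,p,o,q,r,s,t,u],
 ![a,b,c,d,e,g,f,h,i,l,j,k,m,n,p,o,q,s,r,t,u], ![a,b,c,d,e,g,f,h,i,l,j,k,m,p,n,o,q,r,s,t,u], ![a,b,c,d,e,g,f,h,i,l,j,m,k,n,p,o,q,r,s,t,u], ![a,b,c,d,e,g,f,h,i,l,j,m,k,n,p,o,q,s,r,t,u],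
 ![a,b,c,d,e,g,f,h,i,l,j,m,k,n,p,q,o,s,r,t,u], ![a,b,c,d,e,g,f,h,i,l,j,m,k,p,n,o,q,r,s,t,u], ![a,b,c,d,e,g,f,h,i,l,j,m,k,p,n,q,o,r,s,t,u], ![a,b,c,d,e,g,f,h,i,l,j,m,k,p,n,q,o,s,r,t,u] ]
 else
 if N < 15 then
 if N < 12 then
 if N < 11 then
 [ -- block 10: chambers 160…175, four per line
 ![a,b,c,d,e,g,f,h,i,l,j,m,n,k,p,q,o,s,r,t,u], ![a,b,c,d,e,g,f,h,i,l,j,m,n,k,p,q,s,o,r,t,u], ![a,b,c,d,e,g,f,h,i,l,j,m,n,p,k,q,o,s,r,t,u], ![a,b,c,d,e,g,f,h,i,l,j,m,n,p,k,q,s,o,r,t,u],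
 ![a,b,c,d,e,g,f,h,i,l,j,m,n,p,q,k,s,o,r,t,u], ![a,b,c,d,e,g,f,h,i,l,j,m,n,p,q,s,k,o,r,t,u], ![a,b,c,d,e,g,f,h,i,l,j,m,p,k,n,q,o,r,s,t,u], ![a,b,c,d,e,g,f,h,i,l,j,m,p,k,n,q,o,s,r,t,u],
 ![a,b,c,d,e,g,f,h,i,l,j,m,p,n,k,q,o,s,r,t,u], ![a,b,c,d,e,g,f,h,i,l,j,m,p,n,k,q,s,o,r,t,u], ![a,b,c,d,e,g,f,h,i,l,j,m,p,n,q,k,s,o,r,t,u], ![a,b,c,d,e,g,f,h,i,l,j,m,p,n,q,s,k,o,r,t,u],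
 ![a,b,c,d,e,g,f,h,i,l,m,j,k,p,n,o,q,r,s,t,u], ![a,b,c,d,e,g,f,h,i,l,m,j,p,k,n,o,q,r,s,t,u], ![a,b,c,d,e,g,f,h,i,l,m,j,p,k,n,q,o,r,s,t,u], ![a,b,c,d,e,g,f,h,i,l,m,j,p,n,k,q,o,r,s,t,u] ]
 else
 [ -- block 11: chambers 176…191, four per line
 ![a,b,c,d,e,g,f,h,i,l,m,j,p,n,k,q,o,s,r,t,u], ![a,b,c,d,e,g,f,h,i,l,m,j,p,n,q,k,o,s,r,t,u], ![a,b,c,d,e,g,f,h,i,l,m,j,p,n,q,k,s,o,r,t,u], ![a,b,c,d,e,g,f,h,i,l,m,j,p,n,q,s,k,o,r,t,u],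
 ![a,b,c,d,e,g,f,h,i,l,m,p,j,k,n,o,q,r,s,t,u], ![a,b,c,d,e,g,f,h,i,l,m,p,j,k,n,q,o,r,s,t,u], ![a,b,c,d,e,g,f,h,i,l,m,p,j,n,k,q,o,r,s,t,u], ![a,b,c,d,e,g,f,h,i,l,m,p,j,n,q,k,o,r,s,t,u],
 ![a,b,c,d,e,g,f,h,i,l,m,p,j,n,q,k,o,s,r,t,u], ![a,b,c,d,e,g,f,h,i,l,m,p,j,n,q,k,s,o,r,t,u], ![a,b,c,d,e,g,f,h,i,l,m,p,j,n,q,s,k,o,r,t,u], ![a,b,c,d,e,g,f,h,l,i,j,k,m,n,o,p,q,r,s,t,u],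
 ![a,b,c,d,e,g,f,h,l,i,j,k,m,n,o,p,q,s,r,t,u], ![a,b,c,d,e,g,f,h,l,i,j,m,k,n,o,p,q,r,s,t,u], ![a,b,c,d,e,g,f,h,l,i,j,m,k,n,o,p,q,s,r,t,u], ![a,b,c,d,e,g,f,h,l,i,j,m,k,n,p,o,q,r,s,t,u] ]
 else
 if N < 13 then
 [ -- block 12: chambers 192…207, four per line
 ![a,b,c,d,e,g,f,h,l,i,j,m,k,n,p,o,q,s,r,t,u], ![a,b,c,d,e,g,f,h,l,i,j,m,n,k,o,p,q,s,r,t,u], ![a,b,c,d,e,g,f,h,l,i,j,m,n,k,p,o,q,s,r,t,u], ![a,b,c,d,e,g,f,h,l,i,j,m,n,k,p,q,o,s,r,t,u],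
 ![a,b,c,d,e,g,f,h,l,i,j,m,n,k,p,q,s,o,r,t,u], ![a,b,c,d,e,g,f,h,l,i,j,m,n,p,k,q,o,s,r,t,u], ![a,b,c,d,e,g,f,h,l,i,j,m,n,p,k,q,s,o,r,t,u], ![a,b,c,d,e,g,f,h,l,i,j,m,n,p,q,k,s,o,r,t,u],
 ![a,b,c,d,e,g,f,h,l,i,j,m,n,p,q,s,k,o,r,t,u], ![a,b,c,d,e,g,f,h,l,i,m,j,k,n,o,p,q,r,s,t,u], ![a,b,c,d,e,g,f,h,l,i,m,j,k,n,p,o,q,r,s,t,u], ![a,b,c,d,e,g,f,h,l,i,m,j,k,p,n,o,q,r,s,t,u],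
 ![a,b,c,d,e,g,f,h,l,i,m,j,n,k,o,p,q,r,s,t,u], ![a,b,c,d,e,g,f,h,l,i,m,j,n,k,o,p,q,s,r,t,u], ![a,b,c,d,e,g,f,h,l,i,m,j,n,k,p,o,q,r,s,t,u], ![a,b,c,d,e,g,f,h,l,i,m,j,n,k,p,o,q,s,r,t,u] ]
 else
 if N < 14 then
 [ -- block 13: chambers 208…223, four per line
 ![a,b,c,d,e,g,f,h,l,i,m,j,n,p,k,o,q,r,s,t,u], ![a,b,c,d,e,g,f,h,l,i,m,j,n,p,k,o,q,s,r,t,u], ![a,b,c,d,e,g,f,h,l,i,m,j,n,p,k,q,o,s,r,t,u], ![a,b,c,d,e,g,f,h,l,i,m,j,n,p,q,k,o,s,r,t,u],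
 ![a,b,c,d,e,g,f,h,l,i,m,j,n,p,q,k,s,o,r,t,u], ![a,b,c,d,e,g,f,h,l,i,m,j,n,p,q,s,k,o,r,t,u], ![a,b,c,d,e,g,f,h,l,i,m,j,p,k,n,o,q,r,s,t,u], ![a,b,c,d,e,g,f,h,l,i,m,j,p,n,k,o,q,r,s,t,u],
 ![a,b,c,d,e,g,f,h,l,i,m,j,p,n,k,q,o,r,s,t,u], ![a,b,c,d,e,g,f,h,l,i,m,j,p,n,k,q,o,s,r,t,u], ![a,b,c,d,e,g,f,h,l,i,m,j,p,n,q,k,o,s,r,t,u], ![a,b,c,d,e,g,f,h,l,i,m,j,p,n,q,k,s,o,r,t,u],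
 ![a,b,c,d,e,g,f,h,l,i,m,j,p,n,q,s,k,o,r,t,u], ![a,b,c,d,e,g,f,h,l,i,m,p,j,k,n,o,q,r,s,t,u], ![a,b,c,d,e,g,f,h,l,i,m,p,j,n,k,o,q,r,s,t,u], ![a,b,c,d,e,g,f,h,l,i,m,p,j,n,k,q,o,r,s,t,u] ]
 else
 [ -- block 14: chambers 224…239, four per line
 ![a,b,c,d,e,g,f,h,l,i,m,p,j,n,q,k,o,r,s,t,u], ![a,b,c,d,e,g,f,h,l,i,m,p,j,n,q,k,o,s,r,t,u], ![a,b,c,d,e,g,f,h,l,i,m,p,j,n,q,k,s,o,r,t,u], ![a,b,c,d,e,g,f,h,l,i,m,p,j,n,q,s,k,o,r,t,u],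
 ![a,b,c,d,e,g,h,f,i,j,l,m,n,k,p,q,s,o,r,t,u], ![a,b,c,d,e,g,h,f,i,j,l,m,n,p,k,q,s,o,r,t,u], ![a,b,c,d,e,g,h,f,i,j,l,m,n,p,q,k,s,o,r,t,u], ![a,b,c,d,e,g,h,f,i,j,l,m,n,p,q,s,k,o,r,t,u],
 ![a,b,c,d,e,g,h,f,i,j,l,m,p,n,k,q,s,o,r,t,u], ![a,b,c,d,e,g,h,f,i,j,l,m,p,n,q,k,s,o,r,t,u], ![a,b,c,d,e,g,h,f,i,j,l,m,p,n,q,s,k,o,r,t,u], ![a,b,c,d,e,g,h,f,i,l,j,m,n,k,p,q,o,s,r,t,u],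
 ![a,b,c,d,e,g,h,f,i,l,j,m,n,k,p,q,s,o,r,t,u], ![a,b,c,d,e,g,h,f,i,l,j,m,n,p,k,q,o,s,r,t,u], ![a,b,c,d,e,g,h,f,i,l,j,m,n,p,k,q,s,o,r,t,u], ![a,b,c,d,e,g,h,f,i,l,j,m,n,p,q,k,s,o,r,t,u] ]
 else
 if N < 17 then
 if N < 16 then
 [ -- block 15: chambers 240…255, four per line
 ![a,b,c,d,e,g,h,f,i,l,j,m,n,p,q,s,k,o,r,t,u], ![a,b,c,d,e,g,h,f,i,l,j,m,p,n,k,q,o,s,r,t,u], ![a,b,c,d,e,g,h,f,i,l,j,m,p,n,k,q,s,o,r,t,u], ![a,b,c,d,e,g,h,f,i,l,j,m,p,n,q,k,s,o,r,t,u],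
 ![a,b,c,d,e,g,h,f,i,l,j,m,p,n,q,s,k,o,r,t,u], ![a,b,c,d,e,g,h,f,i,l,m,j,p,n,k,q,o,r,s,t,u], ![a,b,c,d,e,g,h,f,i,l,m,j,p,n,k,q,o,s,r,t,u], ![a,b,c,d,e,g,h,f,i,l,m,j,p,n,q,k,o,s,r,t,u],
 ![a,b,c,d,e,g,h,f,i,l,m,j,p,n,q,k,s,o,r,t,u], ![a,b,c,d,e,g,h,f,i,l,m,j,p,n,q,s,k,o,r,t,u], ![a,b,c,d,e,g,h,f,i,l,m,p,j,n,k,q,o,r,s,t,u], ![a,b,c,d,e,g,h,f,i,l,m,p,j,n,q,k,o,r,s,t,u],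
 ![a,b,c,d,e,g,h,f,i,l,m,p,j,n,q,k,o,s,r,t,u], ![a,b,c,d,e,g,h,f,i,l,m,p,j,n,q,k,s,o,r,t,u], ![a,b,c,d,e,g,h,f,i,l,m,p,j,n,q,s,k,o,r,t,u], ![a,b,c,d,e,g,h,f,l,i,j,m,n,k,o,p,q,s,r,t,u] ]
 else
 [ -- block 16: chambers 256…271, four per line
 ![a,b,c,d,e,g,h,f,l,i,j,m,n,k,p,o,q,s,r,t,u], ![a,b,c,d,e,g,h,f,l,i,j,m,n,k,p,q,o,s,r,t,u], ![a,b,c,d,e,g,h,f,l,i,j,m,n,k,p,q,s,o,r,t,u], ![a,b,c,d,e,g,h,f,l,i,j,m,n,p,k,q,o,s,r,t,u],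
 ![a,b,c,d,e,g,h,f,l,i,j,m,n,p,k,q,s,o,r,t,u], ![a,b,c,d,e,g,h,f,l,i,j,m,n,p,q,k,s,o,r,t,u], ![a,b,c,d,e,g,h,f,l,i,j,m,n,p,q,s,k,o,r,t,u], ![a,b,c,d,e,g,h,f,l,i,m,j,n,k,o,p,q,r,s,t,u],
 ![a,b,c,d,e,g,h,f,l,i,m,j,n,k,o,p,q,s,r,t,u], ![a,b,c,d,e,g,h,f,l,i,m,j,n,k,p,o,q,r,s,t,u], ![a,b,c,d,e,g,h,f,l,i,m,j,n,k,p,o,q,s,r,t,u], ![a,b,c,d,e,g,h,f,l,i,m,j,n,p,k,o,q,r,s,t,u],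
 ![a,b,c,d,e,g,h,f,l,i,m,j,n,p,k,o,q,s,r,t,u], ![a,b,c,d,e,g,h,f,l,i,m,j,n,p,k,q,o,s,r,t,u], ![a,b,c,d,e,g,h,f,l,i,m,j,n,p,q,k,o,s,r,t,u], ![a,b,c,d,e,g,h,f,l,i,m,j,n,p,q,k,s,o,r,t,u] ]
 else
 if N < 18 then
 [ -- block 17: chambers 272…287, four per line
 ![a,b,c,d,e,g,h,f,l,i,m,j,n,p,q,s,k,o,r,t,u], ![a,b,c,d,e,g,h,f,l,i,m,j,p,n,k,o,q,r,s,t,u], ![a,b,c,d,e,g,h,f,l,i,m,j,p,n,k,q,o,r,s,t,u], ![a,b,c,d,e,g,h,f,l,i,m,j,p,n,k,q,o,s,r,t,u],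
 ![a,b,c,d,e,g,h,f,l,i,m,j,p,n,q,k,o,s,r,t,u], ![a,b,c,d,e,g,h,f,l,i,m,j,p,n,q,k,s,o,r,t,u], ![a,b,c,d,e,g,h,f,l,i,m,j,p,n,q,s,k,o,r,t,u], ![a,b,c,d,e,g,h,f,l,i,m,p,j,n,k,o,q,r,s,t,u],
 ![a,b,c,d,e,g,h,f,l,i,m,p,j,n,k,q,o,r,s,t,u], ![a,b,c,d,e,g,h,f,l,i,m,p,j,n,q,k,o,r,s,t,u], ![a,b,c,d,e,g,h,f,l,i,m,p,j,n,q,k,o,s,r,t,u], ![a,b,c,d,e,g,h,f,l,i,m,p,j,n,q,k,s,o,r,t,u],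
 ![a,b,c,d,e,g,h,f,l,i,m,p,j,n,q,s,k,o,r,t,u], ![a,b,c,d,e,g,h,i,f,j,l,m,n,p,q,k,s,o,r,t,u], ![a,b,c,d,e,g,h,i,f,j,l,m,n,p,q,s,k,o,r,t,u], ![a,b,c,d,e,g,h,i,f,j,l,m,p,n,q,k,s,o,r,t,u] ]
 else
 if N < 19 then
 [ -- block 18: chambers 288…303, four per line
 ![a,b,c,d,e,g,h,i,f,j,l,m,p,n,q,s,k,o,r,t,u], ![a,b,c,d,e,g,h,i,f,l,j,m,n,p,q,k,s,o,r,t,u], ![a,b,c,d,e,g,h,i,f,l,j,m,n,p,q,s,k,o,r,t,u], ![a,b,c,d,e,g,h,i,f,l,j,m,p,n,q,k,s,o,r,t,u],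
 ![a,b,c,d,e,g,h,i,f,l,j,m,p,n,q,s,k,o,r,t,u], ![a,b,c,d,e,g,h,i,f,l,m,j,p,n,q,k,o,s,r,t,u], ![a,b,c,d,e,g,h,i,f,l,m,j,p,n,q,k,s,o,r,t,u], ![a,b,c,d,e,g,h,i,f,l,m,j,p,n,q,s,k,o,r,t,u],
 ![a,b,c,d,e,g,h,i,f,l,m,p,j,n,q,k,o,r,s,t,u], ![a,b,c,d,e,g,h,i,f,l,m,p,j,n,q,k,o,s,r,t,u], ![a,b,c,d,e,g,h,i,f,l,m,p,j,n,q,k,s,o,r,t,u], ![a,b,c,d,e,g,h,i,f,l,m,p,j,n,q,s,k,o,r,t,u],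
 ![a,b,c,d,e,g,h,i,j,f,l,m,n,p,q,s,k,o,r,t,u], ![a,b,c,d,e,g,h,i,j,f,l,m,p,n,q,s,k,o,r,t,u], ![a,b,c,d,e,g,h,i,j,l,f,m,n,p,q,s,k,o,r,t,u], ![a,b,c,d,e,g,h,i,j,l,f,m,p,n,q,s,k,o,r,t,u] ]
 else
 [ -- block 19: chambers 304…319, four per line
 ![a,b,c,d,e,g,h,i,j,l,m,f,n,p,q,s,k,o,r,t,u], ![a,b,c,d,e,g,h,i,j,l,m,f,p,n,q,s,k,o,r,t,u], ![a,b,c,d,e,g,h,i,j,l,m,n,f,p,q,s,k,o,r,t,u], ![a,b,c,d,e,g,h,i,j,l,m,n,p,f,q,s,k,o,r,t,u],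
 ![a,b,c,d,e,g,h,i,j,l,m,n,p,q,f,s,k,o,r,t,u], ![a,b,c,d,e,g,h,i,j,l,m,n,p,q,s,f,k,o,r,t,u], ![a,b,c,d,e,g,h,i,j,l,m,p,f,n,q,s,k,o,r,t,u], ![a,b,c,d,e,g,h,i,j,l,m,p,n,f,q,s,k,o,r,t,u],
 ![a,b,c,d,e,g,h,i,j,l,m,p,n,q,f,s,k,o,r,t,u], ![a,b,c,d,e,g,h,i,j,l,m,p,n,q,s,f,k,o,r,t,u], ![a,b,c,d,e,g,h,i,l,f,j,m,n,p,q,k,s,o,r,t,u], ![a,b,c,d,e,g,h,i,l,f,j,m,n,p,q,s,k,o,r,t,u],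
 ![a,b,c,d,e,g,h,i,l,f,j,m,p,n,q,k,s,o,r,t,u], ![a,b,c,d,e,g,h,i,l,f,j,m,p,n,q,s,k,o,r,t,u], ![a,b,c,d,e,g,h,i,l,f,m,j,p,n,q,k,o,s,r,t,u], ![a,b,c,d,e,g,h,i,l,f,m,j,p,n,q,k,s,o,r,t,u] ]
 else
 if N < 30 then
 if N < 25 then
 if N < 22 then
 if N < 21 then
 [ -- block 20: chambers 320…335, four per line
 ![a,b,c,d,e,g,h,i,l,f,m,j,p,n,q,s,k,o,r,t,u], ![a,b,c,d,e,g,h,i,l,f,m,p,j,n,q,k,o,r,s,t,u], ![a,b,c,d,e,g,h,i,l,f,m,p,j,n,q,k,o,s,r,t,u], ![a,b,c,d,e,g,h,i,l,f,m,p,j,n,q,k,s,o,r,t,u],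
 ![a,b,c,d,e,g,h,i,l,f,m,p,j,n,q,s,k,o,r,t,u], ![a,b,c,d,e,g,h,i,l,j,f,m,n,p,q,s,k,o,r,t,u], ![a,b,c,d,e,g,h,i,l,j,f,m,p,n,q,s,k,o,r,t,u], ![a,b,c,d,e,g,h,i,l,j,m,f,n,p,q,s,k,o,r,t,u],
 ![a,b,c,d,e,g,h,i,l,j,m,f,p,n,q,s,k,o,r,t,u], ![a,b,c,d,e,g,h,i,l,j,m,n,f,p,q,s,k,o,r,t,u], ![a,b,c,d,e,g,h,i,l,j,m,n,p,f,q,s,k,o,r,t,u], ![a,b,c,d,e,g,h,i,l,j,m,n,p,q,f,s,k,o,r,t,u],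
 ![a,b,c,d,e,g,h,i,l,j,m,n,p,q,s,f,k,o,r,t,u], ![a,b,c,d,e,g,h,i,l,j,m,p,f,n,q,s,k,o,r,t,u], ![a,b,c,d,e,g,h,i,l,j,m,p,n,f,q,s,k,o,r,t,u], ![a,b,c,d,e,g,h,i,l,j,m,p,n,q,f,s,k,o,r,t,u] ]
 else
 [ -- block 21: chambers 336…351, four per line
 ![a,b,c,d,e,g,h,i,l,j,m,p,n,q,s,f,k,o,r,t,u], ![a,b,c,d,e,g,h,i,l,m,f,j,p,n,q,k,s,o,r,t,u], ![a,b,c,d,e,g,h,i,l,m,f,j,p,n,q,s,k,o,r,t,u], ![a,b,c,d,e,g,h,i,l,m,f,p,j,n,q,k,o,r,s,t,u],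
 ![a,b,c,d,e,g,h,i,l,m,f,p,j,n,q,k,o,s,r,t,u], ![a,b,c,d,e,g,h,i,l,m,f,p,j,n,q,k,s,o,r,t,u], ![a,b,c,d,e,g,h,i,l,m,f,p,j,n,q,s,k,o,r,t,u], ![a,b,c,d,e,g,h,i,l,m,j,f,p,n,q,s,k,o,r,t,u],
 ![a,b,c,d,e,g,h,i,l,m,j,p,f,n,q,s,k,o,r,t,u], ![a,b,c,d,e,g,h,i,l,m,j,p,n,f,q,s,k,o,r,t,u], ![a,b,c,d,e,g,h,i,l,m,j,p,n,q,f,s,k,o,r,t,u], ![a,b,c,d,e,g,h,i,l,m,j,p,n,q,s,f,k,o,r,t,u],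
 ![a,b,c,d,e,g,h,i,l,m,p,f,j,n,q,k,o,r,s,t,u], ![a,b,c,d,e,g,h,i,l,m,p,f,j,n,q,k,o,s,r,t,u], ![a,b,c,d,e,g,h,i,l,m,p,f,j,n,q,k,s,o,r,t,u], ![a,b,c,d,e,g,h,i,l,m,p,f,j,n,q,s,k,o,r,t,u] ]
 else
 if N < 23 then
 [ -- block 22: chambers 352…367, four per line
 ![a,b,c,d,e,g,h,i,l,m,p,j,f,n,q,s,k,o,r,t,u], ![a,b,c,d,e,g,h,i,l,m,p,j,n,f,q,s,k,o,r,t,u], ![a,b,c,d,e,g,h,i,l,m,p,j,n,q,f,s,k,o,r,t,u], ![a,b,c,d,e,g,h,i,l,m,p,j,n,q,s,f,k,o,r,t,u],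
 ![a,b,c,d,e,g,h,l,f,i,j,m,n,k,o,p,q,s,r,t,u], ![a,b,c,d,e,g,h,l,f,i,j,m,n,k,p,o,q,s,r,t,u], ![a,b,c,d,e,g,h,l,f,i,j,m,n,k,p,q,o,s,r,t,u], ![a,b,c,d,e,g,h,l,f,i,j,m,n,k,p,q,s,o,r,t,u],
 ![a,b,c,d,e,g,h,l,f,i,j,m,n,p,k,q,o,s,r,t,u], ![a,b,c,d,e,g,h,l,f,i,j,m,n,p,k,q,s,o,r,t,u], ![a,b,c,d,e,g,h,l,f,i,j,m,n,p,q,k,s,o,r,t,u], ![a,b,c,d,e,g,h,l,f,i,j,m,n,p,q,s,k,o,r,t,u],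
 ![a,b,c,d,e,g,h,l,f,i,m,j,n,k,o,p,q,r,s,t,u], ![a,b,c,d,e,g,h,l,f,i,m,j,n,k,o,p,q,s,r,t,u], ![a,b,c,d,e,g,h,l,f,i,m,j,n,k,p,o,q,r,s,t,u], ![a,b,c,d,e,g,h,l,f,i,m,j,n,k,p,o,q,s,r,t,u] ]
 else
 if N < 24 then
 [ -- block 23: chambers 368…383, four per line
 ![a,b,c,d,e,g,h,l,f,i,m,j,n,p,k,o,q,r,s,t,u], ![a,b,c,d,e,g,h,l,f,i,m,j,n,p,k,o,q,s,r,t,u], ![a,b,c,d,e,g,h,l,f,i,m,j,n,p,k,q,o,s,r,t,u], ![a,b,c,d,e,g,h,l,f,i,m,j,n,p,q,k,o,s,r,t,u],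
 ![a,b,c,d,e,g,h,l,f,i,m,j,n,p,q,k,s,o,r,t,u], ![a,b,c,d,e,g,h,l,f,i,m,j,n,p,q,s,k,o,r,t,u], ![a,b,c,d,e,g,h,l,f,i,m,j,p,n,k,o,q,r,s,t,u], ![a,b,c,d,e,g,h,l,f,i,m,j,p,n,k,q,o,r,s,t,u],
 ![a,b,c,d,e,g,h,l,f,i,m,j,p,n,k,q,o,s,r,t,u], ![a,b,c,d,e,g,h,l,f,i,m,j,p,n,q,k,o,s,r,t,u], ![a,b,c,d,e,g,h,l,f,i,m,j,p,n,q,k,s,o,r,t,u], ![a,b,c,d,e,g,h,l,f,i,m,j,p,n,q,s,k,o,r,t,u],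
 ![a,b,c,d,e,g,h,l,f,i,m,p,j,n,k,o,q,r,s,t,u], ![a,b,c,d,e,g,h,l,f,i,m,p,j,n,k,q,o,r,s,t,u], ![a,b,c,d,e,g,h,l,f,i,m,p,j,n,q,k,o,r,s,t,u], ![a,b,c,d,e,g,h,l,f,i,m,p,j,n,q,k,o,s,r,t,u] ]
 else
 [ -- block 24: chambers 384…399, four per line
 ![a,b,c,d,e,g,h,l,f,i,m,p,j,n,q,k,s,o,r,t,u], ![a,b,c,d,e,g,h,l,f,i,m,p,j,n,q,s,k,o,r,t,u], ![a,b,c,d,e,g,h,l,i,f,j,m,n,p,q,k,s,o,r,t,u], ![a,b,c,d,e,g,h,l,i,f,j,m,n,p,q,s,k,o,r,t,u],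
 ![a,b,c,d,e,g,h,l,i,f,m,j,n,p,q,k,o,s,r,t,u], ![a,b,c,d,e,g,h,l,i,f,m,j,n,p,q,k,s,o,r,t,u], ![a,b,c,d,e,g,h,l,i,f,m,j,n,p,q,s,k,o,r,t,u], ![a,b,c,d,e,g,h,l,i,f,m,j,p,n,q,k,o,s,r,t,u],
 ![a,b,c,d,e,g,h,l,i,f,m,j,p,n,q,k,s,o,r,t,u], ![a,b,c,d,e,g,h,l,i,f,m,j,p,n,q,s,k,o,r,t,u], ![a,b,c,d,e,g,h,l,i,f,m,p,j,n,q,k,o,r,s,t,u], ![a,b,c,d,e,g,h,l,i,f,m,p,j,n,q,k,o,s,r,t,u],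
 ![a,b,c,d,e,g,h,l,i,f,m,p,j,n,q,k,s,o,r,t,u], ![a,b,c,d,e,g,h,l,i,f,m,p,j,n,q,s,k,o,r,t,u], ![a,b,c,d,e,g,h,l,i,j,f,m,n,p,q,s,k,o,r,t,u], ![a,b,c,d,e,g,h,l,i,j,m,f,n,p,q,s,k,o,r,t,u] ]
 else
 if N < 27 then
 if N < 26 then
 [ -- block 25: chambers 400…415, four per line
 ![a,b,c,d,e,g,h,l,i,j,m,n,f,p,q,s,k,o,r,t,u], ![a,b,c,d,e,g,h,l,i,j,m,n,p,f,q,s,k,o,r,t,u], ![a,b,c,d,e,g,h,l,i,j,m,n,p,q,f,s,k,o,r,t,u], ![a,b,c,d,e,g,h,l,i,j,m,n,p,q,s,f,k,o,r,t,u],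
 ![a,b,c,d,e,g,h,l,i,m,f,j,n,p,q,k,o,s,r,t,u], ![a,b,c,d,e,g,h,l,i,m,f,j,n,p,q,k,s,o,r,t,u], ![a,b,c,d,e,g,h,l,i,m,f,j,n,p,q,s,k,o,r,t,u], ![a,b,c,d,e,g,h,l,i,m,f,j,p,n,q,k,o,s,r,t,u],
 ![a,b,c,d,e,g,h,l,i,m,f,j,p,n,q,k,s,o,r,t,u], ![a,b,c,d,e,g,h,l,i,m,f,j,p,n,q,s,k,o,r,t,u], ![a,b,c,d,e,g,h,l,i,m,f,p,j,n,q,k,o,r,s,t,u], ![a,b,c,d,e,g,h,l,i,m,f,p,j,n,q,k,o,s,r,t,u],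
 ![a,b,c,d,e,g,h,l,i,m,f,p,j,n,q,k,s,o,r,t,u], ![a,b,c,d,e,g,h,l,i,m,f,p,j,n,q,s,k,o,r,t,u], ![a,b,c,d,e,g,h,l,i,m,j,f,n,p,q,s,k,o,r,t,u], ![a,b,c,d,e,g,h,l,i,m,j,f,p,n,q,s,k,o,r,t,u] ]
 else
 [ -- block 26: chambers 416…431, four per line
 ![a,b,c,d,e,g,h,l,i,m,j,n,f,p,q,s,k,o,r,t,u], ![a,b,c,d,e,g,h,l,i,m,j,n,p,f,q,s,k,o,r,t,u], ![a,b,c,d,e,g,h,l,i,m,j,n,p,q,f,s,k,o,r,t,u], ![a,b,c,d,e,g,h,l,i,m,j,n,p,q,s,f,k,o,r,t,u],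
 ![a,b,c,d,e,g,h,l,i,m,j,p,f,n,q,s,k,o,r,t,u], ![a,b,c,d,e,g,h,l,i,m,j,p,n,f,q,s,k,o,r,t,u], ![a,b,c,d,e,g,h,l,i,m,j,p,n,q,f,s,k,o,r,t,u], ![a,b,c,d,e,g,h,l,i,m,j,p,n,q,s,f,k,o,r,t,u],
 ![a,b,c,d,e,g,h,l,i,m,p,f,j,n,q,k,o,r,s,t,u], ![a,b,c,d,e,g,h,l,i,m,p,f,j,n,q,k,o,s,r,t,u], ![a,b,c,d,e,g,h,l,i,m,p,f,j,n,q,k,s,o,r,t,u], ![a,b,c,d,e,g,h,l,i,m,p,f,j,n,q,s,k,o,r,t,u],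
 ![a,b,c,d,e,g,h,l,i,m,p,j,f,n,q,s,k,o,r,t,u], ![a,b,c,d,e,g,h,l,i,m,p,j,n,f,q,s,k,o,r,t,u], ![a,b,c,d,e,g,h,l,i,m,p,j,n,q,f,s,k,o,r,t,u], ![a,b,c,d,e,g,h,l,i,m,p,j,n,q,s,f,k,o,r,t,u] ]
 else
 if N < 28 then
 [ -- block 27: chambers 432…447, four per line
 ![a,b,c,d,g,e,f,h,i,j,k,l,m,n,o,p,q,r,s,t,u], ![a,b,c,d,g,e,f,h,i,j,k,l,m,n,o,p,q,s,r,t,u], ![a,b,c,d,g,e,f,h,i,j,k,l,m,n,p,o,q,r,s,t,u], ![a,b,c,d,g,e,f,h,i,j,k,l,m,n,p,o,q,s,r,t,u],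
 ![a,b,c,d,g,e,f,h,i,j,k,l,m,n,p,q,o,s,r,t,u], ![a,b,c,d,g,e,f,h,i,j,k,l,m,n,p,q,s,o,r,t,u], ![a,b,c,d,g,e,f,h,i,j,k,l,m,p,n,o,q,r,s,t,u], ![a,b,c,d,g,e,f,h,i,j,k,l,m,p,n,q,o,r,s,t,u],
 ![a,b,c,d,g,e,f,h,i,j,k,l,m,p,n,q,o,s,r,t,u], ![a,b,c,d,g,e,f,h,i,j,k,l,m,p,n,q,s,o,r,t,u], ![a,b,c,d,g,e,f,h,i,j,l,k,m,n,o,p,q,r,s,t,u], ![a,b,c,d,g,e,f,h,i,j,l,k,m,n,o,p,q,s,r,t,u],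
 ![a,b,c,d,g,e,f,h,i,j,l,k,m,n,p,o,q,r,s,t,u], ![a,b,c,d,g,e,f,h,i,j,l,k,m,n,p,o,q,s,r,t,u], ![a,b,c,d,g,e,f,h,i,j,l,k,m,n,p,q,o,s,r,t,u], ![a,b,c,d,g,e,f,h,i,j,l,k,m,n,p,q,s,o,r,t,u] ]
 else
 if N < 29 then
 [ -- block 28: chambers 448…463, four per line
 ![a,b,c,d,g,e,f,h,i,j,l,k,m,p,n,o,q,r,s,t,u], ![a,b,c,d,g,e,f,h,i,j,l,k,m,p,n,q,o,r,s,t,u], ![a,b,c,d,g,e,f,h,i,j,l,k,m,p,n,q,o,s,r,t,u], ![a,b,c,d,g,e,f,h,i,j,l,k,m,p,n,q,s,o,r,t,u],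
 ![a,b,c,d,g,e,f,h,i,j,l,m,k,n,p,q,o,s,r,t,u], ![a,b,c,d,g,e,f,h,i,j,l,m,k,n,p,q,s,o,r,t,u], ![a,b,c,d,g,e,f,h,i,j,l,m,k,p,n,q,o,r,s,t,u], ![a,b,c,d,g,e,f,h,i,j,l,m,k,p,n,q,o,s,r,t,u],
 ![a,b,c,d,g,e,f,h,i,j,l,m,k,p,n,q,s,o,r,t,u], ![a,b,c,d,g,e,f,h,i,j,l,m,p,k,n,q,o,r,s,t,u], ![a,b,c,d,g,e,f,h,i,j,l,m,p,k,n,q,o,s,r,t,u], ![a,b,c,d,g,e,f,h,i,j,l,m,p,k,n,q,s,o,r,t,u],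
 ![a,b,c,d,g,e,f,h,i,l,j,k,m,n,o,p,q,r,s,t,u], ![a,b,c,d,g,e,f,h,i,l,j,k,m,n,o,p,q,s,r,t,u], ![a,b,c,d,g,e,f,h,i,l,j,k,m,n,p,o,q,r,s,t,u], ![a,b,c,d,g,e,f,h,i,l,j,k,m,n,p,o,q,s,r,t,u] ]
 else
 [ -- block 29: chambers 464…479, four per line
 ![a,b,c,d,g,e,f,h,i,l,j,k,m,p,n,o,q,r,s,t,u], ![a,b,c,d,g,e,f,h,i,l,j,m,k,n,p,o,q,r,s,t,u], ![a,b,c,d,g,e,f,h,i,l,j,m,k,n,p,o,q,s,r,t,u], ![a,b,c,d,g,e,f,h,i,l,j,m,k,n,p,q,o,s,r,t,u],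
 ![a,b,c,d,g,e,f,h,i,l,j,m,k,p,n,o,q,r,s,t,u], ![a,b,c,d,g,e,f,h,i,l,j,m,k,p,n,q,o,r,s,t,u], ![a,b,c,d,g,e,f,h,i,l,j,m,k,p,n,q,o,s,r,t,u], ![a,b,c,d,g,e,f,h,i,l,j,m,p,k,n,q,o,r,s,t,u],
 ![a,b,c,d,g,e,f,h,i,l,j,m,p,k,n,q,o,s,r,t,u], ![a,b,c,d,g,e,f,h,i,l,m,j,k,p,n,o,q,r,s,t,u], ![a,b,c,d,g,e,f,h,i,l,m,j,p,k,n,o,q,r,s,t,u], ![a,b,c,d,g,e,f,h,i,l,m,j,p,k,n,q,o,r,s,t,u],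
 ![a,b,c,d,g,e,f,h,i,l,m,p,j,k,n,o,q,r,s,t,u], ![a,b,c,d,g,e,f,h,i,l,m,p,j,k,n,q,o,r,s,t,u], ![a,b,c,d,g,e,f,h,l,i,j,k,m,n,o,p,q,r,s,t,u], ![a,b,c,d,g,e,f,h,l,i,j,k,m,n,o,p,q,s,r,t,u] ]
 else
 if N < 35 then
 if N < 32 then
 if N < 31 then
 [ -- block 30: chambers 480…495, four per line
 ![a,b,c,d,g,e,f,h,l,i,j,m,k,n,o,p,q,r,s,t,u], ![a,b,c,d,g,e,f,h,l,i,j,m,k,n,o,p,q,s,r,t,u], ![a,b,c,d,g,e,f,h,l,i,j,m,k,n,p,o,q,r,s,t,u], ![a,b,c,d,g,e,f,h,l,i,j,m,k,n,p,o,q,s,r,t,u],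
 ![a,b,c,d,g,e,f,h,l,i,m,j,k,n,o,p,q,r,s,t,u], ![a,b,c,d,g,e,f,h,l,i,m,j,k,n,p,o,q,r,s,t,u], ![a,b,c,d,g,e,f,h,l,i,m,j,k,p,n,o,q,r,s,t,u], ![a,b,c,d,g,e,f,h,l,i,m,j,p,k,n,o,q,r,s,t,u],
 ![a,b,c,d,g,e,f,h,l,i,m,p,j,k,n,o,q,r,s,t,u], ![a,b,c,d,g,e,h,f,i,j,l,m,k,n,p,q,o,s,r,t,u], ![a,b,c,d,g,e,h,f,i,j,l,m,k,n,p,q,s,o,r,t,u], ![a,b,c,d,g,e,h,f,i,j,l,m,k,p,n,q,o,r,s,t,u],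
 ![a,b,c,d,g,e,h,f,i,j,l,m,k,p,n,q,o,s,r,t,u], ![a,b,c,d,g,e,h,f,i,j,l,m,k,p,n,q,s,o,r,t,u], ![a,b,c,d,g,e,h,f,i,j,l,m,n,k,p,q,s,o,r,t,u], ![a,b,c,d,g,e,h,f,i,j,l,m,n,p,k,q,s,o,r,t,u] ]
 else
 [ -- block 31: chambers 496…511, four per line
 ![a,b,c,d,g,e,h,f,i,j,l,m,p,k,n,q,o,r,s,t,u], ![a,b,c,d,g,e,h,f,i,j,l,m,p,k,n,q,o,s,r,t,u], ![a,b,c,d,g,e,h,f,i,j,l,m,p,k,n,q,s,o,r,t,u], ![a,b,c,d,g,e,h,f,i,j,l,m,p,n,k,q,s,o,r,t,u],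
 ![a,b,c,d,g,e,h,f,i,l,j,m,k,n,p,o,q,r,s,t,u], ![a,b,c,d,g,e,h,f,i,l,j,m,k,n,p,o,q,s,r,t,u], ![a,b,c,d,g,e,h,f,i,l,j,m,k,n,p,q,o,s,r,t,u], ![a,b,c,d,g,e,h,f,i,l,j,m,k,p,n,o,q,r,s,t,u],
 ![a,b,c,d,g,e,h,f,i,l,j,m,k,p,n,q,o,r,s,t,u], ![a,b,c,d,g,e,h,f,i,l,j,m,k,p,n,q,o,s,r,t,u], ![a,b,c,d,g,e,h,f,i,l,j,m,n,k,p,q,o,s,r,t,u], ![a,b,c,d,g,e,h,f,i,l,j,m,n,k,p,q,s,o,r,t,u],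
 ![a,b,c,d,g,e,h,f,i,l,j,m,n,p,k,q,o,s,r,t,u], ![a,b,c,d,g,e,h,f,i,l,j,m,n,p,k,q,s,o,r,t,u], ![a,b,c,d,g,e,h,f,i,l,j,m,p,k,n,q,o,r,s,t,u], ![a,b,c,d,g,e,h,f,i,l,j,m,p,k,n,q,o,s,r,t,u] ]
 else
 if N < 33 then
 [ -- block 32: chambers 512…527, four per line
 ![a,b,c,d,g,e,h,f,i,l,j,m,p,n,k,q,o,s,r,t,u], ![a,b,c,d,g,e,h,f,i,l,j,m,p,n,k,q,s,o,r,t,u], ![a,b,c,d,g,e,h,f,i,l,m,j,k,p,n,o,q,r,s,t,u], ![a,b,c,d,g,e,h,f,i,l,m,j,p,k,n,o,q,r,s,t,u],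
 ![a,b,c,d,g,e,h,f,i,l,m,j,p,k,n,q,o,r,s,t,u], ![a,b,c,d,g,e,h,f,i,l,m,j,p,n,k,q,o,r,s,t,u], ![a,b,c,d,g,e,h,f,i,l,m,j,p,n,k,q,o,s,r,t,u], ![a,b,c,d,g,e,h,f,i,l,m,p,j,k,n,o,q,r,s,t,u],
 ![a,b,c,d,g,e,h,f,i,l,m,p,j,k,n,q,o,r,s,t,u], ![a,b,c,d,g,e,h,f,i,l,m,p,j,n,k,q,o,r,s,t,u], ![a,b,c,d,g,e,h,f,l,i,j,m,k,n,o,p,q,r,s,t,u], ![a,b,c,d,g,e,h,f,l,i,j,m,k,n,o,p,q,s,r,t,u],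
 ![a,b,c,d,g,e,h,f,l,i,j,m,k,n,p,o,q,r,s,t,u], ![a,b,c,d,g,e,h,f,l,i,j,m,k,n,p,o,q,s,r,t,u], ![a,b,c,d,g,e,h,f,l,i,j,m,n,k,o,p,q,s,r,t,u], ![a,b,c,d,g,e,h,f,l,i,j,m,n,k,p,o,q,s,r,t,u] ]
 else
 if N < 34 then
 [ -- block 33: chambers 528…543, four per line
 ![a,b,c,d,g,e,h,f,l,i,j,m,n,k,p,q,o,s,r,t,u], ![a,b,c,d,g,e,h,f,l,i,j,m,n,k,p,q,s,o,r,t,u], ![a,b,c,d,g,e,h,f,l,i,j,m,n,p,k,q,o,s,r,t,u], ![a,b,c,d,g,e,h,f,l,i,j,m,n,p,k,q,s,o,r,t,u],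
 ![a,b,c,d,g,e,h,f,l,i,m,j,k,n,o,p,q,r,s,t,u], ![a,b,c,d,g,e,h,f,l,i,m,j,k,n,p,o,q,r,s,t,u], ![a,b,c,d,g,e,h,f,l,i,m,j,k,p,n,o,q,r,s,t,u], ![a,b,c,d,g,e,h,f,l,i,m,j,n,k,o,p,q,r,s,t,u],
 ![a,b,c,d,g,e,h,f,l,i,m,j,n,k,o,p,q,s,r,t,u], ![a,b,c,d,g,e,h,f,l,i,m,j,n,k,p,o,q,r,s,t,u], ![a,b,c,d,g,e,h,f,l,i,m,j,n,k,p,o,q,s,r,t,u], ![a,b,c,d,g,e,h,f,l,i,m,j,n,p,k,o,q,r,s,t,u],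
 ![a,b,c,d,g,e,h,f,l,i,m,j,n,p,k,o,q,s,r,t,u], ![a,b,c,d,g,e,h,f,l,i,m,j,n,p,k,q,o,s,r,t,u], ![a,b,c,d,g,e,h,f,l,i,m,j,p,k,n,o,q,r,s,t,u], ![a,b,c,d,g,e,h,f,l,i,m,j,p,n,k,o,q,r,s,t,u] ]
 else
 [ -- block 34: chambers 544…559, four per line
 ![a,b,c,d,g,e,h,f,l,i,m,j,p,n,k,q,o,r,s,t,u], ![a,b,c,d,g,e,h,f,l,i,m,j,p,n,k,q,o,s,r,t,u], ![a,b,c,d,g,e,h,f,l,i,m,p,j,k,n,o,q,r,s,t,u], ![a,b,c,d,g,e,h,f,l,i,m,p,j,n,k,o,q,r,s,t,u],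
 ![a,b,c,d,g,e,h,f,l,i,m,p,j,n,k,q,o,r,s,t,u], ![a,b,c,d,g,e,h,i,f,j,l,m,n,p,k,q,s,o,r,t,u], ![a,b,c,d,g,e,h,i,f,j,l,m,n,p,q,k,s,o,r,t,u], ![a,b,c,d,g,e,h,i,f,j,l,m,p,k,n,q,o,r,s,t,u],
 ![a,b,c,d,g,e,h,i,f,j,l,m,p,k,n,q,o,s,r,t,u], ![a,b,c,d,g,e,h,i,f,j,l,m,p,k,n,q,s,o,r,t,u], ![a,b,c,d,g,e,h,i,f,j,l,m,p,n,k,q,s,o,r,t,u], ![a,b,c,d,g,e,h,i,f,j,l,m,p,n,q,k,s,o,r,t,u],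
 ![a,b,c,d,g,e,h,i,f,l,j,m,n,p,k,q,o,s,r,t,u], ![a,b,c,d,g,e,h,i,f,l,j,m,n,p,k,q,s,o,r,t,u], ![a,b,c,d,g,e,h,i,f,l,j,m,n,p,q,k,s,o,r,t,u], ![a,b,c,d,g,e,h,i,f,l,j,m,p,k,n,q,o,r,s,t,u] ]
 else
 if N < 37 then
 if N < 36 then
 [ -- block 35: chambers 560…575, four per line
 ![a,b,c,d,g,e,h,i,f,l,j,m,p,k,n,q,o,s,r,t,u], ![a,b,c,d,g,e,h,i,f,l,j,m,p,n,k,q,o,s,r,t,u], ![a,b,c,d,g,e,h,i,f,l,j,m,p,n,k,q,s,o,r,t,u], ![a,b,c,d,g,e,h,i,f,l,j,m,p,n,q,k,s,o,r,t,u],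
 ![a,b,c,d,g,e,h,i,f,l,m,j,p,k,n,q,o,r,s,t,u], ![a,b,c,d,g,e,h,i,f,l,m,j,p,n,k,q,o,r,s,t,u], ![a,b,c,d,g,e,h,i,f,l,m,j,p,n,k,q,o,s,r,t,u], ![a,b,c,d,g,e,h,i,f,l,m,j,p,n,q,k,o,s,r,t,u],
 ![a,b,c,d,g,e,h,i,f,l,m,j,p,n,q,k,s,o,r,t,u], ![a,b,c,d,g,e,h,i,f,l,m,p,j,k,n,q,o,r,s,t,u], ![a,b,c,d,g,e,h,i,f,l,m,p,j,n,k,q,o,r,s,t,u], ![a,b,c,d,g,e,h,i,f,l,m,p,j,n,q,k,o,r,s,t,u],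
 ![a,b,c,d,g,e,h,i,f,l,m,p,j,n,q,k,o,s,r,t,u], ![a,b,c,d,g,e,h,i,f,l,m,p,j,n,q,k,s,o,r,t,u], ![a,b,c,d,g,e,h,i,j,f,l,m,n,p,q,k,s,o,r,t,u], ![a,b,c,d,g,e,h,i,j,f,l,m,n,p,q,s,k,o,r,t,u] ]
 else
 [ -- block 36: chambers 576…591, four per line
 ![a,b,c,d,g,e,h,i,j,f,l,m,p,n,q,k,s,o,r,t,u], ![a,b,c,d,g,e,h,i,j,f,l,m,p,n,q,s,k,o,r,t,u], ![a,b,c,d,g,e,h,i,j,l,f,m,n,p,q,k,s,o,r,t,u], ![a,b,c,d,g,e,h,i,j,l,f,m,n,p,q,s,k,o,r,t,u],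
 ![a,b,c,d,g,e,h,i,j,l,f,m,p,n,q,k,s,o,r,t,u], ![a,b,c,d,g,e,h,i,j,l,f,m,p,n,q,s,k,o,r,t,u], ![a,b,c,d,g,e,h,i,j,l,m,f,n,p,q,s,k,o,r,t,u], ![a,b,c,d,g,e,h,i,j,l,m,f,p,n,q,k,s,o,r,t,u],
 ![a,b,c,d,g,e,h,i,j,l,m,f,p,n,q,s,k,o,r,t,u], ![a,b,c,d,g,e,h,i,j,l,m,n,f,p,q,s,k,o,r,t,u], ![a,b,c,d,g,e,h,i,j,l,m,n,p,f,q,s,k,o,r,t,u], ![a,b,c,d,g,e,h,i,j,l,m,n,p,q,f,s,k,o,r,t,u],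
 ![a,b,c,d,g,e,h,i,j,l,m,n,p,q,s,f,k,o,r,t,u], ![a,b,c,d,g,e,h,i,j,l,m,p,f,n,q,k,s,o,r,t,u], ![a,b,c,d,g,e,h,i,j,l,m,p,f,n,q,s,k,o,r,t,u], ![a,b,c,d,g,e,h,i,j,l,m,p,n,f,q,s,k,o,r,t,u] ]
 else
 if N < 38 then
 [ -- block 37: chambers 592…607, four per line
 ![a,b,c,d,g,e,h,i,j,l,m,p,n,q,f,s,k,o,r,t,u], ![a,b,c,d,g,e,h,i,j,l,m,p,n,q,s,f,k,o,r,t,u], ![a,b,c,d,g,e,h,i,l,f,j,m,n,p,k,q,o,s,r,t,u], ![a,b,c,d,g,e,h,i,l,f,j,m,n,p,k,q,s,o,r,t,u],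
 ![a,b,c,d,g,e,h,i,l,f,j,m,n,p,q,k,s,o,r,t,u], ![a,b,c,d,g,e,h,i,l,f,j,m,p,n,k,q,o,s,r,t,u], ![a,b,c,d,g,e,h,i,l,f,j,m,p,n,k,q,s,o,r,t,u], ![a,b,c,d,g,e,h,i,l,f,j,m,p,n,q,k,s,o,r,t,u],
 ![a,b,c,d,g,e,h,i,l,f,m,j,p,n,k,q,o,r,s,t,u], ![a,b,c,d,g,e,h,i,l,f,m,j,p,n,k,q,o,s,r,t,u], ![a,b,c,d,g,e,h,i,l,f,m,j,p,n,q,k,o,s,r,t,u], ![a,b,c,d,g,e,h,i,l,f,m,j,p,n,q,k,s,o,r,t,u],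
 ![a,b,c,d,g,e,h,i,l,f,m,p,j,n,k,q,o,r,s,t,u], ![a,b,c,d,g,e,h,i,l,f,m,p,j,n,q,k,o,r,s,t,u], ![a,b,c,d,g,e,h,i,l,f,m,p,j,n,q,k,o,s,r,t,u], ![a,b,c,d,g,e,h,i,l,f,m,p,j,n,q,k,s,o,r,t,u] ]
 else
 if N < 39 then
 [ -- block 38: chambers 608…623, four per line
 ![a,b,c,d,g,e,h,i,l,j,f,m,n,p,q,k,s,o,r,t,u], ![a,b,c,d,g,e,h,i,l,j,f,m,n,p,q,s,k,o,r,t,u], ![a,b,c,d,g,e,h,i,l,j,f,m,p,n,q,k,s,o,r,t,u], ![a,b,c,d,g,e,h,i,l,j,f,m,p,n,q,s,k,o,r,t,u],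
 ![a,b,c,d,g,e,h,i,l,j,m,f,n,p,q,k,s,o,r,t,u], ![a,b,c,d,g,e,h,i,l,j,m,f,n,p,q,s,k,o,r,t,u], ![a,b,c,d,g,e,h,i,l,j,m,f,p,n,q,k,s,o,r,t,u], ![a,b,c,d,g,e,h,i,l,j,m,f,p,n,q,s,k,o,r,t,u],
 ![a,b,c,d,g,e,h,i,l,j,m,n,f,p,q,s,k,o,r,t,u], ![a,b,c,d,g,e,h,i,l,j,m,n,p,f,q,s,k,o,r,t,u], ![a,b,c,d,g,e,h,i,l,j,m,n,p,q,f,s,k,o,r,t,u], ![a,b,c,d,g,e,h,i,l,j,m,n,p,q,s,f,k,o,r,t,u],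
 ![a,b,c,d,g,e,h,i,l,j,m,p,f,n,q,k,s,o,r,t,u], ![a,b,c,d,g,e,h,i,l,j,m,p,f,n,q,s,k,o,r,t,u], ![a,b,c,d,g,e,h,i,l,j,m,p,n,f,q,s,k,o,r,t,u], ![a,b,c,d,g,e,h,i,l,j,m,p,n,q,f,s,k,o,r,t,u] ]
 else
 [ -- block 39: chambers 624…639, four per line
 ![a,b,c,d,g,e,h,i,l,j,m,p,n,q,s,f,k,o,r,t,u], ![a,b,c,d,g,e,h,i,l,m,f,j,p,n,q,k,o,s,r,t,u], ![a,b,c,d,g,e,h,i,l,m,f,j,p,n,q,k,s,o,r,t,u], ![a,b,c,d,g,e,h,i,l,m,f,p,j,n,q,k,o,r,s,t,u],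
 ![a,b,c,d,g,e,h,i,l,m,f,p,j,n,q,k,o,s,r,t,u], ![a,b,c,d,g,e,h,i,l,m,f,p,j,n,q,k,s,o,r,t,u], ![a,b,c,d,g,e,h,i,l,m,j,f,p,n,q,k,s,o,r,t,u], ![a,b,c,d,g,e,h,i,l,m,j,f,p,n,q,s,k,o,r,t,u],
 ![a,b,c,d,g,e,h,i,l,m,j,p,f,n,q,k,s,o,r,t,u], ![a,b,c,d,g,e,h,i,l,m,j,p,f,n,q,s,k,o,r,t,u], ![a,b,c,d,g,e,h,i,l,m,j,p,n,f,q,s,k,o,r,t,u], ![a,b,c,d,g,e,h,i,l,m,j,p,n,q,f,s,k,o,r,t,u],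
 ![a,b,c,d,g,e,h,i,l,m,j,p,n,q,s,f,k,o,r,t,u], ![a,b,c,d,g,e,h,i,l,m,p,f,j,n,q,k,o,r,s,t,u], ![a,b,c,d,g,e,h,i,l,m,p,f,j,n,q,k,o,s,r,t,u], ![a,b,c,d,g,e,h,i,l,m,p,f,j,n,q,k,s,o,r,t,u] ]
 else
 if N < 60 then
 if N < 50 then
 if N < 45 then
 if N < 42 then
 if N < 41 then
 [ -- block 40: chambers 640…655, four per line
 ![a,b,c,d,g,e,h,i,l,m,p,j,f,n,q,k,s,o,r,t,u], ![a,b,c,d,g,e,h,i,l,m,p,j,f,n,q,s,k,o,r,t,u], ![a,b,c,d,g,e,h,i,l,m,p,j,n,f,q,s,k,o,r,t,u], ![a,b,c,d,g,e,h,i,l,m,p,j,n,q,f,s,k,o,r,t,u],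
 ![a,b,c,d,g,e,h,i,l,m,p,j,n,q,s,f,k,o,r,t,u], ![a,b,c,d,g,e,h,l,f,i,j,m,n,k,o,p,q,s,r,t,u], ![a,b,c,d,g,e,h,l,f,i,j,m,n,k,p,o,q,s,r,t,u], ![a,b,c,d,g,e,h,l,f,i,j,m,n,k,p,q,o,s,r,t,u],
 ![a,b,c,d,g,e,h,l,f,i,j,m,n,k,p,q,s,o,r,t,u], ![a,b,c,d,g,e,h,l,f,i,j,m,n,p,k,q,o,s,r,t,u], ![a,b,c,d,g,e,h,l,f,i,j,m,n,p,k,q,s,o,r,t,u], ![a,b,c,d,g,e,h,l,f,i,m,j,n,k,o,p,q,r,s,t,u],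
 ![a,b,c,d,g,e,h,l,f,i,m,j,n,k,o,p,q,s,r,t,u], ![a,b,c,d,g,e,h,l,f,i,m,j,n,k,p,o,q,r,s,t,u], ![a,b,c,d,g,e,h,l,f,i,m,j,n,k,p,o,q,s,r,t,u], ![a,b,c,d,g,e,h,l,f,i,m,j,n,p,k,o,q,r,s,t,u] ]
 else
 [ -- block 41: chambers 656…671, four per line
 ![a,b,c,d,g,e,h,l,f,i,m,j,n,p,k,o,q,s,r,t,u], ![a,b,c,d,g,e,h,l,f,i,m,j,n,p,k,q,o,s,r,t,u], ![a,b,c,d,g,e,h,l,f,i,m,j,p,n,k,o,q,r,s,t,u], ![a,b,c,d,g,e,h,l,f,i,m,j,p,n,k,q,o,r,s,t,u],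
 ![a,b,c,d,g,e,h,l,f,i,m,j,p,n,k,q,o,s,r,t,u], ![a,b,c,d,g,e,h,l,f,i,m,p,j,n,k,o,q,r,s,t,u], ![a,b,c,d,g,e,h,l,f,i,m,p,j,n,k,q,o,r,s,t,u], ![a,b,c,d,g,e,h,l,i,f,j,m,n,p,k,q,o,s,r,t,u],
 ![a,b,c,d,g,e,h,l,i,f,j,m,n,p,k,q,s,o,r,t,u], ![a,b,c,d,g,e,h,l,i,f,j,m,n,p,q,k,s,o,r,t,u], ![a,b,c,d,g,e,h,l,i,f,m,j,n,p,k,q,o,s,r,t,u], ![a,b,c,d,g,e,h,l,i,f,m,j,n,p,q,k,o,s,r,t,u],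
 ![a,b,c,d,g,e,h,l,i,f,m,j,n,p,q,k,s,o,r,t,u], ![a,b,c,d,g,e,h,l,i,f,m,j,p,n,k,q,o,r,s,t,u], ![a,b,c,d,g,e,h,l,i,f,m,j,p,n,k,q,o,s,r,t,u], ![a,b,c,d,g,e,h,l,i,f,m,j,p,n,q,k,o,s,r,t,u] ]
 else
 if N < 43 then
 [ -- block 42: chambers 672…687, four per line
 ![a,b,c,d,g,e,h,l,i,f,m,j,p,n,q,k,s,o,r,t,u], ![a,b,c,d,g,e,h,l,i,f,m,p,j,n,k,q,o,r,s,t,u], ![a,b,c,d,g,e,h,l,i,f,m,p,j,n,q,k,o,r,s,t,u], ![a,b,c,d,g,e,h,l,i,f,m,p,j,n,q,k,o,s,r,t,u],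
 ![a,b,c,d,g,e,h,l,i,j,f,m,n,p,q,k,s,o,r,t,u], ![a,b,c,d,g,e,h,l,i,j,f,m,n,p,q,s,k,o,r,t,u], ![a,b,c,d,g,e,h,l,i,j,m,f,n,p,q,k,s,o,r,t,u], ![a,b,c,d,g,e,h,l,i,j,m,f,n,p,q,s,k,o,r,t,u],
 ![a,b,c,d,g,e,h,l,i,j,m,n,f,p,q,s,k,o,r,t,u], ![a,b,c,d,g,e,h,l,i,j,m,n,p,f,q,s,k,o,r,t,u], ![a,b,c,d,g,e,h,l,i,j,m,n,p,q,f,s,k,o,r,t,u], ![a,b,c,d,g,e,h,l,i,j,m,n,p,q,s,f,k,o,r,t,u],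
 ![a,b,c,d,g,e,h,l,i,m,f,j,n,p,q,k,o,s,r,t,u], ![a,b,c,d,g,e,h,l,i,m,f,j,n,p,q,k,s,o,r,t,u], ![a,b,c,d,g,e,h,l,i,m,f,j,p,n,q,k,o,s,r,t,u], ![a,b,c,d,g,e,h,l,i,m,f,j,p,n,q,k,s,o,r,t,u] ]
 else
 if N < 44 then
 [ -- block 43: chambers 688…703, four per line
 ![a,b,c,d,g,e,h,l,i,m,f,p,j,n,q,k,o,r,s,t,u], ![a,b,c,d,g,e,h,l,i,m,f,p,j,n,q,k,o,s,r,t,u], ![a,b,c,d,g,e,h,l,i,m,f,p,j,n,q,k,s,o,r,t,u], ![a,b,c,d,g,e,h,l,i,m,j,f,n,p,q,k,s,o,r,t,u],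
 ![a,b,c,d,g,e,h,l,i,m,j,f,n,p,q,s,k,o,r,t,u], ![a,b,c,d,g,e,h,l,i,m,j,f,p,n,q,k,s,o,r,t,u], ![a,b,c,d,g,e,h,l,i,m,j,f,p,n,q,s,k,o,r,t,u], ![a,b,c,d,g,e,h,l,i,m,j,n,f,p,q,s,k,o,r,t,u],
 ![a,b,c,d,g,e,h,l,i,m,j,n,p,f,q,s,k,o,r,t,u], ![a,b,c,d,g,e,h,l,i,m,j,n,p,q,f,s,k,o,r,t,u], ![a,b,c,d,g,e,h,l,i,m,j,n,p,q,s,f,k,o,r,t,u], ![a,b,c,d,g,e,h,l,i,m,j,p,f,n,q,k,s,o,r,t,u],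
 ![a,b,c,d,g,e,h,l,i,m,j,p,f,n,q,s,k,o,r,t,u], ![a,b,c,d,g,e,h,l,i,m,j,p,n,f,q,s,k,o,r,t,u], ![a,b,c,d,g,e,h,l,i,m,j,p,n,q,f,s,k,o,r,t,u], ![a,b,c,d,g,e,h,l,i,m,j,p,n,q,s,f,k,o,r,t,u] ]
 else
 [ -- block 44: chambers 704…719, four per line
 ![a,b,c,d,g,e,h,l,i,m,p,f,j,n,q,k,o,r,s,t,u], ![a,b,c,d,g,e,h,l,i,m,p,f,j,n,q,k,o,s,r,t,u], ![a,b,c,d,g,e,h,l,i,m,p,f,j,n,q,k,s,o,r,t,u], ![a,b,c,d,g,e,h,l,i,m,p,j,f,n,q,k,s,o,r,t,u],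
 ![a,b,c,d,g,e,h,l,i,m,p,j,f,n,q,s,k,o,r,t,u], ![a,b,c,d,g,e,h,l,i,m,p,j,n,f,q,s,k,o,r,t,u], ![a,b,c,d,g,e,h,l,i,m,p,j,n,q,f,s,k,o,r,t,u], ![a,b,c,d,g,e,h,l,i,m,p,j,n,q,s,f,k,o,r,t,u],
 ![a,b,c,d,g,h,e,f,i,l,m,j,k,p,n,o,q,r,s,t,u], ![a,b,c,d,g,h,e,f,i,l,m,j,p,k,n,o,q,r,s,t,u], ![a,b,c,d,g,h,e,f,i,l,m,p,j,k,n,o,q,r,s,t,u], ![a,b,c,d,g,h,e,f,l,i,m,j,k,n,o,p,q,r,s,t,u],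
 ![a,b,c,d,g,h,e,f,l,i,m,j,k,n,p,o,q,r,s,t,u], ![a,b,c,d,g,h,e,f,l,i,m,j,k,p,n,o,q,r,s,t,u], ![a,b,c,d,g,h,e,f,l,i,m,j,p,k,n,o,q,r,s,t,u], ![a,b,c,d,g,h,e,f,l,i,m,p,j,k,n,o,q,r,s,t,u] ]
 else
 if N < 47 then
 if N < 46 then
 [ -- block 45: chambers 720…735, four per line
 ![a,b,c,d,g,h,e,i,f,l,m,j,p,k,n,o,q,r,s,t,u], ![a,b,c,d,g,h,e,i,f,l,m,j,p,k,n,q,o,r,s,t,u], ![a,b,c,d,g,h,e,i,f,l,m,p,j,k,n,o,q,r,s,t,u], ![a,b,c,d,g,h,e,i,f,l,m,p,j,k,n,q,o,r,s,t,u],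
 ![a,b,c,d,g,h,e,i,l,f,m,j,p,k,n,o,q,r,s,t,u], ![a,b,c,d,g,h,e,i,l,f,m,j,p,k,n,q,o,r,s,t,u], ![a,b,c,d,g,h,e,i,l,f,m,j,p,n,k,q,o,r,s,t,u], ![a,b,c,d,g,h,e,i,l,f,m,j,p,n,k,q,o,s,r,t,u],
 ![a,b,c,d,g,h,e,i,l,f,m,p,j,k,n,o,q,r,s,t,u], ![a,b,c,d,g,h,e,i,l,f,m,p,j,k,n,q,o,r,s,t,u], ![a,b,c,d,g,h,e,i,l,f,m,p,j,n,k,q,o,r,s,t,u], ![a,b,c,d,g,h,e,i,l,m,f,j,p,n,k,q,o,r,s,t,u],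
 ![a,b,c,d,g,h,e,i,l,m,f,j,p,n,k,q,o,s,r,t,u], ![a,b,c,d,g,h,e,i,l,m,f,j,p,n,q,k,o,s,r,t,u], ![a,b,c,d,g,h,e,i,l,m,f,p,j,n,k,q,o,r,s,t,u], ![a,b,c,d,g,h,e,i,l,m,f,p,j,n,q,k,o,r,s,t,u] ]
 else
 [ -- block 46: chambers 736…751, four per line
 ![a,b,c,d,g,h,e,i,l,m,f,p,j,n,q,k,o,s,r,t,u], ![a,b,c,d,g,h,e,i,l,m,j,f,p,n,q,k,o,s,r,t,u], ![a,b,c,d,g,h,e,i,l,m,j,f,p,n,q,k,s,o,r,t,u], ![a,b,c,d,g,h,e,i,l,m,j,p,f,n,q,k,o,s,r,t,u],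
 ![a,b,c,d,g,h,e,i,l,m,j,p,f,n,q,k,s,o,r,t,u], ![a,b,c,d,g,h,e,i,l,m,j,p,n,f,q,k,s,o,r,t,u], ![a,b,c,d,g,h,e,i,l,m,j,p,n,f,q,s,k,o,r,t,u], ![a,b,c,d,g,h,e,i,l,m,j,p,n,q,f,s,k,o,r,t,u],
 ![a,b,c,d,g,h,e,i,l,m,j,p,n,q,s,f,k,o,r,t,u], ![a,b,c,d,g,h,e,i,l,m,p,f,j,n,q,k,o,r,s,t,u], ![a,b,c,d,g,h,e,i,l,m,p,f,j,n,q,k,o,s,r,t,u], ![a,b,c,d,g,h,e,i,l,m,p,j,f,n,q,k,o,s,r,t,u],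
 ![a,b,c,d,g,h,e,i,l,m,p,j,f,n,q,k,s,o,r,t,u], ![a,b,c,d,g,h,e,i,l,m,p,j,n,f,q,k,s,o,r,t,u], ![a,b,c,d,g,h,e,i,l,m,p,j,n,f,q,s,k,o,r,t,u], ![a,b,c,d,g,h,e,i,l,m,p,j,n,q,f,s,k,o,r,t,u] ]
 else
 if N < 48 then
 [ -- block 47: chambers 752…767, four per line
 ![a,b,c,d,g,h,e,i,l,m,p,j,n,q,s,f,k,o,r,t,u], ![a,b,c,d,g,h,e,l,f,i,m,j,k,n,o,p,q,r,s,t,u], ![a,b,c,d,g,h,e,l,f,i,m,j,k,n,p,o,q,r,s,t,u], ![a,b,c,d,g,h,e,l,f,i,m,j,k,p,n,o,q,r,s,t,u],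
 ![a,b,c,d,g,h,e,l,f,i,m,j,n,k,o,p,q,r,s,t,u], ![a,b,c,d,g,h,e,l,f,i,m,j,n,k,o,p,q,s,r,t,u], ![a,b,c,d,g,h,e,l,f,i,m,j,n,k,p,o,q,r,s,t,u], ![a,b,c,d,g,h,e,l,f,i,m,j,n,k,p,o,q,s,r,t,u],
 ![a,b,c,d,g,h,e,l,f,i,m,j,n,p,k,o,q,r,s,t,u], ![a,b,c,d,g,h,e,l,f,i,m,j,n,p,k,o,q,s,r,t,u], ![a,b,c,d,g,h,e,l,f,i,m,j,p,k,n,o,q,r,s,t,u], ![a,b,c,d,g,h,e,l,f,i,m,j,p,n,k,o,q,r,s,t,u],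
 ![a,b,c,d,g,h,e,l,f,i,m,p,j,k,n,o,q,r,s,t,u], ![a,b,c,d,g,h,e,l,f,i,m,p,j,n,k,o,q,r,s,t,u], ![a,b,c,d,g,h,e,l,i,f,m,j,n,p,k,o,q,r,s,t,u], ![a,b,c,d,g,h,e,l,i,f,m,j,n,p,k,o,q,s,r,t,u] ]
 else
 if N < 49 then
 [ -- block 48: chambers 768…783, four per line
 ![a,b,c,d,g,h,e,l,i,f,m,j,n,p,k,q,o,s,r,t,u], ![a,b,c,d,g,h,e,l,i,f,m,j,p,k,n,o,q,r,s,t,u], ![a,b,c,d,g,h,e,l,i,f,m,j,p,n,k,o,q,r,s,t,u], ![a,b,c,d,g,h,e,l,i,f,m,j,p,n,k,q,o,r,s,t,u],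
 ![a,b,c,d,g,h,e,l,i,f,m,j,p,n,k,q,o,s,r,t,u], ![a,b,c,d,g,h,e,l,i,f,m,p,j,k,n,o,q,r,s,t,u], ![a,b,c,d,g,h,e,l,i,f,m,p,j,n,k,o,q,r,s,t,u], ![a,b,c,d,g,h,e,l,i,f,m,p,j,n,k,q,o,r,s,t,u],
 ![a,b,c,d,g,h,e,l,i,m,f,j,n,p,k,q,o,s,r,t,u], ![a,b,c,d,g,h,e,l,i,m,f,j,n,p,q,k,o,s,r,t,u], ![a,b,c,d,g,h,e,l,i,m,f,j,p,n,k,q,o,r,s,t,u], ![a,b,c,d,g,h,e,l,i,m,f,j,p,n,k,q,o,s,r,t,u],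
 ![a,b,c,d,g,h,e,l,i,m,f,j,p,n,q,k,o,s,r,t,u], ![a,b,c,d,g,h,e,l,i,m,f,p,j,n,k,q,o,r,s,t,u], ![a,b,c,d,g,h,e,l,i,m,f,p,j,n,q,k,o,r,s,t,u], ![a,b,c,d,g,h,e,l,i,m,f,p,j,n,q,k,o,s,r,t,u] ]
 else
 [ -- block 49: chambers 784…799, four per line
 ![a,b,c,d,g,h,e,l,i,m,j,f,n,p,q,k,o,s,r,t,u], ![a,b,c,d,g,h,e,l,i,m,j,f,n,p,q,k,s,o,r,t,u], ![a,b,c,d,g,h,e,l,i,m,j,f,p,n,q,k,o,s,r,t,u], ![a,b,c,d,g,h,e,l,i,m,j,f,p,n,q,k,s,o,r,t,u],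
 ![a,b,c,d,g,h,e,l,i,m,j,n,f,p,q,k,s,o,r,t,u], ![a,b,c,d,g,h,e,l,i,m,j,n,f,p,q,s,k,o,r,t,u], ![a,b,c,d,g,h,e,l,i,m,j,n,p,f,q,k,s,o,r,t,u], ![a,b,c,d,g,h,e,l,i,m,j,n,p,f,q,s,k,o,r,t,u],
 ![a,b,c,d,g,h,e,l,i,m,j,n,p,q,f,s,k,o,r,t,u], ![a,b,c,d,g,h,e,l,i,m,j,n,p,q,s,f,k,o,r,t,u], ![a,b,c,d,g,h,e,l,i,m,j,p,f,n,q,k,o,s,r,t,u], ![a,b,c,d,g,h,e,l,i,m,j,p,f,n,q,k,s,o,r,t,u],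
 ![a,b,c,d,g,h,e,l,i,m,j,p,n,f,q,k,s,o,r,t,u], ![a,b,c,d,g,h,e,l,i,m,j,p,n,f,q,s,k,o,r,t,u], ![a,b,c,d,g,h,e,l,i,m,j,p,n,q,f,s,k,o,r,t,u], ![a,b,c,d,g,h,e,l,i,m,j,p,n,q,s,f,k,o,r,t,u] ]
 else
 if N < 55 then
 if N < 52 then
 if N < 51 then
 [ -- block 50: chambers 800…815, four per line
 ![a,b,c,d,g,h,e,l,i,m,p,f,j,n,q,k,o,r,s,t,u], ![a,b,c,d,g,h,e,l,i,m,p,f,j,n,q,k,o,s,r,t,u], ![a,b,c,d,g,h,e,l,i,m,p,j,f,n,q,k,o,s,r,t,u], ![a,b,c,d,g,h,e,l,i,m,p,j,f,n,q,k,s,o,r,t,u],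
 ![a,b,c,d,g,h,e,l,i,m,p,j,n,f,q,k,s,o,r,t,u], ![a,b,c,d,g,h,e,l,i,m,p,j,n,f,q,s,k,o,r,t,u], ![a,b,c,d,g,h,e,l,i,m,p,j,n,q,f,s,k,o,r,t,u], ![a,b,c,d,g,h,e,l,i,m,p,j,n,q,s,f,k,o,r,t,u],
 ![a,b,c,d,g,h,i,e,f,l,m,p,j,k,n,o,q,r,s,t,u], ![a,b,c,d,g,h,i,e,f,l,m,p,j,k,n,q,o,r,s,t,u], ![a,b,c,d,g,h,i,e,l,f,m,p,j,k,n,o,q,r,s,t,u], ![a,b,c,d,g,h,i,e,l,f,m,p,j,k,n,q,o,r,s,t,u],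
 ![a,b,c,d,g,h,i,e,l,m,f,p,j,k,n,q,o,r,s,t,u], ![a,b,c,d,g,h,i,e,l,m,f,p,j,n,k,q,o,r,s,t,u], ![a,b,c,d,g,h,i,e,l,m,p,f,j,k,n,q,o,r,s,t,u], ![a,b,c,d,g,h,i,e,l,m,p,f,j,n,k,q,o,r,s,t,u] ]
 else
 [ -- block 51: chambers 816…831, four per line
 ![a,b,c,d,g,h,i,e,l,m,p,f,j,n,q,k,o,r,s,t,u], ![a,b,c,d,g,h,i,e,l,m,p,j,f,n,q,k,o,r,s,t,u], ![a,b,c,d,g,h,i,e,l,m,p,j,f,n,q,k,o,s,r,t,u], ![a,b,c,d,g,h,i,e,l,m,p,j,f,n,q,k,s,o,r,t,u],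
 ![a,b,c,d,g,h,i,e,l,m,p,j,n,f,q,k,s,o,r,t,u], ![a,b,c,d,g,h,i,e,l,m,p,j,n,q,f,k,s,o,r,t,u], ![a,b,c,d,g,h,i,e,l,m,p,j,n,q,f,s,k,o,r,t,u], ![a,b,c,d,g,h,i,e,l,m,p,j,n,q,s,f,k,o,r,t,u],
 ![a,b,c,d,g,h,i,l,e,f,m,p,j,k,n,o,q,r,s,t,u], ![a,b,c,d,g,h,i,l,e,m,f,p,j,k,n,o,q,r,s,t,u], ![a,b,c,d,g,h,i,l,e,m,f,p,j,k,n,q,o,r,s,t,u], ![a,b,c,d,g,h,i,l,e,m,f,p,j,n,k,q,o,r,s,t,u],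
 ![a,b,c,d,g,h,i,l,e,m,p,f,j,k,n,q,o,r,s,t,u], ![a,b,c,d,g,h,i,l,e,m,p,f,j,n,k,q,o,r,s,t,u], ![a,b,c,d,g,h,i,l,e,m,p,f,j,n,q,k,o,r,s,t,u], ![a,b,c,d,g,h,i,l,e,m,p,j,f,n,q,k,o,r,s,t,u] ]
 else
 if N < 53 then
 [ -- block 52: chambers 832…847, four per line
 ![a,b,c,d,g,h,i,l,e,m,p,j,f,n,q,k,o,s,r,t,u], ![a,b,c,d,g,h,i,l,e,m,p,j,n,f,q,k,o,s,r,t,u], ![a,b,c,d,g,h,i,l,e,m,p,j,n,f,q,k,s,o,r,t,u], ![a,b,c,d,g,h,i,l,e,m,p,j,n,q,f,k,s,o,r,t,u],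
 ![a,b,c,d,g,h,i,l,e,m,p,j,n,q,f,s,k,o,r,t,u], ![a,b,c,d,g,h,i,l,e,m,p,j,n,q,s,f,k,o,r,t,u], ![a,b,c,d,g,h,i,l,m,e,f,p,j,k,n,o,q,r,s,t,u], ![a,b,c,d,g,h,i,l,m,e,p,f,j,k,n,o,q,r,s,t,u],
 ![a,b,c,d,g,h,i,l,m,e,p,f,j,k,n,q,o,r,s,t,u], ![a,b,c,d,g,h,i,l,m,e,p,f,j,n,k,q,o,r,s,t,u], ![a,b,c,d,g,h,i,l,m,e,p,f,j,n,q,k,o,r,s,t,u], ![a,b,c,d,g,h,i,l,m,e,p,j,f,n,q,k,o,r,s,t,u],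
 ![a,b,c,d,g,h,i,l,m,e,p,j,n,f,q,k,o,r,s,t,u], ![a,b,c,d,g,h,i,l,m,e,p,j,n,f,q,k,o,s,r,t,u], ![a,b,c,d,g,h,i,l,m,e,p,j,n,q,f,k,o,s,r,t,u], ![a,b,c,d,g,h,i,l,m,e,p,j,n,q,f,k,s,o,r,t,u] ]
 else
 if N < 54 then
 [ -- block 53: chambers 848…863, four per line
 ![a,b,c,d,g,h,i,l,m,e,p,j,n,q,f,s,k,o,r,t,u], ![a,b,c,d,g,h,i,l,m,e,p,j,n,q,s,f,k,o,r,t,u], ![a,b,c,d,g,h,i,l,m,p,e,f,j,k,n,o,q,r,s,t,u], ![a,b,c,d,g,h,i,l,m,p,e,f,j,k,n,q,o,r,s,t,u],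
 ![a,b,c,d,g,h,i,l,m,p,e,f,j,n,k,q,o,r,s,t,u], ![a,b,c,d,g,h,i,l,m,p,e,f,j,n,q,k,o,r,s,t,u], ![a,b,c,d,g,h,i,l,m,p,e,j,f,n,q,k,o,r,s,t,u], ![a,b,c,d,g,h,i,l,m,p,e,j,n,f,q,k,o,r,s,t,u],
 ![a,b,c,d,g,h,i,l,m,p,e,j,n,q,f,k,o,r,s,t,u], ![a,b,c,d,g,h,i,l,m,p,e,j,n,q,f,k,o,s,r,t,u], ![a,b,c,d,g,h,i,l,m,p,e,j,n,q,f,k,s,o,r,t,u], ![a,b,c,d,g,h,i,l,m,p,e,j,n,q,f,s,k,o,r,t,u],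
 ![a,b,c,d,g,h,i,l,m,p,e,j,n,q,s,f,k,o,r,t,u], ![a,b,c,d,g,h,l,e,f,i,m,j,k,n,o,p,q,r,s,t,u], ![a,b,c,d,g,h,l,e,f,i,m,j,k,n,p,o,q,r,s,t,u], ![a,b,c,d,g,h,l,e,f,i,m,j,k,p,n,o,q,r,s,t,u] ]
 else
 [ -- block 54: chambers 864…879, four per line
 ![a,b,c,d,g,h,l,e,f,i,m,j,n,k,o,p,q,r,s,t,u], ![a,b,c,d,g,h,l,e,f,i,m,j,n,k,o,p,q,s,r,t,u], ![a,b,c,d,g,h,l,e,f,i,m,j,n,k,p,o,q,r,s,t,u], ![a,b,c,d,g,h,l,e,f,i,m,j,n,k,p,o,q,s,r,t,u],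
 ![a,b,c,d,g,h,l,e,f,i,m,j,n,p,k,o,q,r,s,t,u], ![a,b,c,d,g,h,l,e,f,i,m,j,n,p,k,o,q,s,r,t,u], ![a,b,c,d,g,h,l,e,f,i,m,j,p,k,n,o,q,r,s,t,u], ![a,b,c,d,g,h,l,e,f,i,m,j,p,n,k,o,q,r,s,t,u],
 ![a,b,c,d,g,h,l,e,f,i,m,p,j,k,n,o,q,r,s,t,u], ![a,b,c,d,g,h,l,e,f,i,m,p,j,n,k,o,q,r,s,t,u], ![a,b,c,d,g,h,l,e,i,f,m,j,n,p,k,o,q,r,s,t,u], ![a,b,c,d,g,h,l,e,i,f,m,j,n,p,k,o,q,s,r,t,u],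
 ![a,b,c,d,g,h,l,e,i,f,m,j,p,k,n,o,q,r,s,t,u], ![a,b,c,d,g,h,l,e,i,f,m,j,p,n,k,o,q,r,s,t,u], ![a,b,c,d,g,h,l,e,i,f,m,p,j,k,n,o,q,r,s,t,u], ![a,b,c,d,g,h,l,e,i,f,m,p,j,n,k,o,q,r,s,t,u] ]
 else
 if N < 57 then
 if N < 56 then
 [ -- block 55: chambers 880…895, four per line
 ![a,b,c,d,g,h,l,e,i,m,f,j,n,p,k,o,q,r,s,t,u], ![a,b,c,d,g,h,l,e,i,m,f,j,n,p,k,o,q,s,r,t,u], ![a,b,c,d,g,h,l,e,i,m,f,j,n,p,k,q,o,s,r,t,u], ![a,b,c,d,g,h,l,e,i,m,f,j,n,p,q,k,o,s,r,t,u],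
 ![a,b,c,d,g,h,l,e,i,m,f,j,p,n,k,o,q,r,s,t,u], ![a,b,c,d,g,h,l,e,i,m,f,j,p,n,k,q,o,r,s,t,u], ![a,b,c,d,g,h,l,e,i,m,f,j,p,n,k,q,o,s,r,t,u], ![a,b,c,d,g,h,l,e,i,m,f,j,p,n,q,k,o,s,r,t,u],
 ![a,b,c,d,g,h,l,e,i,m,f,p,j,n,k,o,q,r,s,t,u], ![a,b,c,d,g,h,l,e,i,m,f,p,j,n,k,q,o,r,s,t,u], ![a,b,c,d,g,h,l,e,i,m,f,p,j,n,q,k,o,r,s,t,u], ![a,b,c,d,g,h,l,e,i,m,f,p,j,n,q,k,o,s,r,t,u],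
 ![a,b,c,d,g,h,l,e,i,m,j,f,n,p,q,k,o,s,r,t,u], ![a,b,c,d,g,h,l,e,i,m,j,f,p,n,q,k,o,s,r,t,u], ![a,b,c,d,g,h,l,e,i,m,j,n,f,p,q,k,o,s,r,t,u], ![a,b,c,d,g,h,l,e,i,m,j,n,f,p,q,k,s,o,r,t,u] ]
 else
 [ -- block 56: chambers 896…911, four per line
 ![a,b,c,d,g,h,l,e,i,m,j,n,f,p,q,s,k,o,r,t,u], ![a,b,c,d,g,h,l,e,i,m,j,n,p,f,q,k,o,s,r,t,u], ![a,b,c,d,g,h,l,e,i,m,j,n,p,f,q,k,s,o,r,t,u], ![a,b,c,d,g,h,l,e,i,m,j,n,p,f,q,s,k,o,r,t,u],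
 ![a,b,c,d,g,h,l,e,i,m,j,n,p,q,f,s,k,o,r,t,u], ![a,b,c,d,g,h,l,e,i,m,j,n,p,q,s,f,k,o,r,t,u], ![a,b,c,d,g,h,l,e,i,m,j,p,f,n,q,k,o,s,r,t,u], ![a,b,c,d,g,h,l,e,i,m,j,p,n,f,q,k,o,s,r,t,u],
 ![a,b,c,d,g,h,l,e,i,m,j,p,n,f,q,k,s,o,r,t,u], ![a,b,c,d,g,h,l,e,i,m,j,p,n,f,q,s,k,o,r,t,u], ![a,b,c,d,g,h,l,e,i,m,j,p,n,q,f,s,k,o,r,t,u], ![a,b,c,d,g,h,l,e,i,m,j,p,n,q,s,f,k,o,r,t,u],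
 ![a,b,c,d,g,h,l,e,i,m,p,f,j,n,q,k,o,r,s,t,u], ![a,b,c,d,g,h,l,e,i,m,p,f,j,n,q,k,o,s,r,t,u], ![a,b,c,d,g,h,l,e,i,m,p,j,f,n,q,k,o,s,r,t,u], ![a,b,c,d,g,h,l,e,i,m,p,j,n,f,q,k,o,s,r,t,u] ]
 else
 if N < 58 then
 [ -- block 57: chambers 912…927, four per line
 ![a,b,c,d,g,h,l,e,i,m,p,j,n,f,q,k,s,o,r,t,u], ![a,b,c,d,g,h,l,e,i,m,p,j,n,f,q,s,k,o,r,t,u], ![a,b,c,d,g,h,l,e,i,m,p,j,n,q,f,s,k,o,r,t,u], ![a,b,c,d,g,h,l,e,i,m,p,j,n,q,s,f,k,o,r,t,u],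
 ![a,b,c,d,g,h,l,i,e,f,m,p,j,k,n,o,q,r,s,t,u], ![a,b,c,d,g,h,l,i,e,m,f,p,j,k,n,o,q,r,s,t,u], ![a,b,c,d,g,h,l,i,e,m,f,p,j,n,k,o,q,r,s,t,u], ![a,b,c,d,g,h,l,i,e,m,f,p,j,n,k,q,o,r,s,t,u],
 ![a,b,c,d,g,h,l,i,e,m,p,f,j,n,k,q,o,r,s,t,u], ![a,b,c,d,g,h,l,i,e,m,p,f,j,n,q,k,o,r,s,t,u], ![a,b,c,d,g,h,l,i,e,m,p,j,f,n,q,k,o,r,s,t,u], ![a,b,c,d,g,h,l,i,e,m,p,j,f,n,q,k,o,s,r,t,u],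
 ![a,b,c,d,g,h,l,i,e,m,p,j,n,f,q,k,o,s,r,t,u], ![a,b,c,d,g,h,l,i,e,m,p,j,n,f,q,k,s,o,r,t,u], ![a,b,c,d,g,h,l,i,e,m,p,j,n,q,f,k,s,o,r,t,u], ![a,b,c,d,g,h,l,i,e,m,p,j,n,q,f,s,k,o,r,t,u] ]
 else
 if N < 59 then
 [ -- block 58: chambers 928…943, four per line
 ![a,b,c,d,g,h,l,i,e,m,p,j,n,q,s,f,k,o,r,t,u], ![a,b,c,d,g,h,l,i,m,e,f,p,j,k,n,o,q,r,s,t,u], ![a,b,c,d,g,h,l,i,m,e,f,p,j,n,k,o,q,r,s,t,u], ![a,b,c,d,g,h,l,i,m,e,p,f,j,k,n,o,q,r,s,t,u],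
 ![a,b,c,d,g,h,l,i,m,e,p,f,j,n,k,o,q,r,s,t,u], ![a,b,c,d,g,h,l,i,m,e,p,f,j,n,k,q,o,r,s,t,u], ![a,b,c,d,g,h,l,i,m,e,p,f,j,n,q,k,o,r,s,t,u], ![a,b,c,d,g,h,l,i,m,e,p,j,f,n,q,k,o,r,s,t,u],
 ![a,b,c,d,g,h,l,i,m,e,p,j,n,f,q,k,o,r,s,t,u], ![a,b,c,d,g,h,l,i,m,e,p,j,n,f,q,k,o,s,r,t,u], ![a,b,c,d,g,h,l,i,m,e,p,j,n,q,f,k,o,s,r,t,u], ![a,b,c,d,g,h,l,i,m,e,p,j,n,q,f,k,s,o,r,t,u],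
 ![a,b,c,d,g,h,l,i,m,e,p,j,n,q,f,s,k,o,r,t,u], ![a,b,c,d,g,h,l,i,m,e,p,j,n,q,s,f,k,o,r,t,u], ![a,b,c,d,g,h,l,i,m,p,e,f,j,k,n,o,q,r,s,t,u], ![a,b,c,d,g,h,l,i,m,p,e,f,j,n,k,o,q,r,s,t,u] ]
 else
 [ -- block 59: chambers 944…959, four per line
 ![a,b,c,d,g,h,l,i,m,p,e,f,j,n,k,q,o,r,s,t,u], ![a,b,c,d,g,h,l,i,m,p,e,f,j,n,q,k,o,r,s,t,u], ![a,b,c,d,g,h,l,i,m,p,e,j,f,n,q,k,o,r,s,t,u], ![a,b,c,d,g,h,l,i,m,p,e,j,n,f,q,k,o,r,s,t,u],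
 ![a,b,c,d,g,h,l,i,m,p,e,j,n,q,f,k,o,r,s,t,u], ![a,b,c,d,g,h,l,i,m,p,e,j,n,q,f,k,o,s,r,t,u], ![a,b,c,d,g,h,l,i,m,p,e,j,n,q,f,k,s,o,r,t,u], ![a,b,c,d,g,h,l,i,m,p,e,j,n,q,f,s,k,o,r,t,u],
 ![a,b,c,d,g,h,l,i,m,p,e,j,n,q,s,f,k,o,r,t,u], ![a,b,c,g,d,e,f,h,i,j,k,l,m,n,o,p,q,r,s,t,u], ![a,b,c,g,d,e,f,h,i,j,k,l,m,n,o,p,q,s,r,t,u], ![a,b,c,g,d,e,f,h,i,j,k,l,m,n,p,o,q,r,s,t,u],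
 ![a,b,c,g,d,e,f,h,i,j,k,l,m,n,p,o,q,s,r,t,u], ![a,b,c,g,d,e,f,h,i,j,k,l,m,n,p,q,o,s,r,t,u], ![a,b,c,g,d,e,f,h,i,j,k,l,m,n,p,q,s,o,r,t,u], ![a,b,c,g,d,e,f,h,i,j,k,l,m,p,n,o,q,r,s,t,u] ]
 else
 if N < 70 then
 if N < 65 then
 if N < 62 then
 if N < 61 then
 [ -- block 60: chambers 960…975, four per line
 ![a,b,c,g,d,e,f,h,i,j,k,l,m,p,n,q,o,r,s,t,u], ![a,b,c,g,d,e,f,h,i,j,k,l,m,p,n,q,o,s,r,t,u], ![a,b,c,g,d,e,f,h,i,j,k,l,m,p,n,q,s,o,r,t,u], ![a,b,c,g,d,e,f,h,i,j,l,k,m,n,o,p,q,r,s,t,u],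
 ![a,b,c,g,d,e,f,h,i,j,l,k,m,n,o,p,q,s,r,t,u], ![a,b,c,g,d,e,f,h,i,j,l,k,m,n,p,o,q,r,s,t,u], ![a,b,c,g,d,e,f,h,i,j,l,k,m,n,p,o,q,s,r,t,u], ![a,b,c,g,d,e,f,h,i,j,l,k,m,n,p,q,o,s,r,t,u],
 ![a,b,c,g,d,e,f,h,i,j,l,k,m,n,p,q,s,o,r,t,u], ![a,b,c,g,d,e,f,h,i,j,l,k,m,p,n,o,q,r,s,t,u], ![a,b,c,g,d,e,f,h,i,j,l,k,m,p,n,q,o,r,s,t,u], ![a,b,c,g,d,e,f,h,i,j,l,k,m,p,n,q,o,s,r,t,u],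
 ![a,b,c,g,d,e,f,h,i,j,l,k,m,p,n,q,s,o,r,t,u], ![a,b,c,g,d,e,f,h,i,l,j,k,m,n,o,p,q,r,s,t,u], ![a,b,c,g,d,e,f,h,i,l,j,k,m,n,o,p,q,s,r,t,u], ![a,b,c,g,d,e,f,h,i,l,j,k,m,n,p,o,q,r,s,t,u] ]
 else
 [ -- block 61: chambers 976…991, four per line
 ![a,b,c,g,d,e,f,h,i,l,j,k,m,n,p,o,q,s,r,t,u], ![a,b,c,g,d,e,f,h,i,l,j,k,m,p,n,o,q,r,s,t,u], ![a,b,c,g,d,e,f,h,l,i,j,k,m,n,o,p,q,r,s,t,u], ![a,b,c,g,d,e,f,h,l,i,j,k,m,n,o,p,q,s,r,t,u],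
 ![a,b,c,g,d,e,h,f,i,j,l,k,m,n,o,p,q,r,s,t,u], ![a,b,c,g,d,e,h,f,i,j,l,k,m,n,o,p,q,s,r,t,u], ![a,b,c,g,d,e,h,f,i,j,l,k,m,n,p,o,q,r,s,t,u], ![a,b,c,g,d,e,h,f,i,j,l,k,m,n,p,o,q,s,r,t,u],
 ![a,b,c,g,d,e,h,f,i,j,l,k,m,n,p,q,o,s,r,t,u], ![a,b,c,g,d,e,h,f,i,j,l,k,m,n,p,q,s,o,r,t,u], ![a,b,c,g,d,e,h,f,i,j,l,k,m,p,n,o,q,r,s,t,u], ![a,b,c,g,d,e,h,f,i,j,l,k,m,p,n,q,o,r,s,t,u],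
 ![a,b,c,g,d,e,h,f,i,j,l,k,m,p,n,q,o,s,r,t,u], ![a,b,c,g,d,e,h,f,i,j,l,k,m,p,n,q,s,o,r,t,u], ![a,b,c,g,d,e,h,f,i,j,l,m,k,n,p,q,o,s,r,t,u], ![a,b,c,g,d,e,h,f,i,j,l,m,k,n,p,q,s,o,r,t,u] ]
 else
 if N < 63 then
 [ -- block 62: chambers 992…1007, four per line
 ![a,b,c,g,d,e,h,f,i,j,l,m,k,p,n,q,o,r,s,t,u], ![a,b,c,g,d,e,h,f,i,j,l,m,k,p,n,q,o,s,r,t,u], ![a,b,c,g,d,e,h,f,i,j,l,m,k,p,n,q,s,o,r,t,u], ![a,b,c,g,d,e,h,f,i,j,l,m,n,k,p,q,s,o,r,t,u],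
 ![a,b,c,g,d,e,h,f,i,l,j,k,m,n,o,p,q,r,s,t,u], ![a,b,c,g,d,e,h,f,i,l,j,k,m,n,o,p,q,s,r,t,u], ![a,b,c,g,d,e,h,f,i,l,j,k,m,n,p,o,q,r,s,t,u], ![a,b,c,g,d,e,h,f,i,l,j,k,m,n,p,o,q,s,r,t,u],
 ![a,b,c,g,d,e,h,f,i,l,j,k,m,p,n,o,q,r,s,t,u], ![a,b,c,g,d,e,h,f,i,l,j,m,k,n,p,o,q,r,s,t,u], ![a,b,c,g,d,e,h,f,i,l,j,m,k,n,p,o,q,s,r,t,u], ![a,b,c,g,d,e,h,f,i,l,j,m,k,n,p,q,o,s,r,t,u],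
 ![a,b,c,g,d,e,h,f,i,l,j,m,k,p,n,o,q,r,s,t,u], ![a,b,c,g,d,e,h,f,i,l,j,m,k,p,n,q,o,r,s,t,u], ![a,b,c,g,d,e,h,f,i,l,j,m,k,p,n,q,o,s,r,t,u], ![a,b,c,g,d,e,h,f,i,l,j,m,n,k,p,q,o,s,r,t,u] ]
 else
 if N < 64 then
 [ -- block 63: chambers 1008…1023, four per line
 ![a,b,c,g,d,e,h,f,i,l,j,m,n,k,p,q,s,o,r,t,u], ![a,b,c,g,d,e,h,f,l,i,j,k,m,n,o,p,q,r,s,t,u], ![a,b,c,g,d,e,h,f,l,i,j,k,m,n,o,p,q,s,r,t,u], ![a,b,c,g,d,e,h,f,l,i,j,m,k,n,o,p,q,r,s,t,u],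
 ![a,b,c,g,d,e,h,f,l,i,j,m,k,n,o,p,q,s,r,t,u], ![a,b,c,g,d,e,h,f,l,i,j,m,k,n,p,o,q,r,s,t,u], ![a,b,c,g,d,e,h,f,l,i,j,m,k,n,p,o,q,s,r,t,u], ![a,b,c,g,d,e,h,f,l,i,j,m,n,k,o,p,q,s,r,t,u],
 ![a,b,c,g,d,e,h,f,l,i,j,m,n,k,p,o,q,s,r,t,u], ![a,b,c,g,d,e,h,f,l,i,j,m,n,k,p,q,o,s,r,t,u], ![a,b,c,g,d,e,h,f,l,i,j,m,n,k,p,q,s,o,r,t,u], ![a,b,c,g,d,e,h,i,f,j,l,m,k,n,p,q,o,s,r,t,u],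
 ![a,b,c,g,d,e,h,i,f,j,l,m,k,n,p,q,s,o,r,t,u], ![a,b,c,g,d,e,h,i,f,j,l,m,k,p,n,q,o,r,s,t,u], ![a,b,c,g,d,e,h,i,f,j,l,m,k,p,n,q,o,s,r,t,u], ![a,b,c,g,d,e,h,i,f,j,l,m,k,p,n,q,s,o,r,t,u] ]
 else
 [ -- block 64: chambers 1024…1039, four per line
 ![a,b,c,g,d,e,h,i,f,j,l,m,n,k,p,q,s,o,r,t,u], ![a,b,c,g,d,e,h,i,f,j,l,m,n,p,k,q,s,o,r,t,u], ![a,b,c,g,d,e,h,i,f,j,l,m,p,k,n,q,o,r,s,t,u], ![a,b,c,g,d,e,h,i,f,j,l,m,p,k,n,q,o,s,r,t,u],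
 ![a,b,c,g,d,e,h,i,f,j,l,m,p,k,n,q,s,o,r,t,u], ![a,b,c,g,d,e,h,i,f,j,l,m,p,n,k,q,s,o,r,t,u], ![a,b,c,g,d,e,h,i,f,l,j,m,k,n,p,q,o,s,r,t,u], ![a,b,c,g,d,e,h,i,f,l,j,m,k,p,n,q,o,r,s,t,u],
 ![a,b,c,g,d,e,h,i,f,l,j,m,k,p,n,q,o,s,r,t,u], ![a,b,c,g,d,e,h,i,f,l,j,m,n,k,p,q,o,s,r,t,u], ![a,b,c,g,d,e,h,i,f,l,j,m,n,k,p,q,s,o,r,t,u], ![a,b,c,g,d,e,h,i,f,l,j,m,n,p,k,q,o,s,r,t,u],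
 ![a,b,c,g,d,e,h,i,f,l,j,m,n,p,k,q,s,o,r,t,u], ![a,b,c,g,d,e,h,i,f,l,j,m,p,k,n,q,o,r,s,t,u], ![a,b,c,g,d,e,h,i,f,l,j,m,p,k,n,q,o,s,r,t,u], ![a,b,c,g,d,e,h,i,f,l,j,m,p,n,k,q,o,s,r,t,u] ]
 else
 if N < 67 then
 if N < 66 then
 [ -- block 65: chambers 1040…1055, four per line
 ![a,b,c,g,d,e,h,i,f,l,j,m,p,n,k,q,s,o,r,t,u], ![a,b,c,g,d,e,h,i,j,f,l,m,n,k,p,q,s,o,r,t,u], ![a,b,c,g,d,e,h,i,j,f,l,m,n,p,k,q,s,o,r,t,u], ![a,b,c,g,d,e,h,i,j,f,l,m,n,p,q,k,s,o,r,t,u],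
 ![a,b,c,g,d,e,h,i,j,f,l,m,n,p,q,s,k,o,r,t,u], ![a,b,c,g,d,e,h,i,j,f,l,m,p,n,k,q,s,o,r,t,u], ![a,b,c,g,d,e,h,i,j,f,l,m,p,n,q,k,s,o,r,t,u], ![a,b,c,g,d,e,h,i,j,f,l,m,p,n,q,s,k,o,r,t,u],
 ![a,b,c,g,d,e,h,i,j,l,f,m,n,k,p,q,s,o,r,t,u], ![a,b,c,g,d,e,h,i,j,l,f,m,n,p,k,q,s,o,r,t,u], ![a,b,c,g,d,e,h,i,j,l,f,m,n,p,q,k,s,o,r,t,u], ![a,b,c,g,d,e,h,i,j,l,f,m,n,p,q,s,k,o,r,t,u],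
 ![a,b,c,g,d,e,h,i,j,l,f,m,p,n,k,q,s,o,r,t,u], ![a,b,c,g,d,e,h,i,j,l,f,m,p,n,q,k,s,o,r,t,u], ![a,b,c,g,d,e,h,i,j,l,f,m,p,n,q,s,k,o,r,t,u], ![a,b,c,g,d,e,h,i,j,l,m,f,n,p,q,k,s,o,r,t,u] ]
 else
 [ -- block 66: chambers 1056…1071, four per line
 ![a,b,c,g,d,e,h,i,j,l,m,f,n,p,q,s,k,o,r,t,u], ![a,b,c,g,d,e,h,i,j,l,m,f,p,n,q,k,s,o,r,t,u], ![a,b,c,g,d,e,h,i,j,l,m,f,p,n,q,s,k,o,r,t,u], ![a,b,c,g,d,e,h,i,j,l,m,n,f,p,q,s,k,o,r,t,u],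
 ![a,b,c,g,d,e,h,i,j,l,m,n,p,f,q,s,k,o,r,t,u], ![a,b,c,g,d,e,h,i,j,l,m,n,p,q,f,s,k,o,r,t,u], ![a,b,c,g,d,e,h,i,j,l,m,n,p,q,s,f,k,o,r,t,u], ![a,b,c,g,d,e,h,i,j,l,m,p,f,n,q,k,s,o,r,t,u],
 ![a,b,c,g,d,e,h,i,j,l,m,p,f,n,q,s,k,o,r,t,u], ![a,b,c,g,d,e,h,i,j,l,m,p,n,f,q,s,k,o,r,t,u], ![a,b,c,g,d,e,h,i,j,l,m,p,n,q,f,s,k,o,r,t,u], ![a,b,c,g,d,e,h,i,j,l,m,p,n,q,s,f,k,o,r,t,u],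
 ![a,b,c,g,d,e,h,i,l,f,j,m,n,k,p,q,o,s,r,t,u], ![a,b,c,g,d,e,h,i,l,f,j,m,n,k,p,q,s,o,r,t,u], ![a,b,c,g,d,e,h,i,l,f,j,m,n,p,k,q,o,s,r,t,u], ![a,b,c,g,d,e,h,i,l,f,j,m,n,p,k,q,s,o,r,t,u] ]
 else
 if N < 68 then
 [ -- block 67: chambers 1072…1087, four per line
 ![a,b,c,g,d,e,h,i,l,f,j,m,p,n,k,q,o,s,r,t,u], ![a,b,c,g,d,e,h,i,l,f,j,m,p,n,k,q,s,o,r,t,u], ![a,b,c,g,d,e,h,i,l,j,f,m,n,k,p,q,s,o,r,t,u], ![a,b,c,g,d,e,h,i,l,j,f,m,n,p,k,q,s,o,r,t,u],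
 ![a,b,c,g,d,e,h,i,l,j,f,m,n,p,q,k,s,o,r,t,u], ![a,b,c,g,d,e,h,i,l,j,f,m,n,p,q,s,k,o,r,t,u], ![a,b,c,g,d,e,h,i,l,j,f,m,p,n,k,q,s,o,r,t,u], ![a,b,c,g,d,e,h,i,l,j,f,m,p,n,q,k,s,o,r,t,u],
 ![a,b,c,g,d,e,h,i,l,j,m,f,n,p,q,k,s,o,r,t,u], ![a,b,c,g,d,e,h,i,l,j,m,f,n,p,q,s,k,o,r,t,u], ![a,b,c,g,d,e,h,i,l,j,m,f,p,n,q,k,s,o,r,t,u], ![a,b,c,g,d,e,h,i,l,j,m,f,p,n,q,s,k,o,r,t,u],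
 ![a,b,c,g,d,e,h,i,l,j,m,n,f,p,q,s,k,o,r,t,u], ![a,b,c,g,d,e,h,i,l,j,m,n,p,f,q,s,k,o,r,t,u], ![a,b,c,g,d,e,h,i,l,j,m,n,p,q,f,s,k,o,r,t,u], ![a,b,c,g,d,e,h,i,l,j,m,n,p,q,s,f,k,o,r,t,u] ]
 else
 if N < 69 then
 [ -- block 68: chambers 1088…1103, four per line
 ![a,b,c,g,d,e,h,i,l,j,m,p,f,n,q,k,s,o,r,t,u], ![a,b,c,g,d,e,h,i,l,j,m,p,f,n,q,s,k,o,r,t,u], ![a,b,c,g,d,e,h,i,l,j,m,p,n,f,q,s,k,o,r,t,u], ![a,b,c,g,d,e,h,i,l,j,m,p,n,q,f,s,k,o,r,t,u],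
 ![a,b,c,g,d,e,h,i,l,j,m,p,n,q,s,f,k,o,r,t,u], ![a,b,c,g,d,e,h,l,f,i,j,m,n,k,o,p,q,s,r,t,u], ![a,b,c,g,d,e,h,l,f,i,j,m,n,k,p,o,q,s,r,t,u], ![a,b,c,g,d,e,h,l,f,i,j,m,n,k,p,q,o,s,r,t,u],
 ![a,b,c,g,d,e,h,l,f,i,j,m,n,k,p,q,s,o,r,t,u], ![a,b,c,g,d,e,h,l,i,f,j,m,n,k,p,q,o,s,r,t,u], ![a,b,c,g,d,e,h,l,i,f,j,m,n,k,p,q,s,o,r,t,u], ![a,b,c,g,d,e,h,l,i,f,j,m,n,p,k,q,o,s,r,t,u],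
 ![a,b,c,g,d,e,h,l,i,f,j,m,n,p,k,q,s,o,r,t,u], ![a,b,c,g,d,e,h,l,i,j,f,m,n,k,p,q,s,o,r,t,u], ![a,b,c,g,d,e,h,l,i,j,f,m,n,p,k,q,s,o,r,t,u], ![a,b,c,g,d,e,h,l,i,j,f,m,n,p,q,k,s,o,r,t,u] ]
 else
 [ -- block 69: chambers 1104…1119, four per line
 ![a,b,c,g,d,e,h,l,i,j,f,m,n,p,q,s,k,o,r,t,u], ![a,b,c,g,d,e,h,l,i,j,m,f,n,p,q,k,s,o,r,t,u], ![a,b,c,g,d,e,h,l,i,j,m,f,n,p,q,s,k,o,r,t,u], ![a,b,c,g,d,e,h,l,i,j,m,n,f,p,q,s,k,o,r,t,u],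
 ![a,b,c,g,d,e,h,l,i,j,m,n,p,f,q,s,k,o,r,t,u], ![a,b,c,g,d,e,h,l,i,j,m,n,p,q,f,s,k,o,r,t,u], ![a,b,c,g,d,e,h,l,i,j,m,n,p,q,s,f,k,o,r,t,u], ![a,b,c,g,d,h,e,f,i,l,j,k,m,n,o,p,q,r,s,t,u],
 ![a,b,c,g,d,h,e,f,i,l,j,k,m,n,o,p,q,s,r,t,u], ![a,b,c,g,d,h,e,f,i,l,j,k,m,n,p,o,q,r,s,t,u], ![a,b,c,g,d,h,e,f,i,l,j,k,m,n,p,o,q,s,r,t,u], ![a,b,c,g,d,h,e,f,i,l,j,k,m,p,n,o,q,r,s,t,u],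
 ![a,b,c,g,d,h,e,f,i,l,j,m,k,n,p,o,q,r,s,t,u], ![a,b,c,g,d,h,e,f,i,l,j,m,k,n,p,o,q,s,r,t,u], ![a,b,c,g,d,h,e,f,i,l,j,m,k,p,n,o,q,r,s,t,u], ![a,b,c,g,d,h,e,f,i,l,m,j,k,p,n,o,q,r,s,t,u] ]
 else
 if N < 75 then
 if N < 72 then
 if N < 71 then
 [ -- block 70: chambers 1120…1135, four per line
 ![a,b,c,g,d,h,e,f,l,i,j,k,m,n,o,p,q,r,s,t,u], ![a,b,c,g,d,h,e,f,l,i,j,k,m,n,o,p,q,s,r,t,u], ![a,b,c,g,d,h,e,f,l,i,j,m,k,n,o,p,q,r,s,t,u], ![a,b,c,g,d,h,e,f,l,i,j,m,k,n,o,p,q,s,r,t,u],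
 ![a,b,c,g,d,h,e,f,l,i,j,m,k,n,p,o,q,r,s,t,u], ![a,b,c,g,d,h,e,f,l,i,j,m,k,n,p,o,q,s,r,t,u], ![a,b,c,g,d,h,e,f,l,i,m,j,k,n,o,p,q,r,s,t,u], ![a,b,c,g,d,h,e,f,l,i,m,j,k,n,p,o,q,r,s,t,u],
 ![a,b,c,g,d,h,e,f,l,i,m,j,k,p,n,o,q,r,s,t,u], ![a,b,c,g,d,h,e,i,f,l,j,m,k,n,p,o,q,r,s,t,u], ![a,b,c,g,d,h,e,i,f,l,j,m,k,n,p,o,q,s,r,t,u], ![a,b,c,g,d,h,e,i,f,l,j,m,k,n,p,q,o,s,r,t,u],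
 ![a,b,c,g,d,h,e,i,f,l,j,m,k,p,n,o,q,r,s,t,u], ![a,b,c,g,d,h,e,i,f,l,j,m,k,p,n,q,o,r,s,t,u], ![a,b,c,g,d,h,e,i,f,l,j,m,k,p,n,q,o,s,r,t,u], ![a,b,c,g,d,h,e,i,f,l,j,m,p,k,n,q,o,r,s,t,u] ]
 else
 [ -- block 71: chambers 1136…1151, four per line
 ![a,b,c,g,d,h,e,i,f,l,j,m,p,k,n,q,o,s,r,t,u], ![a,b,c,g,d,h,e,i,f,l,m,j,k,p,n,o,q,r,s,t,u], ![a,b,c,g,d,h,e,i,f,l,m,j,p,k,n,o,q,r,s,t,u], ![a,b,c,g,d,h,e,i,f,l,m,j,p,k,n,q,o,r,s,t,u],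
 ![a,b,c,g,d,h,e,i,l,f,j,m,k,n,p,o,q,r,s,t,u], ![a,b,c,g,d,h,e,i,l,f,j,m,k,n,p,o,q,s,r,t,u], ![a,b,c,g,d,h,e,i,l,f,j,m,k,n,p,q,o,s,r,t,u], ![a,b,c,g,d,h,e,i,l,f,j,m,k,p,n,o,q,r,s,t,u],
 ![a,b,c,g,d,h,e,i,l,f,j,m,k,p,n,q,o,r,s,t,u], ![a,b,c,g,d,h,e,i,l,f,j,m,k,p,n,q,o,s,r,t,u], ![a,b,c,g,d,h,e,i,l,f,j,m,n,k,p,q,o,s,r,t,u], ![a,b,c,g,d,h,e,i,l,f,j,m,n,p,k,q,o,s,r,t,u],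
 ![a,b,c,g,d,h,e,i,l,f,j,m,p,k,n,q,o,r,s,t,u], ![a,b,c,g,d,h,e,i,l,f,j,m,p,k,n,q,o,s,r,t,u], ![a,b,c,g,d,h,e,i,l,f,j,m,p,n,k,q,o,s,r,t,u], ![a,b,c,g,d,h,e,i,l,f,m,j,k,p,n,o,q,r,s,t,u] ]
 else
 if N < 73 then
 [ -- block 72: chambers 1152…1167, four per line
 ![a,b,c,g,d,h,e,i,l,f,m,j,p,k,n,o,q,r,s,t,u], ![a,b,c,g,d,h,e,i,l,f,m,j,p,k,n,q,o,r,s,t,u], ![a,b,c,g,d,h,e,i,l,f,m,j,p,n,k,q,o,r,s,t,u], ![a,b,c,g,d,h,e,i,l,f,m,j,p,n,k,q,o,s,r,t,u],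
 ![a,b,c,g,d,h,e,i,l,j,f,m,n,k,p,q,o,s,r,t,u], ![a,b,c,g,d,h,e,i,l,j,f,m,n,k,p,q,s,o,r,t,u], ![a,b,c,g,d,h,e,i,l,j,f,m,n,p,k,q,o,s,r,t,u], ![a,b,c,g,d,h,e,i,l,j,f,m,n,p,k,q,s,o,r,t,u],
 ![a,b,c,g,d,h,e,i,l,j,f,m,p,n,k,q,o,s,r,t,u], ![a,b,c,g,d,h,e,i,l,j,f,m,p,n,k,q,s,o,r,t,u], ![a,b,c,g,d,h,e,i,l,j,m,f,n,p,k,q,o,s,r,t,u], ![a,b,c,g,d,h,e,i,l,j,m,f,n,p,k,q,s,o,r,t,u],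
 ![a,b,c,g,d,h,e,i,l,j,m,f,n,p,q,k,s,o,r,t,u], ![a,b,c,g,d,h,e,i,l,j,m,f,p,n,k,q,o,s,r,t,u], ![a,b,c,g,d,h,e,i,l,j,m,f,p,n,k,q,s,o,r,t,u], ![a,b,c,g,d,h,e,i,l,j,m,f,p,n,q,k,s,o,r,t,u] ]
 else
 if N < 74 then
 [ -- block 73: chambers 1168…1183, four per line
 ![a,b,c,g,d,h,e,i,l,j,m,n,f,p,q,k,s,o,r,t,u], ![a,b,c,g,d,h,e,i,l,j,m,n,f,p,q,s,k,o,r,t,u], ![a,b,c,g,d,h,e,i,l,j,m,n,p,f,q,k,s,o,r,t,u], ![a,b,c,g,d,h,e,i,l,j,m,n,p,f,q,s,k,o,r,t,u],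
 ![a,b,c,g,d,h,e,i,l,j,m,n,p,q,f,s,k,o,r,t,u], ![a,b,c,g,d,h,e,i,l,j,m,n,p,q,s,f,k,o,r,t,u], ![a,b,c,g,d,h,e,i,l,j,m,p,f,n,q,k,s,o,r,t,u], ![a,b,c,g,d,h,e,i,l,j,m,p,n,f,q,k,s,o,r,t,u],
 ![a,b,c,g,d,h,e,i,l,j,m,p,n,f,q,s,k,o,r,t,u], ![a,b,c,g,d,h,e,i,l,j,m,p,n,q,f,s,k,o,r,t,u], ![a,b,c,g,d,h,e,i,l,j,m,p,n,q,s,f,k,o,r,t,u], ![a,b,c,g,d,h,e,i,l,m,f,j,p,n,k,q,o,r,s,t,u],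
 ![a,b,c,g,d,h,e,i,l,m,f,j,p,n,k,q,o,s,r,t,u], ![a,b,c,g,d,h,e,i,l,m,j,f,p,n,k,q,o,s,r,t,u], ![a,b,c,g,d,h,e,i,l,m,j,f,p,n,q,k,o,s,r,t,u], ![a,b,c,g,d,h,e,i,l,m,j,f,p,n,q,k,s,o,r,t,u] ]
 else
 [ -- block 74: chambers 1184…1199, four per line
 ![a,b,c,g,d,h,e,i,l,m,j,p,f,n,q,k,o,s,r,t,u], ![a,b,c,g,d,h,e,i,l,m,j,p,f,n,q,k,s,o,r,t,u], ![a,b,c,g,d,h,e,i,l,m,j,p,n,f,q,k,s,o,r,t,u], ![a,b,c,g,d,h,e,i,l,m,j,p,n,f,q,s,k,o,r,t,u],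
 ![a,b,c,g,d,h,e,i,l,m,j,p,n,q,f,s,k,o,r,t,u], ![a,b,c,g,d,h,e,i,l,m,j,p,n,q,s,f,k,o,r,t,u], ![a,b,c,g,d,h,e,l,f,i,j,m,k,n,o,p,q,r,s,t,u], ![a,b,c,g,d,h,e,l,f,i,j,m,k,n,o,p,q,s,r,t,u],
 ![a,b,c,g,d,h,e,l,f,i,j,m,k,n,p,o,q,r,s,t,u], ![a,b,c,g,d,h,e,l,f,i,j,m,k,n,p,o,q,s,r,t,u], ![a,b,c,g,d,h,e,l,f,i,j,m,n,k,o,p,q,s,r,t,u], ![a,b,c,g,d,h,e,l,f,i,j,m,n,k,p,o,q,s,r,t,u],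
 ![a,b,c,g,d,h,e,l,f,i,m,j,k,n,o,p,q,r,s,t,u], ![a,b,c,g,d,h,e,l,f,i,m,j,k,n,p,o,q,r,s,t,u], ![a,b,c,g,d,h,e,l,f,i,m,j,k,p,n,o,q,r,s,t,u], ![a,b,c,g,d,h,e,l,f,i,m,j,n,k,o,p,q,r,s,t,u] ]
 else
 if N < 78 then
 if N < 76 then
 [ -- block 75: chambers 1200…1215, four per line
 ![a,b,c,g,d,h,e,l,f,i,m,j,n,k,o,p,q,s,r,t,u], ![a,b,c,g,d,h,e,l,f,i,m,j,n,k,p,o,q,r,s,t,u], ![a,b,c,g,d,h,e,l,f,i,m,j,n,k,p,o,q,s,r,t,u], ![a,b,c,g,d,h,e,l,i,f,j,m,k,n,p,o,q,r,s,t,u],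
 ![a,b,c,g,d,h,e,l,i,f,j,m,k,n,p,o,q,s,r,t,u], ![a,b,c,g,d,h,e,l,i,f,j,m,n,k,p,o,q,s,r,t,u], ![a,b,c,g,d,h,e,l,i,f,j,m,n,k,p,q,o,s,r,t,u], ![a,b,c,g,d,h,e,l,i,f,j,m,n,p,k,q,o,s,r,t,u],
 ![a,b,c,g,d,h,e,l,i,f,m,j,k,n,p,o,q,r,s,t,u], ![a,b,c,g,d,h,e,l,i,f,m,j,k,p,n,o,q,r,s,t,u], ![a,b,c,g,d,h,e,l,i,f,m,j,n,k,p,o,q,r,s,t,u], ![a,b,c,g,d,h,e,l,i,f,m,j,n,k,p,o,q,s,r,t,u],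
 ![a,b,c,g,d,h,e,l,i,f,m,j,n,p,k,o,q,r,s,t,u], ![a,b,c,g,d,h,e,l,i,f,m,j,n,p,k,o,q,s,r,t,u], ![a,b,c,g,d,h,e,l,i,f,m,j,n,p,k,q,o,s,r,t,u], ![a,b,c,g,d,h,e,l,i,f,m,j,p,k,n,o,q,r,s,t,u] ]
 else
 if N < 77 then
 [ -- block 76: chambers 1216…1231, four per line
 ![a,b,c,g,d,h,e,l,i,f,m,j,p,n,k,o,q,r,s,t,u], ![a,b,c,g,d,h,e,l,i,f,m,j,p,n,k,q,o,r,s,t,u], ![a,b,c,g,d,h,e,l,i,f,m,j,p,n,k,q,o,s,r,t,u], ![a,b,c,g,d,h,e,l,i,j,f,m,n,k,p,q,o,s,r,t,u],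
 ![a,b,c,g,d,h,e,l,i,j,f,m,n,k,p,q,s,o,r,t,u], ![a,b,c,g,d,h,e,l,i,j,f,m,n,p,k,q,o,s,r,t,u], ![a,b,c,g,d,h,e,l,i,j,f,m,n,p,k,q,s,o,r,t,u], ![a,b,c,g,d,h,e,l,i,j,m,f,n,p,k,q,o,s,r,t,u],
 ![a,b,c,g,d,h,e,l,i,j,m,f,n,p,k,q,s,o,r,t,u], ![a,b,c,g,d,h,e,l,i,j,m,f,n,p,q,k,s,o,r,t,u], ![a,b,c,g,d,h,e,l,i,j,m,n,f,p,q,k,s,o,r,t,u], ![a,b,c,g,d,h,e,l,i,j,m,n,f,p,q,s,k,o,r,t,u],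
 ![a,b,c,g,d,h,e,l,i,j,m,n,p,f,q,k,s,o,r,t,u], ![a,b,c,g,d,h,e,l,i,j,m,n,p,f,q,s,k,o,r,t,u], ![a,b,c,g,d,h,e,l,i,j,m,n,p,q,f,s,k,o,r,t,u], ![a,b,c,g,d,h,e,l,i,j,m,n,p,q,s,f,k,o,r,t,u] ]
 else
 [ -- block 77: chambers 1232…1247, four per line
 ![a,b,c,g,d,h,e,l,i,m,f,j,n,p,k,q,o,s,r,t,u], ![a,b,c,g,d,h,e,l,i,m,f,j,p,n,k,q,o,r,s,t,u], ![a,b,c,g,d,h,e,l,i,m,f,j,p,n,k,q,o,s,r,t,u], ![a,b,c,g,d,h,e,l,i,m,j,f,n,p,k,q,o,s,r,t,u],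
 ![a,b,c,g,d,h,e,l,i,m,j,f,n,p,q,k,o,s,r,t,u], ![a,b,c,g,d,h,e,l,i,m,j,f,n,p,q,k,s,o,r,t,u], ![a,b,c,g,d,h,e,l,i,m,j,f,p,n,k,q,o,s,r,t,u], ![a,b,c,g,d,h,e,l,i,m,j,f,p,n,q,k,o,s,r,t,u],
 ![a,b,c,g,d,h,e,l,i,m,j,f,p,n,q,k,s,o,r,t,u], ![a,b,c,g,d,h,e,l,i,m,j,n,f,p,q,k,s,o,r,t,u], ![a,b,c,g,d,h,e,l,i,m,j,n,f,p,q,s,k,o,r,t,u], ![a,b,c,g,d,h,e,l,i,m,j,n,p,f,q,k,s,o,r,t,u],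
 ![a,b,c,g,d,h,e,l,i,m,j,n,p,f,q,s,k,o,r,t,u], ![a,b,c,g,d,h,e,l,i,m,j,n,p,q,f,s,k,o,r,t,u], ![a,b,c,g,d,h,e,l,i,m,j,n,p,q,s,f,k,o,r,t,u], ![a,b,c,g,d,h,e,l,i,m,j,p,f,n,q,k,o,s,r,t,u] ]
 else
 if N < 79 then
 [ -- block 78: chambers 1248…1263, four per line
 ![a,b,c,g,d,h,e,l,i,m,j,p,f,n,q,k,s,o,r,t,u], ![a,b,c,g,d,h,e,l,i,m,j,p,n,f,q,k,s,o,r,t,u], ![a,b,c,g,d,h,e,l,i,m,j,p,n,f,q,s,k,o,r,t,u], ![a,b,c,g,d,h,e,l,i,m,j,p,n,q,f,s,k,o,r,t,u],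
 ![a,b,c,g,d,h,e,l,i,m,j,p,n,q,s,f,k,o,r,t,u], ![a,b,c,g,d,h,i,e,f,l,m,j,k,p,n,o,q,r,s,t,u], ![a,b,c,g,d,h,i,e,f,l,m,j,p,k,n,o,q,r,s,t,u], ![a,b,c,g,d,h,i,e,f,l,m,j,p,k,n,q,o,r,s,t,u],
 ![a,b,c,g,d,h,i,e,f,l,m,p,j,k,n,o,q,r,s,t,u], ![a,b,c,g,d,h,i,e,f,l,m,p,j,k,n,q,o,r,s,t,u], ![a,b,c,g,d,h,i,e,l,f,m,j,k,p,n,o,q,r,s,t,u], ![a,b,c,g,d,h,i,e,l,f,m,j,p,k,n,o,q,r,s,t,u],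
 ![a,b,c,g,d,h,i,e,l,f,m,j,p,k,n,q,o,r,s,t,u], ![a,b,c,g,d,h,i,e,l,f,m,p,j,k,n,o,q,r,s,t,u], ![a,b,c,g,d,h,i,e,l,f,m,p,j,k,n,q,o,r,s,t,u], ![a,b,c,g,d,h,i,e,l,m,f,j,p,k,n,q,o,r,s,t,u] ]
 else
 if N < 80 then
 [ -- block 79: chambers 1264…1279, four per line
 ![a,b,c,g,d,h,i,e,l,m,f,j,p,n,k,q,o,r,s,t,u], ![a,b,c,g,d,h,i,e,l,m,f,p,j,k,n,q,o,r,s,t,u], ![a,b,c,g,d,h,i,e,l,m,f,p,j,n,k,q,o,r,s,t,u], ![a,b,c,g,d,h,i,e,l,m,j,f,p,n,k,q,o,r,s,t,u],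
 ![a,b,c,g,d,h,i,e,l,m,j,f,p,n,k,q,o,s,r,t,u], ![a,b,c,g,d,h,i,e,l,m,j,p,f,n,k,q,o,r,s,t,u], ![a,b,c,g,d,h,i,e,l,m,j,p,f,n,k,q,o,s,r,t,u], ![a,b,c,g,d,h,i,e,l,m,j,p,f,n,q,k,o,s,r,t,u],
 ![a,b,c,g,d,h,i,e,l,m,j,p,f,n,q,k,s,o,r,t,u], ![a,b,c,g,d,h,i,e,l,m,j,p,n,f,q,k,s,o,r,t,u], ![a,b,c,g,d,h,i,e,l,m,j,p,n,q,f,k,s,o,r,t,u], ![a,b,c,g,d,h,i,e,l,m,j,p,n,q,f,s,k,o,r,t,u],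
 ![a,b,c,g,d,h,i,e,l,m,j,p,n,q,s,f,k,o,r,t,u], ![a,b,c,g,d,h,i,e,l,m,p,f,j,k,n,q,o,r,s,t,u], ![a,b,c,g,d,h,i,e,l,m,p,f,j,n,k,q,o,r,s,t,u], ![a,b,c,g,d,h,i,e,l,m,p,j,f,n,k,q,o,r,s,t,u] ]
 else
 [ -- block 80: chambers 1280…1295, four per line
 ![a,b,c,g,d,h,i,e,l,m,p,j,f,n,q,k,o,r,s,t,u], ![a,b,c,g,d,h,i,e,l,m,p,j,f,n,q,k,o,s,r,t,u], ![a,b,c,g,d,h,i,e,l,m,p,j,f,n,q,k,s,o,r,t,u], ![a,b,c,g,d,h,i,e,l,m,p,j,n,f,q,k,s,o,r,t,u],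
 ![a,b,c,g,d,h,i,e,l,m,p,j,n,q,f,k,s,o,r,t,u], ![a,b,c,g,d,h,i,e,l,m,p,j,n,q,f,s,k,o,r,t,u], ![a,b,c,g,d,h,i,e,l,m,p,j,n,q,s,f,k,o,r,t,u], ![a,b,c,g,d,h,i,l,e,f,m,j,k,p,n,o,q,r,s,t,u],
 ![a,b,c,g,d,h,i,l,e,f,m,j,p,k,n,o,q,r,s,t,u], ![a,b,c,g,d,h,i,l,e,f,m,p,j,k,n,o,q,r,s,t,u], ![a,b,c,g,d,h,i,l,e,m,f,j,p,k,n,o,q,r,s,t,u], ![a,b,c,g,d,h,i,l,e,m,f,j,p,k,n,q,o,r,s,t,u],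
 ![a,b,c,g,d,h,i,l,e,m,f,j,p,n,k,q,o,r,s,t,u], ![a,b,c,g,d,h,i,l,e,m,f,p,j,k,n,o,q,r,s,t,u], ![a,b,c,g,d,h,i,l,e,m,f,p,j,k,n,q,o,r,s,t,u], ![a,b,c,g,d,h,i,l,e,m,f,p,j,n,k,q,o,r,s,t,u] ]
 else
 if N < 122 then
 if N < 101 then
 if N < 91 then
 if N < 86 then
 if N < 83 then
 if N < 82 then
 [ -- block 81: chambers 1296…1311, four per line
 ![a,b,c,g,d,h,i,l,e,m,j,f,p,n,k,q,o,r,s,t,u], ![a,b,c,g,d,h,i,l,e,m,j,f,p,n,k,q,o,s,r,t,u], ![a,b,c,g,d,h,i,l,e,m,j,p,f,n,k,q,o,r,s,t,u], ![a,b,c,g,d,h,i,l,e,m,j,p,f,n,k,q,o,s,r,t,u],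
 ![a,b,c,g,d,h,i,l,e,m,j,p,f,n,q,k,o,s,r,t,u], ![a,b,c,g,d,h,i,l,e,m,j,p,n,f,q,k,o,s,r,t,u], ![a,b,c,g,d,h,i,l,e,m,j,p,n,f,q,k,s,o,r,t,u], ![a,b,c,g,d,h,i,l,e,m,j,p,n,q,f,k,s,o,r,t,u],
 ![a,b,c,g,d,h,i,l,e,m,j,p,n,q,f,s,k,o,r,t,u], ![a,b,c,g,d,h,i,l,e,m,j,p,n,q,s,f,k,o,r,t,u], ![a,b,c,g,d,h,i,l,e,m,p,f,j,k,n,q,o,r,s,t,u], ![a,b,c,g,d,h,i,l,e,m,p,f,j,n,k,q,o,r,s,t,u],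
 ![a,b,c,g,d,h,i,l,e,m,p,j,f,n,k,q,o,r,s,t,u], ![a,b,c,g,d,h,i,l,e,m,p,j,f,n,q,k,o,r,s,t,u], ![a,b,c,g,d,h,i,l,e,m,p,j,f,n,q,k,o,s,r,t,u], ![a,b,c,g,d,h,i,l,e,m,p,j,n,f,q,k,o,s,r,t,u] ]
 else
 [ -- block 82: chambers 1312…1327, four per line
 ![a,b,c,g,d,h,i,l,e,m,p,j,n,f,q,k,s,o,r,t,u], ![a,b,c,g,d,h,i,l,e,m,p,j,n,q,f,k,s,o,r,t,u], ![a,b,c,g,d,h,i,l,e,m,p,j,n,q,f,s,k,o,r,t,u], ![a,b,c,g,d,h,i,l,e,m,p,j,n,q,s,f,k,o,r,t,u],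
 ![a,b,c,g,d,h,i,l,m,e,f,p,j,k,n,o,q,r,s,t,u], ![a,b,c,g,d,h,i,l,m,e,p,f,j,k,n,o,q,r,s,t,u], ![a,b,c,g,d,h,i,l,m,e,p,f,j,k,n,q,o,r,s,t,u], ![a,b,c,g,d,h,i,l,m,e,p,f,j,n,k,q,o,r,s,t,u],
 ![a,b,c,g,d,h,i,l,m,e,p,j,f,n,k,q,o,r,s,t,u], ![a,b,c,g,d,h,i,l,m,e,p,j,f,n,q,k,o,r,s,t,u], ![a,b,c,g,d,h,i,l,m,e,p,j,n,f,q,k,o,r,s,t,u], ![a,b,c,g,d,h,i,l,m,e,p,j,n,f,q,k,o,s,r,t,u],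
 ![a,b,c,g,d,h,i,l,m,e,p,j,n,q,f,k,o,s,r,t,u], ![a,b,c,g,d,h,i,l,m,e,p,j,n,q,f,k,s,o,r,t,u], ![a,b,c,g,d,h,i,l,m,e,p,j,n,q,f,s,k,o,r,t,u], ![a,b,c,g,d,h,i,l,m,e,p,j,n,q,s,f,k,o,r,t,u] ]
 else
 if N < 84 then
 [ -- block 83: chambers 1328…1343, four per line
 ![a,b,c,g,d,h,i,l,m,p,e,f,j,k,n,o,q,r,s,t,u], ![a,b,c,g,d,h,i,l,m,p,e,f,j,k,n,q,o,r,s,t,u], ![a,b,c,g,d,h,i,l,m,p,e,f,j,n,k,q,o,r,s,t,u], ![a,b,c,g,d,h,i,l,m,p,e,j,f,n,k,q,o,r,s,t,u],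
 ![a,b,c,g,d,h,i,l,m,p,e,j,f,n,q,k,o,r,s,t,u], ![a,b,c,g,d,h,i,l,m,p,e,j,n,f,q,k,o,r,s,t,u], ![a,b,c,g,d,h,i,l,m,p,e,j,n,q,f,k,o,r,s,t,u], ![a,b,c,g,d,h,i,l,m,p,e,j,n,q,f,k,o,s,r,t,u],
 ![a,b,c,g,d,h,i,l,m,p,e,j,n,q,f,k,s,o,r,t,u], ![a,b,c,g,d,h,i,l,m,p,e,j,n,q,f,s,k,o,r,t,u], ![a,b,c,g,d,h,i,l,m,p,e,j,n,q,s,f,k,o,r,t,u], ![a,b,c,g,d,h,l,e,f,i,m,j,k,n,o,p,q,r,s,t,u],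
 ![a,b,c,g,d,h,l,e,f,i,m,j,k,n,p,o,q,r,s,t,u], ![a,b,c,g,d,h,l,e,f,i,m,j,k,p,n,o,q,r,s,t,u], ![a,b,c,g,d,h,l,e,f,i,m,j,n,k,o,p,q,r,s,t,u], ![a,b,c,g,d,h,l,e,f,i,m,j,n,k,o,p,q,s,r,t,u] ]
 else
 if N < 85 then
 [ -- block 84: chambers 1344…1359, four per line
 ![a,b,c,g,d,h,l,e,f,i,m,j,n,k,p,o,q,r,s,t,u], ![a,b,c,g,d,h,l,e,f,i,m,j,n,k,p,o,q,s,r,t,u], ![a,b,c,g,d,h,l,e,i,f,m,j,k,n,p,o,q,r,s,t,u], ![a,b,c,g,d,h,l,e,i,f,m,j,k,p,n,o,q,r,s,t,u],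
 ![a,b,c,g,d,h,l,e,i,f,m,j,n,k,p,o,q,r,s,t,u], ![a,b,c,g,d,h,l,e,i,f,m,j,n,k,p,o,q,s,r,t,u], ![a,b,c,g,d,h,l,e,i,f,m,j,n,p,k,o,q,r,s,t,u], ![a,b,c,g,d,h,l,e,i,f,m,j,n,p,k,o,q,s,r,t,u],
 ![a,b,c,g,d,h,l,e,i,f,m,j,p,k,n,o,q,r,s,t,u], ![a,b,c,g,d,h,l,e,i,f,m,j,p,n,k,o,q,r,s,t,u], ![a,b,c,g,d,h,l,e,i,m,f,j,n,p,k,o,q,r,s,t,u], ![a,b,c,g,d,h,l,e,i,m,f,j,n,p,k,o,q,s,r,t,u],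
 ![a,b,c,g,d,h,l,e,i,m,f,j,n,p,k,q,o,s,r,t,u], ![a,b,c,g,d,h,l,e,i,m,f,j,p,n,k,o,q,r,s,t,u], ![a,b,c,g,d,h,l,e,i,m,f,j,p,n,k,q,o,r,s,t,u], ![a,b,c,g,d,h,l,e,i,m,f,j,p,n,k,q,o,s,r,t,u] ]
 else
 [ -- block 85: chambers 1360…1375, four per line
 ![a,b,c,g,d,h,l,e,i,m,j,f,n,p,k,q,o,s,r,t,u], ![a,b,c,g,d,h,l,e,i,m,j,f,n,p,q,k,o,s,r,t,u], ![a,b,c,g,d,h,l,e,i,m,j,f,p,n,k,q,o,s,r,t,u], ![a,b,c,g,d,h,l,e,i,m,j,f,p,n,q,k,o,s,r,t,u],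
 ![a,b,c,g,d,h,l,e,i,m,j,n,f,p,q,k,o,s,r,t,u], ![a,b,c,g,d,h,l,e,i,m,j,n,f,p,q,k,s,o,r,t,u], ![a,b,c,g,d,h,l,e,i,m,j,n,f,p,q,s,k,o,r,t,u], ![a,b,c,g,d,h,l,e,i,m,j,n,p,f,q,k,o,s,r,t,u],
 ![a,b,c,g,d,h,l,e,i,m,j,n,p,f,q,k,s,o,r,t,u], ![a,b,c,g,d,h,l,e,i,m,j,n,p,f,q,s,k,o,r,t,u], ![a,b,c,g,d,h,l,e,i,m,j,n,p,q,f,s,k,o,r,t,u], ![a,b,c,g,d,h,l,e,i,m,j,n,p,q,s,f,k,o,r,t,u],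
 ![a,b,c,g,d,h,l,e,i,m,j,p,f,n,q,k,o,s,r,t,u], ![a,b,c,g,d,h,l,e,i,m,j,p,n,f,q,k,o,s,r,t,u], ![a,b,c,g,d,h,l,e,i,m,j,p,n,f,q,k,s,o,r,t,u], ![a,b,c,g,d,h,l,e,i,m,j,p,n,f,q,s,k,o,r,t,u] ]
 else
 if N < 88 then
 if N < 87 then
 [ -- block 86: chambers 1376…1391, four per line
 ![a,b,c,g,d,h,l,e,i,m,j,p,n,q,f,s,k,o,r,t,u], ![a,b,c,g,d,h,l,e,i,m,j,p,n,q,s,f,k,o,r,t,u], ![a,b,c,g,d,h,l,i,e,f,m,j,k,p,n,o,q,r,s,t,u], ![a,b,c,g,d,h,l,i,e,f,m,j,p,k,n,o,q,r,s,t,u],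
 ![a,b,c,g,d,h,l,i,e,f,m,p,j,k,n,o,q,r,s,t,u], ![a,b,c,g,d,h,l,i,e,m,f,j,p,k,n,o,q,r,s,t,u], ![a,b,c,g,d,h,l,i,e,m,f,j,p,n,k,o,q,r,s,t,u], ![a,b,c,g,d,h,l,i,e,m,f,j,p,n,k,q,o,r,s,t,u],
 ![a,b,c,g,d,h,l,i,e,m,f,p,j,k,n,o,q,r,s,t,u], ![a,b,c,g,d,h,l,i,e,m,f,p,j,n,k,o,q,r,s,t,u], ![a,b,c,g,d,h,l,i,e,m,f,p,j,n,k,q,o,r,s,t,u], ![a,b,c,g,d,h,l,i,e,m,j,f,p,n,k,q,o,r,s,t,u],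
 ![a,b,c,g,d,h,l,i,e,m,j,f,p,n,k,q,o,s,r,t,u], ![a,b,c,g,d,h,l,i,e,m,j,p,f,n,k,q,o,r,s,t,u], ![a,b,c,g,d,h,l,i,e,m,j,p,f,n,k,q,o,s,r,t,u], ![a,b,c,g,d,h,l,i,e,m,j,p,f,n,q,k,o,s,r,t,u] ]
 else
 [ -- block 87: chambers 1392…1407, four per line
 ![a,b,c,g,d,h,l,i,e,m,j,p,n,f,q,k,o,s,r,t,u], ![a,b,c,g,d,h,l,i,e,m,j,p,n,f,q,k,s,o,r,t,u], ![a,b,c,g,d,h,l,i,e,m,j,p,n,q,f,k,s,o,r,t,u], ![a,b,c,g,d,h,l,i,e,m,j,p,n,q,f,s,k,o,r,t,u],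
 ![a,b,c,g,d,h,l,i,e,m,j,p,n,q,s,f,k,o,r,t,u], ![a,b,c,g,d,h,l,i,e,m,p,f,j,n,k,q,o,r,s,t,u], ![a,b,c,g,d,h,l,i,e,m,p,j,f,n,k,q,o,r,s,t,u], ![a,b,c,g,d,h,l,i,e,m,p,j,f,n,q,k,o,r,s,t,u],
 ![a,b,c,g,d,h,l,i,e,m,p,j,f,n,q,k,o,s,r,t,u], ![a,b,c,g,d,h,l,i,e,m,p,j,n,f,q,k,o,s,r,t,u], ![a,b,c,g,d,h,l,i,e,m,p,j,n,f,q,k,s,o,r,t,u], ![a,b,c,g,d,h,l,i,e,m,p,j,n,q,f,k,s,o,r,t,u],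
 ![a,b,c,g,d,h,l,i,e,m,p,j,n,q,f,s,k,o,r,t,u], ![a,b,c,g,d,h,l,i,e,m,p,j,n,q,s,f,k,o,r,t,u], ![a,b,c,g,d,h,l,i,m,e,f,p,j,k,n,o,q,r,s,t,u], ![a,b,c,g,d,h,l,i,m,e,f,p,j,n,k,o,q,r,s,t,u] ]
 else
 if N < 89 then
 [ -- block 88: chambers 1408…1423, four per line
 ![a,b,c,g,d,h,l,i,m,e,p,f,j,k,n,o,q,r,s,t,u], ![a,b,c,g,d,h,l,i,m,e,p,f,j,n,k,o,q,r,s,t,u], ![a,b,c,g,d,h,l,i,m,e,p,f,j,n,k,q,o,r,s,t,u], ![a,b,c,g,d,h,l,i,m,e,p,j,f,n,k,q,o,r,s,t,u],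
 ![a,b,c,g,d,h,l,i,m,e,p,j,f,n,q,k,o,r,s,t,u], ![a,b,c,g,d,h,l,i,m,e,p,j,n,f,q,k,o,r,s,t,u], ![a,b,c,g,d,h,l,i,m,e,p,j,n,f,q,k,o,s,r,t,u], ![a,b,c,g,d,h,l,i,m,e,p,j,n,q,f,k,o,s,r,t,u],
 ![a,b,c,g,d,h,l,i,m,e,p,j,n,q,f,k,s,o,r,t,u], ![a,b,c,g,d,h,l,i,m,e,p,j,n,q,f,s,k,o,r,t,u], ![a,b,c,g,d,h,l,i,m,e,p,j,n,q,s,f,k,o,r,t,u], ![a,b,c,g,d,h,l,i,m,p,e,f,j,k,n,o,q,r,s,t,u],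
 ![a,b,c,g,d,h,l,i,m,p,e,f,j,n,k,o,q,r,s,t,u], ![a,b,c,g,d,h,l,i,m,p,e,f,j,n,k,q,o,r,s,t,u], ![a,b,c,g,d,h,l,i,m,p,e,j,f,n,k,q,o,r,s,t,u], ![a,b,c,g,d,h,l,i,m,p,e,j,f,n,q,k,o,r,s,t,u] ]
 else
 if N < 90 then
 [ -- block 89: chambers 1424…1439, four per line
 ![a,b,c,g,d,h,l,i,m,p,e,j,n,f,q,k,o,r,s,t,u], ![a,b,c,g,d,h,l,i,m,p,e,j,n,q,f,k,o,r,s,t,u], ![a,b,c,g,d,h,l,i,m,p,e,j,n,q,f,k,o,s,r,t,u], ![a,b,c,g,d,h,l,i,m,p,e,j,n,q,f,k,s,o,r,t,u],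
 ![a,b,c,g,d,h,l,i,m,p,e,j,n,q,f,s,k,o,r,t,u], ![a,b,c,g,d,h,l,i,m,p,e,j,n,q,s,f,k,o,r,t,u], ![a,b,c,g,h,d,e,f,l,i,j,k,m,n,o,p,q,r,s,t,u], ![a,b,c,g,h,d,e,f,l,i,j,k,m,n,o,p,q,s,r,t,u],
 ![a,b,c,g,h,d,e,l,f,i,j,k,m,n,o,p,q,r,s,t,u], ![a,b,c,g,h,d,e,l,f,i,j,k,m,n,o,p,q,s,r,t,u], ![a,b,c,g,h,d,e,l,f,i,j,m,k,n,o,p,q,r,s,t,u], ![a,b,c,g,h,d,e,l,f,i,j,m,k,n,o,p,q,s,r,t,u],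
 ![a,b,c,g,h,d,e,l,f,i,j,m,n,k,o,p,q,s,r,t,u], ![a,b,c,g,h,d,e,l,i,f,j,m,k,n,o,p,q,r,s,t,u], ![a,b,c,g,h,d,e,l,i,f,j,m,k,n,o,p,q,s,r,t,u], ![a,b,c,g,h,d,e,l,i,f,j,m,k,n,p,o,q,r,s,t,u] ]
 else
 [ -- block 90: chambers 1440…1455, four per line
 ![a,b,c,g,h,d,e,l,i,f,j,m,k,n,p,o,q,s,r,t,u], ![a,b,c,g,h,d,e,l,i,f,j,m,n,k,o,p,q,s,r,t,u], ![a,b,c,g,h,d,e,l,i,f,j,m,n,k,p,o,q,s,r,t,u], ![a,b,c,g,h,d,e,l,i,j,f,m,n,k,o,p,q,s,r,t,u],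
 ![a,b,c,g,h,d,e,l,i,j,f,m,n,k,p,o,q,s,r,t,u], ![a,b,c,g,h,d,e,l,i,j,f,m,n,k,p,q,o,s,r,t,u], ![a,b,c,g,h,d,e,l,i,j,f,m,n,k,p,q,s,o,r,t,u], ![a,b,c,g,h,d,e,l,i,j,m,f,n,k,p,q,o,s,r,t,u],
 ![a,b,c,g,h,d,e,l,i,j,m,f,n,k,p,q,s,o,r,t,u], ![a,b,c,g,h,d,e,l,i,j,m,f,n,p,k,q,o,s,r,t,u], ![a,b,c,g,h,d,e,l,i,j,m,f,n,p,k,q,s,o,r,t,u], ![a,b,c,g,h,d,e,l,i,j,m,n,f,k,p,q,s,o,r,t,u],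
 ![a,b,c,g,h,d,e,l,i,j,m,n,f,p,k,q,s,o,r,t,u], ![a,b,c,g,h,d,e,l,i,j,m,n,f,p,q,k,s,o,r,t,u], ![a,b,c,g,h,d,e,l,i,j,m,n,f,p,q,s,k,o,r,t,u], ![a,b,c,g,h,d,e,l,i,j,m,n,p,f,q,k,s,o,r,t,u] ]
 else
 if N < 96 then
 if N < 93 then
 if N < 92 then
 [ -- block 91: chambers 1456…1471, four per line
 ![a,b,c,g,h,d,e,l,i,j,m,n,p,f,q,s,k,o,r,t,u], ![a,b,c,g,h,d,e,l,i,j,m,n,p,q,f,s,k,o,r,t,u], ![a,b,c,g,h,d,e,l,i,j,m,n,p,q,s,f,k,o,r,t,u], ![a,b,c,g,h,d,l,e,f,i,j,k,m,n,o,p,q,r,s,t,u],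
 ![a,b,c,g,h,d,l,e,f,i,j,k,m,n,o,p,q,s,r,t,u], ![a,b,c,g,h,d,l,e,f,i,j,m,k,n,o,p,q,r,s,t,u], ![a,b,c,g,h,d,l,e,f,i,j,m,k,n,o,p,q,s,r,t,u], ![a,b,c,g,h,d,l,e,f,i,j,m,n,k,o,p,q,s,r,t,u],
 ![a,b,c,g,h,d,l,e,f,i,m,j,k,n,o,p,q,r,s,t,u], ![a,b,c,g,h,d,l,e,f,i,m,j,n,k,o,p,q,r,s,t,u], ![a,b,c,g,h,d,l,e,f,i,m,j,n,k,o,p,q,s,r,t,u], ![a,b,c,g,h,d,l,e,i,f,j,m,k,n,o,p,q,r,s,t,u],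
 ![a,b,c,g,h,d,l,e,i,f,j,m,k,n,o,p,q,s,r,t,u], ![a,b,c,g,h,d,l,e,i,f,j,m,k,n,p,o,q,r,s,t,u], ![a,b,c,g,h,d,l,e,i,f,j,m,k,n,p,o,q,s,r,t,u], ![a,b,c,g,h,d,l,e,i,f,j,m,n,k,o,p,q,s,r,t,u] ]
 else
 [ -- block 92: chambers 1472…1487, four per line
 ![a,b,c,g,h,d,l,e,i,f,j,m,n,k,p,o,q,s,r,t,u], ![a,b,c,g,h,d,l,e,i,f,m,j,k,n,o,p,q,r,s,t,u], ![a,b,c,g,h,d,l,e,i,f,m,j,k,n,p,o,q,r,s,t,u], ![a,b,c,g,h,d,l,e,i,f,m,j,n,k,o,p,q,r,s,t,u],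
 ![a,b,c,g,h,d,l,e,i,f,m,j,n,k,o,p,q,s,r,t,u], ![a,b,c,g,h,d,l,e,i,f,m,j,n,k,p,o,q,r,s,t,u], ![a,b,c,g,h,d,l,e,i,f,m,j,n,k,p,o,q,s,r,t,u], ![a,b,c,g,h,d,l,e,i,j,f,m,n,k,o,p,q,s,r,t,u],
 ![a,b,c,g,h,d,l,e,i,j,f,m,n,k,p,o,q,s,r,t,u], ![a,b,c,g,h,d,l,e,i,j,m,f,n,k,p,o,q,s,r,t,u], ![a,b,c,g,h,d,l,e,i,j,m,f,n,k,p,q,o,s,r,t,u], ![a,b,c,g,h,d,l,e,i,j,m,f,n,p,k,q,o,s,r,t,u],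
 ![a,b,c,g,h,d,l,e,i,j,m,n,f,k,p,q,o,s,r,t,u], ![a,b,c,g,h,d,l,e,i,j,m,n,f,k,p,q,s,o,r,t,u], ![a,b,c,g,h,d,l,e,i,j,m,n,f,p,k,q,o,s,r,t,u], ![a,b,c,g,h,d,l,e,i,j,m,n,f,p,k,q,s,o,r,t,u] ]
 else
 if N < 94 then
 [ -- block 93: chambers 1488…1503, four per line
 ![a,b,c,g,h,d,l,e,i,j,m,n,f,p,q,k,s,o,r,t,u], ![a,b,c,g,h,d,l,e,i,j,m,n,f,p,q,s,k,o,r,t,u], ![a,b,c,g,h,d,l,e,i,j,m,n,p,f,q,k,s,o,r,t,u], ![a,b,c,g,h,d,l,e,i,j,m,n,p,f,q,s,k,o,r,t,u],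
 ![a,b,c,g,h,d,l,e,i,j,m,n,p,q,f,s,k,o,r,t,u], ![a,b,c,g,h,d,l,e,i,j,m,n,p,q,s,f,k,o,r,t,u], ![a,b,c,g,h,d,l,e,i,m,f,j,n,k,p,o,q,r,s,t,u], ![a,b,c,g,h,d,l,e,i,m,f,j,n,k,p,o,q,s,r,t,u],
 ![a,b,c,g,h,d,l,e,i,m,f,j,n,p,k,o,q,r,s,t,u], ![a,b,c,g,h,d,l,e,i,m,f,j,n,p,k,o,q,s,r,t,u], ![a,b,c,g,h,d,l,e,i,m,j,f,n,k,p,o,q,s,r,t,u], ![a,b,c,g,h,d,l,e,i,m,j,f,n,p,k,o,q,s,r,t,u],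
 ![a,b,c,g,h,d,l,e,i,m,j,f,n,p,k,q,o,s,r,t,u], ![a,b,c,g,h,d,l,e,i,m,j,n,f,p,k,q,o,s,r,t,u], ![a,b,c,g,h,d,l,e,i,m,j,n,f,p,q,k,o,s,r,t,u], ![a,b,c,g,h,d,l,e,i,m,j,n,f,p,q,k,s,o,r,t,u] ]
 else
 if N < 95 then
 [ -- block 94: chambers 1504…1519, four per line
 ![a,b,c,g,h,d,l,e,i,m,j,n,f,p,q,s,k,o,r,t,u], ![a,b,c,g,h,d,l,e,i,m,j,n,p,f,q,k,o,s,r,t,u], ![a,b,c,g,h,d,l,e,i,m,j,n,p,f,q,k,s,o,r,t,u], ![a,b,c,g,h,d,l,e,i,m,j,n,p,f,q,s,k,o,r,t,u],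
 ![a,b,c,g,h,d,l,e,i,m,j,n,p,q,f,s,k,o,r,t,u], ![a,b,c,g,h,d,l,e,i,m,j,n,p,q,s,f,k,o,r,t,u], ![a,b,c,g,h,d,l,i,e,f,m,j,k,n,o,p,q,r,s,t,u], ![a,b,c,g,h,d,l,i,e,f,m,j,k,n,p,o,q,r,s,t,u],
 ![a,b,c,g,h,d,l,i,e,f,m,j,k,p,n,o,q,r,s,t,u], ![a,b,c,g,h,d,l,i,e,m,f,j,k,n,p,o,q,r,s,t,u], ![a,b,c,g,h,d,l,i,e,m,f,j,k,p,n,o,q,r,s,t,u], ![a,b,c,g,h,d,l,i,e,m,f,j,n,k,p,o,q,r,s,t,u],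
 ![a,b,c,g,h,d,l,i,e,m,f,j,n,p,k,o,q,r,s,t,u], ![a,b,c,g,h,d,l,i,e,m,f,j,p,k,n,o,q,r,s,t,u], ![a,b,c,g,h,d,l,i,e,m,f,j,p,n,k,o,q,r,s,t,u], ![a,b,c,g,h,d,l,i,e,m,j,f,n,k,p,o,q,r,s,t,u] ]
 else
 [ -- block 95: chambers 1520…1535, four per line
 ![a,b,c,g,h,d,l,i,e,m,j,f,n,k,p,o,q,s,r,t,u], ![a,b,c,g,h,d,l,i,e,m,j,f,n,p,k,o,q,r,s,t,u], ![a,b,c,g,h,d,l,i,e,m,j,f,n,p,k,o,q,s,r,t,u], ![a,b,c,g,h,d,l,i,e,m,j,f,n,p,k,q,o,s,r,t,u],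
 ![a,b,c,g,h,d,l,i,e,m,j,f,p,n,k,o,q,r,s,t,u], ![a,b,c,g,h,d,l,i,e,m,j,f,p,n,k,q,o,r,s,t,u], ![a,b,c,g,h,d,l,i,e,m,j,f,p,n,k,q,o,s,r,t,u], ![a,b,c,g,h,d,l,i,e,m,j,n,f,p,k,q,o,s,r,t,u],
 ![a,b,c,g,h,d,l,i,e,m,j,n,p,f,k,q,o,s,r,t,u], ![a,b,c,g,h,d,l,i,e,m,j,n,p,f,q,k,o,s,r,t,u], ![a,b,c,g,h,d,l,i,e,m,j,n,p,f,q,k,s,o,r,t,u], ![a,b,c,g,h,d,l,i,e,m,j,n,p,q,f,k,s,o,r,t,u],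
 ![a,b,c,g,h,d,l,i,e,m,j,n,p,q,f,s,k,o,r,t,u], ![a,b,c,g,h,d,l,i,e,m,j,n,p,q,s,f,k,o,r,t,u], ![a,b,c,g,h,d,l,i,e,m,j,p,f,n,k,q,o,r,s,t,u], ![a,b,c,g,h,d,l,i,e,m,j,p,f,n,k,q,o,s,r,t,u] ]
 else
 if N < 98 then
 if N < 97 then
 [ -- block 96: chambers 1536…1551, four per line
 ![a,b,c,g,h,d,l,i,e,m,j,p,n,f,k,q,o,s,r,t,u], ![a,b,c,g,h,d,l,i,e,m,j,p,n,f,q,k,o,s,r,t,u], ![a,b,c,g,h,d,l,i,e,m,j,p,n,f,q,k,s,o,r,t,u], ![a,b,c,g,h,d,l,i,e,m,j,p,n,q,f,k,s,o,r,t,u],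
 ![a,b,c,g,h,d,l,i,e,m,j,p,n,q,f,s,k,o,r,t,u], ![a,b,c,g,h,d,l,i,e,m,j,p,n,q,s,f,k,o,r,t,u], ![a,b,c,g,h,d,l,i,m,e,f,j,k,p,n,o,q,r,s,t,u], ![a,b,c,g,h,d,l,i,m,e,f,j,p,k,n,o,q,r,s,t,u],
 ![a,b,c,g,h,d,l,i,m,e,f,j,p,n,k,o,q,r,s,t,u], ![a,b,c,g,h,d,l,i,m,e,f,p,j,k,n,o,q,r,s,t,u], ![a,b,c,g,h,d,l,i,m,e,f,p,j,n,k,o,q,r,s,t,u], ![a,b,c,g,h,d,l,i,m,e,j,f,p,n,k,o,q,r,s,t,u],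
 ![a,b,c,g,h,d,l,i,m,e,j,p,f,n,k,o,q,r,s,t,u], ![a,b,c,g,h,d,l,i,m,e,j,p,f,n,k,q,o,r,s,t,u], ![a,b,c,g,h,d,l,i,m,e,j,p,n,f,k,q,o,r,s,t,u], ![a,b,c,g,h,d,l,i,m,e,j,p,n,f,k,q,o,s,r,t,u] ]
 else
 [ -- block 97: chambers 1552…1567, four per line
 ![a,b,c,g,h,d,l,i,m,e,j,p,n,f,q,k,o,s,r,t,u], ![a,b,c,g,h,d,l,i,m,e,j,p,n,q,f,k,o,s,r,t,u], ![a,b,c,g,h,d,l,i,m,e,j,p,n,q,f,k,s,o,r,t,u], ![a,b,c,g,h,d,l,i,m,e,j,p,n,q,f,s,k,o,r,t,u],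
 ![a,b,c,g,h,d,l,i,m,e,j,p,n,q,s,f,k,o,r,t,u], ![a,b,c,g,h,d,l,i,m,e,p,f,j,k,n,o,q,r,s,t,u], ![a,b,c,g,h,d,l,i,m,e,p,f,j,n,k,o,q,r,s,t,u], ![a,b,c,g,h,d,l,i,m,e,p,j,f,n,k,o,q,r,s,t,u],
 ![a,b,c,g,h,d,l,i,m,e,p,j,f,n,k,q,o,r,s,t,u], ![a,b,c,g,h,d,l,i,m,e,p,j,n,f,k,q,o,r,s,t,u], ![a,b,c,g,h,d,l,i,m,e,p,j,n,f,q,k,o,r,s,t,u], ![a,b,c,g,h,d,l,i,m,e,p,j,n,f,q,k,o,s,r,t,u],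
 ![a,b,c,g,h,d,l,i,m,e,p,j,n,q,f,k,o,s,r,t,u], ![a,b,c,g,h,d,l,i,m,e,p,j,n,q,f,k,s,o,r,t,u], ![a,b,c,g,h,d,l,i,m,e,p,j,n,q,f,s,k,o,r,t,u], ![a,b,c,g,h,d,l,i,m,e,p,j,n,q,s,f,k,o,r,t,u] ]
 else
 if N < 99 then
 [ -- block 98: chambers 1568…1583, four per line
 ![a,b,c,g,h,d,l,i,m,p,e,f,j,k,n,o,q,r,s,t,u], ![a,b,c,g,h,d,l,i,m,p,e,f,j,n,k,o,q,r,s,t,u], ![a,b,c,g,h,d,l,i,m,p,e,j,f,n,k,o,q,r,s,t,u], ![a,b,c,g,h,d,l,i,m,p,e,j,f,n,k,q,o,r,s,t,u],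
 ![a,b,c,g,h,d,l,i,m,p,e,j,n,f,k,q,o,r,s,t,u], ![a,b,c,g,h,d,l,i,m,p,e,j,n,f,q,k,o,r,s,t,u], ![a,b,c,g,h,d,l,i,m,p,e,j,n,q,f,k,o,r,s,t,u], ![a,b,c,g,h,d,l,i,m,p,e,j,n,q,f,k,o,s,r,t,u],
 ![a,b,c,g,h,d,l,i,m,p,e,j,n,q,f,k,s,o,r,t,u], ![a,b,c,g,h,d,l,i,m,p,e,j,n,q,f,s,k,o,r,t,u], ![a,b,c,g,h,d,l,i,m,p,e,j,n,q,s,f,k,o,r,t,u], ![a,b,c,g,h,l,d,e,f,i,j,k,m,n,o,p,q,r,s,t,u],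
 ![a,b,c,g,h,l,d,e,f,i,j,k,m,n,o,p,q,s,r,t,u], ![a,b,c,g,h,l,d,e,f,i,j,m,k,n,o,p,q,r,s,t,u], ![a,b,c,g,h,l,d,e,f,i,j,m,k,n,o,p,q,s,r,t,u], ![a,b,c,g,h,l,d,e,f,i,j,m,n,k,o,p,q,s,r,t,u] ]
 else
 if N < 100 then
 [ -- block 99: chambers 1584…1599, four per line
 ![a,b,c,g,h,l,d,e,f,i,m,j,k,n,o,p,q,r,s,t,u], ![a,b,c,g,h,l,d,e,f,i,m,j,n,k,o,p,q,r,s,t,u], ![a,b,c,g,h,l,d,e,f,i,m,j,n,k,o,p,q,s,r,t,u], ![a,b,c,g,h,l,d,e,i,f,j,m,k,n,o,p,q,r,s,t,u],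
 ![a,b,c,g,h,l,d,e,i,f,j,m,k,n,o,p,q,s,r,t,u], ![a,b,c,g,h,l,d,e,i,f,j,m,n,k,o,p,q,s,r,t,u], ![a,b,c,g,h,l,d,e,i,f,m,j,k,n,o,p,q,r,s,t,u], ![a,b,c,g,h,l,d,e,i,f,m,j,n,k,o,p,q,r,s,t,u],
 ![a,b,c,g,h,l,d,e,i,f,m,j,n,k,o,p,q,s,r,t,u], ![a,b,c,g,h,l,d,e,i,j,f,m,n,k,o,p,q,s,r,t,u], ![a,b,c,g,h,l,d,e,i,j,m,f,n,k,o,p,q,s,r,t,u], ![a,b,c,g,h,l,d,e,i,j,m,f,n,k,p,o,q,s,r,t,u],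
 ![a,b,c,g,h,l,d,e,i,j,m,n,f,k,o,p,q,s,r,t,u], ![a,b,c,g,h,l,d,e,i,j,m,n,f,k,p,o,q,s,r,t,u], ![a,b,c,g,h,l,d,e,i,j,m,n,f,k,p,q,o,s,r,t,u], ![a,b,c,g,h,l,d,e,i,j,m,n,f,k,p,q,s,o,r,t,u] ]
 else
 [ -- block 100: chambers 1600…1615, four per line
 ![a,b,c,g,h,l,d,e,i,j,m,n,f,p,k,q,o,s,r,t,u], ![a,b,c,g,h,l,d,e,i,j,m,n,f,p,k,q,s,o,r,t,u], ![a,b,c,g,h,l,d,e,i,j,m,n,f,p,q,k,s,o,r,t,u], ![a,b,c,g,h,l,d,e,i,j,m,n,f,p,q,s,k,o,r,t,u],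
 ![a,b,c,g,h,l,d,e,i,j,m,n,p,f,q,k,s,o,r,t,u], ![a,b,c,g,h,l,d,e,i,j,m,n,p,f,q,s,k,o,r,t,u], ![a,b,c,g,h,l,d,e,i,j,m,n,p,q,f,s,k,o,r,t,u], ![a,b,c,g,h,l,d,e,i,j,m,n,p,q,s,f,k,o,r,t,u],
 ![a,b,c,g,h,l,d,e,i,m,f,j,n,k,o,p,q,r,s,t,u], ![a,b,c,g,h,l,d,e,i,m,f,j,n,k,o,p,q,s,r,t,u], ![a,b,c,g,h,l,d,e,i,m,f,j,n,k,p,o,q,r,s,t,u], ![a,b,c,g,h,l,d,e,i,m,f,j,n,k,p,o,q,s,r,t,u],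
 ![a,b,c,g,h,l,d,e,i,m,f,j,n,p,k,o,q,r,s,t,u], ![a,b,c,g,h,l,d,e,i,m,f,j,n,p,k,o,q,s,r,t,u], ![a,b,c,g,h,l,d,e,i,m,j,f,n,k,o,p,q,s,r,t,u], ![a,b,c,g,h,l,d,e,i,m,j,f,n,k,p,o,q,s,r,t,u] ]
 else
 if N < 111 then
 if N < 106 then
 if N < 103 then
 if N < 102 then
 [ -- block 101: chambers 1616…1631, four per line
 ![a,b,c,g,h,l,d,e,i,m,j,f,n,p,k,o,q,s,r,t,u], ![a,b,c,g,h,l,d,e,i,m,j,n,f,k,o,p,q,s,r,t,u], ![a,b,c,g,h,l,d,e,i,m,j,n,f,k,p,o,q,s,r,t,u], ![a,b,c,g,h,l,d,e,i,m,j,n,f,p,k,o,q,s,r,t,u],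
 ![a,b,c,g,h,l,d,e,i,m,j,n,f,p,k,q,o,s,r,t,u], ![a,b,c,g,h,l,d,e,i,m,j,n,f,p,q,k,o,s,r,t,u], ![a,b,c,g,h,l,d,e,i,m,j,n,f,p,q,k,s,o,r,t,u], ![a,b,c,g,h,l,d,e,i,m,j,n,f,p,q,s,k,o,r,t,u],
 ![a,b,c,g,h,l,d,e,i,m,j,n,p,f,q,k,o,s,r,t,u], ![a,b,c,g,h,l,d,e,i,m,j,n,p,f,q,k,s,o,r,t,u], ![a,b,c,g,h,l,d,e,i,m,j,n,p,f,q,s,k,o,r,t,u], ![a,b,c,g,h,l,d,e,i,m,j,n,p,q,f,s,k,o,r,t,u],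
 ![a,b,c,g,h,l,d,e,i,m,j,n,p,q,s,f,k,o,r,t,u], ![a,b,c,g,h,l,d,i,e,f,m,j,k,n,o,p,q,r,s,t,u], ![a,b,c,g,h,l,d,i,e,m,f,j,k,n,o,p,q,r,s,t,u], ![a,b,c,g,h,l,d,i,e,m,f,j,k,n,p,o,q,r,s,t,u] ]
 else
 [ -- block 102: chambers 1632…1647, four per line
 ![a,b,c,g,h,l,d,i,e,m,f,j,n,k,o,p,q,r,s,t,u], ![a,b,c,g,h,l,d,i,e,m,f,j,n,k,p,o,q,r,s,t,u], ![a,b,c,g,h,l,d,i,e,m,f,j,n,p,k,o,q,r,s,t,u], ![a,b,c,g,h,l,d,i,e,m,j,f,n,k,o,p,q,r,s,t,u],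
 ![a,b,c,g,h,l,d,i,e,m,j,f,n,k,o,p,q,s,r,t,u], ![a,b,c,g,h,l,d,i,e,m,j,f,n,k,p,o,q,r,s,t,u], ![a,b,c,g,h,l,d,i,e,m,j,f,n,k,p,o,q,s,r,t,u], ![a,b,c,g,h,l,d,i,e,m,j,f,n,p,k,o,q,r,s,t,u],
 ![a,b,c,g,h,l,d,i,e,m,j,f,n,p,k,o,q,s,r,t,u], ![a,b,c,g,h,l,d,i,e,m,j,n,f,k,o,p,q,s,r,t,u], ![a,b,c,g,h,l,d,i,e,m,j,n,f,k,p,o,q,s,r,t,u], ![a,b,c,g,h,l,d,i,e,m,j,n,f,p,k,o,q,s,r,t,u],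
 ![a,b,c,g,h,l,d,i,e,m,j,n,f,p,k,q,o,s,r,t,u], ![a,b,c,g,h,l,d,i,e,m,j,n,p,f,k,q,o,s,r,t,u], ![a,b,c,g,h,l,d,i,e,m,j,n,p,f,q,k,o,s,r,t,u], ![a,b,c,g,h,l,d,i,e,m,j,n,p,f,q,k,s,o,r,t,u] ]
 else
 if N < 104 then
 [ -- block 103: chambers 1648…1663, four per line
 ![a,b,c,g,h,l,d,i,e,m,j,n,p,q,f,k,s,o,r,t,u], ![a,b,c,g,h,l,d,i,e,m,j,n,p,q,f,s,k,o,r,t,u], ![a,b,c,g,h,l,d,i,e,m,j,n,p,q,s,f,k,o,r,t,u], ![a,b,c,g,h,l,d,i,m,e,f,j,k,n,o,p,q,r,s,t,u],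
 ![a,b,c,g,h,l,d,i,m,e,f,j,k,n,p,o,q,r,s,t,u], ![a,b,c,g,h,l,d,i,m,e,f,j,k,p,n,o,q,r,s,t,u], ![a,b,c,g,h,l,d,i,m,e,f,j,n,k,o,p,q,r,s,t,u], ![a,b,c,g,h,l,d,i,m,e,f,j,n,k,p,o,q,r,s,t,u],
 ![a,b,c,g,h,l,d,i,m,e,f,j,n,p,k,o,q,r,s,t,u], ![a,b,c,g,h,l,d,i,m,e,f,j,p,k,n,o,q,r,s,t,u], ![a,b,c,g,h,l,d,i,m,e,f,j,p,n,k,o,q,r,s,t,u], ![a,b,c,g,h,l,d,i,m,e,f,p,j,k,n,o,q,r,s,t,u],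
 ![a,b,c,g,h,l,d,i,m,e,f,p,j,n,k,o,q,r,s,t,u], ![a,b,c,g,h,l,d,i,m,e,j,f,n,k,o,p,q,r,s,t,u], ![a,b,c,g,h,l,d,i,m,e,j,f,n,k,p,o,q,r,s,t,u], ![a,b,c,g,h,l,d,i,m,e,j,f,n,p,k,o,q,r,s,t,u] ]
 else
 if N < 105 then
 [ -- block 104: chambers 1664…1679, four per line
 ![a,b,c,g,h,l,d,i,m,e,j,f,p,n,k,o,q,r,s,t,u], ![a,b,c,g,h,l,d,i,m,e,j,n,f,k,o,p,q,r,s,t,u], ![a,b,c,g,h,l,d,i,m,e,j,n,f,k,o,p,q,s,r,t,u], ![a,b,c,g,h,l,d,i,m,e,j,n,f,k,p,o,q,r,s,t,u],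
 ![a,b,c,g,h,l,d,i,m,e,j,n,f,k,p,o,q,s,r,t,u], ![a,b,c,g,h,l,d,i,m,e,j,n,f,p,k,o,q,r,s,t,u], ![a,b,c,g,h,l,d,i,m,e,j,n,f,p,k,o,q,s,r,t,u], ![a,b,c,g,h,l,d,i,m,e,j,n,p,f,k,o,q,r,s,t,u],
 ![a,b,c,g,h,l,d,i,m,e,j,n,p,f,k,o,q,s,r,t,u], ![a,b,c,g,h,l,d,i,m,e,j,n,p,f,k,q,o,s,r,t,u], ![a,b,c,g,h,l,d,i,m,e,j,n,p,f,q,k,o,s,r,t,u], ![a,b,c,g,h,l,d,i,m,e,j,n,p,q,f,k,o,s,r,t,u],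
 ![a,b,c,g,h,l,d,i,m,e,j,n,p,q,f,k,s,o,r,t,u], ![a,b,c,g,h,l,d,i,m,e,j,n,p,q,f,s,k,o,r,t,u], ![a,b,c,g,h,l,d,i,m,e,j,n,p,q,s,f,k,o,r,t,u], ![a,b,c,g,h,l,d,i,m,e,j,p,f,n,k,o,q,r,s,t,u] ]
 else
 [ -- block 105: chambers 1680…1695, four per line
 ![a,b,c,g,h,l,d,i,m,e,j,p,n,f,k,o,q,r,s,t,u], ![a,b,c,g,h,l,d,i,m,e,j,p,n,f,k,q,o,r,s,t,u], ![a,b,c,g,h,l,d,i,m,e,j,p,n,f,k,q,o,s,r,t,u], ![a,b,c,g,h,l,d,i,m,e,j,p,n,f,q,k,o,s,r,t,u],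
 ![a,b,c,g,h,l,d,i,m,e,j,p,n,q,f,k,o,s,r,t,u], ![a,b,c,g,h,l,d,i,m,e,j,p,n,q,f,k,s,o,r,t,u], ![a,b,c,g,h,l,d,i,m,e,j,p,n,q,f,s,k,o,r,t,u], ![a,b,c,g,h,l,d,i,m,e,j,p,n,q,s,f,k,o,r,t,u],
 ![a,b,c,g,h,l,d,i,m,e,p,f,j,k,n,o,q,r,s,t,u], ![a,b,c,g,h,l,d,i,m,e,p,f,j,n,k,o,q,r,s,t,u], ![a,b,c,g,h,l,d,i,m,e,p,j,f,n,k,o,q,r,s,t,u], ![a,b,c,g,h,l,d,i,m,e,p,j,n,f,k,o,q,r,s,t,u],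
 ![a,b,c,g,h,l,d,i,m,e,p,j,n,f,k,q,o,r,s,t,u], ![a,b,c,g,h,l,d,i,m,e,p,j,n,f,q,k,o,r,s,t,u], ![a,b,c,g,h,l,d,i,m,e,p,j,n,f,q,k,o,s,r,t,u], ![a,b,c,g,h,l,d,i,m,e,p,j,n,q,f,k,o,s,r,t,u] ]
 else
 if N < 108 then
 if N < 107 then
 [ -- block 106: chambers 1696…1711, four per line
 ![a,b,c,g,h,l,d,i,m,e,p,j,n,q,f,k,s,o,r,t,u], ![a,b,c,g,h,l,d,i,m,e,p,j,n,q,f,s,k,o,r,t,u], ![a,b,c,g,h,l,d,i,m,e,p,j,n,q,s,f,k,o,r,t,u], ![a,b,c,g,h,l,d,i,m,p,e,f,j,k,n,o,q,r,s,t,u],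
 ![a,b,c,g,h,l,d,i,m,p,e,f,j,n,k,o,q,r,s,t,u], ![a,b,c,g,h,l,d,i,m,p,e,j,f,n,k,o,q,r,s,t,u], ![a,b,c,g,h,l,d,i,m,p,e,j,n,f,k,o,q,r,s,t,u], ![a,b,c,g,h,l,d,i,m,p,e,j,n,f,k,q,o,r,s,t,u],
 ![a,b,c,g,h,l,d,i,m,p,e,j,n,f,q,k,o,r,s,t,u], ![a,b,c,g,h,l,d,i,m,p,e,j,n,q,f,k,o,r,s,t,u], ![a,b,c,g,h,l,d,i,m,p,e,j,n,q,f,k,o,s,r,t,u], ![a,b,c,g,h,l,d,i,m,p,e,j,n,q,f,k,s,o,r,t,u],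
 ![a,b,c,g,h,l,d,i,m,p,e,j,n,q,f,s,k,o,r,t,u], ![a,b,c,g,h,l,d,i,m,p,e,j,n,q,s,f,k,o,r,t,u], ![a,b,g,c,d,e,f,h,i,j,k,l,m,n,o,p,q,r,s,t,u], ![a,b,g,c,d,e,f,h,i,j,k,l,m,n,o,p,q,s,r,t,u] ]
 else
 [ -- block 107: chambers 1712…1727, four per line
 ![a,b,g,c,d,e,f,h,i,j,k,l,m,n,p,o,q,r,s,t,u], ![a,b,g,c,d,e,f,h,i,j,k,l,m,n,p,o,q,s,r,t,u], ![a,b,g,c,d,e,f,h,i,j,k,l,m,n,p,q,o,s,r,t,u], ![a,b,g,c,d,e,f,h,i,j,k,l,m,n,p,q,s,o,r,t,u],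
 ![a,b,g,c,d,e,f,h,i,j,k,l,m,p,n,o,q,r,s,t,u], ![a,b,g,c,d,e,f,h,i,j,k,l,m,p,n,q,o,r,s,t,u], ![a,b,g,c,d,e,f,h,i,j,k,l,m,p,n,q,o,s,r,t,u], ![a,b,g,c,d,e,f,h,i,j,k,l,m,p,n,q,s,o,r,t,u],
 ![a,b,g,c,d,e,h,f,i,j,k,l,m,n,o,p,q,r,s,t,u], ![a,b,g,c,d,e,h,f,i,j,k,l,m,n,o,p,q,s,r,t,u], ![a,b,g,c,d,e,h,f,i,j,k,l,m,n,p,o,q,r,s,t,u], ![a,b,g,c,d,e,h,f,i,j,k,l,m,n,p,o,q,s,r,t,u],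
 ![a,b,g,c,d,e,h,f,i,j,k,l,m,n,p,q,o,s,r,t,u], ![a,b,g,c,d,e,h,f,i,j,k,l,m,n,p,q,s,o,r,t,u], ![a,b,g,c,d,e,h,f,i,j,k,l,m,p,n,o,q,r,s,t,u], ![a,b,g,c,d,e,h,f,i,j,k,l,m,p,n,q,o,r,s,t,u] ]
 else
 if N < 109 then
 [ -- block 108: chambers 1728…1743, four per line
 ![a,b,g,c,d,e,h,f,i,j,k,l,m,p,n,q,o,s,r,t,u], ![a,b,g,c,d,e,h,f,i,j,k,l,m,p,n,q,s,o,r,t,u], ![a,b,g,c,d,e,h,f,i,j,l,k,m,n,o,p,q,r,s,t,u], ![a,b,g,c,d,e,h,f,i,j,l,k,m,n,o,p,q,s,r,t,u],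
 ![a,b,g,c,d,e,h,f,i,j,l,k,m,n,p,o,q,r,s,t,u], ![a,b,g,c,d,e,h,f,i,j,l,k,m,n,p,o,q,s,r,t,u], ![a,b,g,c,d,e,h,f,i,j,l,k,m,n,p,q,o,s,r,t,u], ![a,b,g,c,d,e,h,f,i,j,l,k,m,n,p,q,s,o,r,t,u],
 ![a,b,g,c,d,e,h,f,i,j,l,k,m,p,n,o,q,r,s,t,u], ![a,b,g,c,d,e,h,f,i,j,l,k,m,p,n,q,o,r,s,t,u], ![a,b,g,c,d,e,h,f,i,j,l,k,m,p,n,q,o,s,r,t,u], ![a,b,g,c,d,e,h,f,i,j,l,k,m,p,n,q,s,o,r,t,u],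
 ![a,b,g,c,d,e,h,i,f,j,k,l,m,n,p,q,o,s,r,t,u], ![a,b,g,c,d,e,h,i,f,j,k,l,m,n,p,q,s,o,r,t,u], ![a,b,g,c,d,e,h,i,f,j,k,l,m,p,n,q,o,r,s,t,u], ![a,b,g,c,d,e,h,i,f,j,k,l,m,p,n,q,o,s,r,t,u] ]
 else
 if N < 110 then
 [ -- block 109: chambers 1744…1759, four per line
 ![a,b,g,c,d,e,h,i,f,j,k,l,m,p,n,q,s,o,r,t,u], ![a,b,g,c,d,e,h,i,f,j,l,k,m,n,p,q,o,s,r,t,u], ![a,b,g,c,d,e,h,i,f,j,l,k,m,n,p,q,s,o,r,t,u], ![a,b,g,c,d,e,h,i,f,j,l,k,m,p,n,q,o,r,s,t,u],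
 ![a,b,g,c,d,e,h,i,f,j,l,k,m,p,n,q,o,s,r,t,u], ![a,b,g,c,d,e,h,i,f,j,l,k,m,p,n,q,s,o,r,t,u], ![a,b,g,c,d,e,h,i,f,j,l,m,k,n,p,q,o,s,r,t,u], ![a,b,g,c,d,e,h,i,f,j,l,m,k,n,p,q,s,o,r,t,u],
 ![a,b,g,c,d,e,h,i,f,j,l,m,k,p,n,q,o,r,s,t,u], ![a,b,g,c,d,e,h,i,f,j,l,m,k,p,n,q,o,s,r,t,u], ![a,b,g,c,d,e,h,i,f,j,l,m,k,p,n,q,s,o,r,t,u], ![a,b,g,c,d,e,h,i,f,j,l,m,p,k,n,q,o,r,s,t,u],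
 ![a,b,g,c,d,e,h,i,f,j,l,m,p,k,n,q,o,s,r,t,u], ![a,b,g,c,d,e,h,i,f,j,l,m,p,k,n,q,s,o,r,t,u], ![a,b,g,c,d,e,h,i,j,f,k,l,m,n,p,q,s,o,r,t,u], ![a,b,g,c,d,e,h,i,j,f,k,l,m,p,n,q,s,o,r,t,u] ]
 else
 [ -- block 110: chambers 1760…1775, four per line
 ![a,b,g,c,d,e,h,i,j,f,l,k,m,n,p,q,s,o,r,t,u], ![a,b,g,c,d,e,h,i,j,f,l,k,m,p,n,q,s,o,r,t,u], ![a,b,g,c,d,e,h,i,j,f,l,m,k,n,p,q,s,o,r,t,u], ![a,b,g,c,d,e,h,i,j,f,l,m,k,p,n,q,s,o,r,t,u],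
 ![a,b,g,c,d,e,h,i,j,f,l,m,n,k,p,q,s,o,r,t,u], ![a,b,g,c,d,e,h,i,j,f,l,m,n,p,k,q,s,o,r,t,u], ![a,b,g,c,d,e,h,i,j,f,l,m,n,p,q,k,s,o,r,t,u], ![a,b,g,c,d,e,h,i,j,f,l,m,n,p,q,s,k,o,r,t,u],
 ![a,b,g,c,d,e,h,i,j,f,l,m,p,k,n,q,s,o,r,t,u], ![a,b,g,c,d,e,h,i,j,f,l,m,p,n,k,q,s,o,r,t,u], ![a,b,g,c,d,e,h,i,j,f,l,m,p,n,q,k,s,o,r,t,u], ![a,b,g,c,d,e,h,i,j,f,l,m,p,n,q,s,k,o,r,t,u],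
 ![a,b,g,c,d,e,h,i,j,l,f,m,n,k,p,q,s,o,r,t,u], ![a,b,g,c,d,e,h,i,j,l,f,m,n,p,k,q,s,o,r,t,u], ![a,b,g,c,d,e,h,i,j,l,f,m,n,p,q,k,s,o,r,t,u], ![a,b,g,c,d,e,h,i,j,l,f,m,n,p,q,s,k,o,r,t,u] ]
 else
 if N < 116 then
 if N < 113 then
 if N < 112 then
 [ -- block 111: chambers 1776…1791, four per line
 ![a,b,g,c,d,e,h,i,j,l,f,m,p,n,k,q,s,o,r,t,u], ![a,b,g,c,d,e,h,i,j,l,f,m,p,n,q,k,s,o,r,t,u], ![a,b,g,c,d,e,h,i,j,l,f,m,p,n,q,s,k,o,r,t,u], ![a,b,g,c,d,e,h,i,j,l,m,f,n,p,q,k,s,o,r,t,u],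
 ![a,b,g,c,d,e,h,i,j,l,m,f,n,p,q,s,k,o,r,t,u], ![a,b,g,c,d,e,h,i,j,l,m,f,p,n,q,k,s,o,r,t,u], ![a,b,g,c,d,e,h,i,j,l,m,f,p,n,q,s,k,o,r,t,u], ![a,b,g,c,d,e,h,i,j,l,m,n,f,p,q,s,k,o,r,t,u],
 ![a,b,g,c,d,e,h,i,j,l,m,n,p,f,q,s,k,o,r,t,u], ![a,b,g,c,d,e,h,i,j,l,m,n,p,q,f,s,k,o,r,t,u], ![a,b,g,c,d,e,h,i,j,l,m,n,p,q,s,f,k,o,r,t,u], ![a,b,g,c,d,e,h,i,j,l,m,p,f,n,q,k,s,o,r,t,u],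
 ![a,b,g,c,d,e,h,i,j,l,m,p,f,n,q,s,k,o,r,t,u], ![a,b,g,c,d,e,h,i,j,l,m,p,n,f,q,s,k,o,r,t,u], ![a,b,g,c,d,e,h,i,j,l,m,p,n,q,f,s,k,o,r,t,u], ![a,b,g,c,d,e,h,i,j,l,m,p,n,q,s,f,k,o,r,t,u] ]
 else
 [ -- block 112: chambers 1792…1807, four per line
 ![a,b,g,c,d,h,e,f,i,j,k,l,m,n,o,p,q,r,s,t,u], ![a,b,g,c,d,h,e,f,i,j,k,l,m,n,o,p,q,s,r,t,u], ![a,b,g,c,d,h,e,f,i,j,k,l,m,n,p,o,q,r,s,t,u], ![a,b,g,c,d,h,e,f,i,j,k,l,m,n,p,o,q,s,r,t,u],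
 ![a,b,g,c,d,h,e,f,i,j,k,l,m,p,n,o,q,r,s,t,u], ![a,b,g,c,d,h,e,f,i,j,l,k,m,n,o,p,q,r,s,t,u], ![a,b,g,c,d,h,e,f,i,j,l,k,m,n,o,p,q,s,r,t,u], ![a,b,g,c,d,h,e,f,i,j,l,k,m,n,p,o,q,r,s,t,u],
 ![a,b,g,c,d,h,e,f,i,j,l,k,m,n,p,o,q,s,r,t,u], ![a,b,g,c,d,h,e,f,i,j,l,k,m,p,n,o,q,r,s,t,u], ![a,b,g,c,d,h,e,f,i,l,j,k,m,n,o,p,q,r,s,t,u], ![a,b,g,c,d,h,e,f,i,l,j,k,m,n,o,p,q,s,r,t,u],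
 ![a,b,g,c,d,h,e,f,i,l,j,k,m,n,p,o,q,r,s,t,u], ![a,b,g,c,d,h,e,f,i,l,j,k,m,n,p,o,q,s,r,t,u], ![a,b,g,c,d,h,e,f,i,l,j,k,m,p,n,o,q,r,s,t,u], ![a,b,g,c,d,h,e,i,f,j,k,l,m,n,p,o,q,r,s,t,u] ]
 else
 if N < 114 then
 [ -- block 113: chambers 1808…1823, four per line
 ![a,b,g,c,d,h,e,i,f,j,k,l,m,n,p,o,q,s,r,t,u], ![a,b,g,c,d,h,e,i,f,j,k,l,m,n,p,q,o,s,r,t,u], ![a,b,g,c,d,h,e,i,f,j,k,l,m,p,n,o,q,r,s,t,u], ![a,b,g,c,d,h,e,i,f,j,k,l,m,p,n,q,o,r,s,t,u],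
 ![a,b,g,c,d,h,e,i,f,j,k,l,m,p,n,q,o,s,r,t,u], ![a,b,g,c,d,h,e,i,f,j,l,k,m,n,p,o,q,r,s,t,u], ![a,b,g,c,d,h,e,i,f,j,l,k,m,n,p,o,q,s,r,t,u], ![a,b,g,c,d,h,e,i,f,j,l,k,m,n,p,q,o,s,r,t,u],
 ![a,b,g,c,d,h,e,i,f,j,l,k,m,p,n,o,q,r,s,t,u], ![a,b,g,c,d,h,e,i,f,j,l,k,m,p,n,q,o,r,s,t,u], ![a,b,g,c,d,h,e,i,f,j,l,k,m,p,n,q,o,s,r,t,u], ![a,b,g,c,d,h,e,i,f,j,l,m,k,n,p,q,o,s,r,t,u],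
 ![a,b,g,c,d,h,e,i,f,j,l,m,k,p,n,q,o,r,s,t,u], ![a,b,g,c,d,h,e,i,f,j,l,m,k,p,n,q,o,s,r,t,u], ![a,b,g,c,d,h,e,i,f,j,l,m,p,k,n,q,o,r,s,t,u], ![a,b,g,c,d,h,e,i,f,j,l,m,p,k,n,q,o,s,r,t,u] ]
 else
 if N < 115 then
 [ -- block 114: chambers 1824…1839, four per line
 ![a,b,g,c,d,h,e,i,f,l,j,k,m,n,p,o,q,r,s,t,u], ![a,b,g,c,d,h,e,i,f,l,j,k,m,n,p,o,q,s,r,t,u], ![a,b,g,c,d,h,e,i,f,l,j,k,m,p,n,o,q,r,s,t,u], ![a,b,g,c,d,h,e,i,f,l,j,m,k,n,p,o,q,r,s,t,u],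
 ![a,b,g,c,d,h,e,i,f,l,j,m,k,n,p,o,q,s,r,t,u], ![a,b,g,c,d,h,e,i,f,l,j,m,k,n,p,q,o,s,r,t,u], ![a,b,g,c,d,h,e,i,f,l,j,m,k,p,n,o,q,r,s,t,u], ![a,b,g,c,d,h,e,i,f,l,j,m,k,p,n,q,o,r,s,t,u],
 ![a,b,g,c,d,h,e,i,f,l,j,m,k,p,n,q,o,s,r,t,u], ![a,b,g,c,d,h,e,i,f,l,j,m,p,k,n,q,o,r,s,t,u], ![a,b,g,c,d,h,e,i,f,l,j,m,p,k,n,q,o,s,r,t,u], ![a,b,g,c,d,h,e,i,j,f,k,l,m,n,p,q,o,s,r,t,u],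
 ![a,b,g,c,d,h,e,i,j,f,k,l,m,n,p,q,s,o,r,t,u], ![a,b,g,c,d,h,e,i,j,f,k,l,m,p,n,q,o,s,r,t,u], ![a,b,g,c,d,h,e,i,j,f,k,l,m,p,n,q,s,o,r,t,u], ![a,b,g,c,d,h,e,i,j,f,l,k,m,n,p,q,o,s,r,t,u] ]
 else
 [ -- block 115: chambers 1840…1855, four per line
 ![a,b,g,c,d,h,e,i,j,f,l,k,m,n,p,q,s,o,r,t,u], ![a,b,g,c,d,h,e,i,j,f,l,k,m,p,n,q,o,s,r,t,u], ![a,b,g,c,d,h,e,i,j,f,l,k,m,p,n,q,s,o,r,t,u], ![a,b,g,c,d,h,e,i,j,f,l,m,k,n,p,q,o,s,r,t,u],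
 ![a,b,g,c,d,h,e,i,j,f,l,m,k,n,p,q,s,o,r,t,u], ![a,b,g,c,d,h,e,i,j,f,l,m,k,p,n,q,o,s,r,t,u], ![a,b,g,c,d,h,e,i,j,f,l,m,k,p,n,q,s,o,r,t,u], ![a,b,g,c,d,h,e,i,j,f,l,m,p,k,n,q,o,s,r,t,u],
 ![a,b,g,c,d,h,e,i,j,f,l,m,p,k,n,q,s,o,r,t,u], ![a,b,g,c,d,h,e,i,j,l,f,m,k,n,p,q,o,s,r,t,u], ![a,b,g,c,d,h,e,i,j,l,f,m,k,n,p,q,s,o,r,t,u], ![a,b,g,c,d,h,e,i,j,l,f,m,k,p,n,q,o,s,r,t,u],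
 ![a,b,g,c,d,h,e,i,j,l,f,m,k,p,n,q,s,o,r,t,u], ![a,b,g,c,d,h,e,i,j,l,f,m,n,k,p,q,s,o,r,t,u], ![a,b,g,c,d,h,e,i,j,l,f,m,n,p,k,q,s,o,r,t,u], ![a,b,g,c,d,h,e,i,j,l,f,m,p,k,n,q,o,s,r,t,u] ]
 else
 if N < 119 then
 if N < 117 then
 [ -- block 116: chambers 1856…1871, four per line
 ![a,b,g,c,d,h,e,i,j,l,f,m,p,k,n,q,s,o,r,t,u], ![a,b,g,c,d,h,e,i,j,l,f,m,p,n,k,q,s,o,r,t,u], ![a,b,g,c,d,h,e,i,j,l,m,f,n,p,k,q,s,o,r,t,u], ![a,b,g,c,d,h,e,i,j,l,m,f,n,p,q,k,s,o,r,t,u],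
 ![a,b,g,c,d,h,e,i,j,l,m,f,p,n,k,q,s,o,r,t,u], ![a,b,g,c,d,h,e,i,j,l,m,f,p,n,q,k,s,o,r,t,u], ![a,b,g,c,d,h,e,i,j,l,m,n,f,p,q,k,s,o,r,t,u], ![a,b,g,c,d,h,e,i,j,l,m,n,f,p,q,s,k,o,r,t,u],
 ![a,b,g,c,d,h,e,i,j,l,m,n,p,f,q,k,s,o,r,t,u], ![a,b,g,c,d,h,e,i,j,l,m,n,p,f,q,s,k,o,r,t,u], ![a,b,g,c,d,h,e,i,j,l,m,n,p,q,f,s,k,o,r,t,u], ![a,b,g,c,d,h,e,i,j,l,m,n,p,q,s,f,k,o,r,t,u],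
 ![a,b,g,c,d,h,e,i,j,l,m,p,f,n,q,k,s,o,r,t,u], ![a,b,g,c,d,h,e,i,j,l,m,p,n,f,q,k,s,o,r,t,u], ![a,b,g,c,d,h,e,i,j,l,m,p,n,f,q,s,k,o,r,t,u], ![a,b,g,c,d,h,e,i,j,l,m,p,n,q,f,s,k,o,r,t,u] ]
 else
 if N < 118 then
 [ -- block 117: chambers 1872…1887, four per line
 ![a,b,g,c,d,h,e,i,j,l,m,p,n,q,s,f,k,o,r,t,u], ![a,b,g,c,d,h,e,i,l,f,j,m,k,n,p,o,q,r,s,t,u], ![a,b,g,c,d,h,e,i,l,f,j,m,k,n,p,o,q,s,r,t,u], ![a,b,g,c,d,h,e,i,l,f,j,m,k,n,p,q,o,s,r,t,u],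
 ![a,b,g,c,d,h,e,i,l,f,j,m,k,p,n,o,q,r,s,t,u], ![a,b,g,c,d,h,e,i,l,f,j,m,k,p,n,q,o,r,s,t,u], ![a,b,g,c,d,h,e,i,l,f,j,m,k,p,n,q,o,s,r,t,u], ![a,b,g,c,d,h,e,i,l,f,j,m,p,k,n,q,o,r,s,t,u],
 ![a,b,g,c,d,h,e,i,l,f,j,m,p,k,n,q,o,s,r,t,u], ![a,b,g,c,d,h,e,i,l,j,f,m,k,n,p,q,o,s,r,t,u], ![a,b,g,c,d,h,e,i,l,j,f,m,k,p,n,q,o,s,r,t,u], ![a,b,g,c,d,h,e,i,l,j,f,m,n,k,p,q,o,s,r,t,u],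
 ![a,b,g,c,d,h,e,i,l,j,f,m,n,k,p,q,s,o,r,t,u], ![a,b,g,c,d,h,e,i,l,j,f,m,n,p,k,q,o,s,r,t,u], ![a,b,g,c,d,h,e,i,l,j,f,m,n,p,k,q,s,o,r,t,u], ![a,b,g,c,d,h,e,i,l,j,f,m,p,k,n,q,o,s,r,t,u] ]
 else
 [ -- block 118: chambers 1888…1903, four per line
 ![a,b,g,c,d,h,e,i,l,j,f,m,p,n,k,q,o,s,r,t,u], ![a,b,g,c,d,h,e,i,l,j,f,m,p,n,k,q,s,o,r,t,u], ![a,b,g,c,d,h,e,i,l,j,m,f,n,p,k,q,o,s,r,t,u], ![a,b,g,c,d,h,e,i,l,j,m,f,n,p,k,q,s,o,r,t,u],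
 ![a,b,g,c,d,h,e,i,l,j,m,f,n,p,q,k,s,o,r,t,u], ![a,b,g,c,d,h,e,i,l,j,m,f,p,n,k,q,o,s,r,t,u], ![a,b,g,c,d,h,e,i,l,j,m,f,p,n,k,q,s,o,r,t,u], ![a,b,g,c,d,h,e,i,l,j,m,f,p,n,q,k,s,o,r,t,u],
 ![a,b,g,c,d,h,e,i,l,j,m,n,f,p,q,k,s,o,r,t,u], ![a,b,g,c,d,h,e,i,l,j,m,n,f,p,q,s,k,o,r,t,u], ![a,b,g,c,d,h,e,i,l,j,m,n,p,f,q,k,s,o,r,t,u], ![a,b,g,c,d,h,e,i,l,j,m,n,p,f,q,s,k,o,r,t,u],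
 ![a,b,g,c,d,h,e,i,l,j,m,n,p,q,f,s,k,o,r,t,u], ![a,b,g,c,d,h,e,i,l,j,m,n,p,q,s,f,k,o,r,t,u], ![a,b,g,c,d,h,e,i,l,j,m,p,f,n,q,k,s,o,r,t,u], ![a,b,g,c,d,h,e,i,l,j,m,p,n,f,q,k,s,o,r,t,u] ]
 else
 if N < 120 then
 [ -- block 119: chambers 1904…1919, four per line
 ![a,b,g,c,d,h,e,i,l,j,m,p,n,f,q,s,k,o,r,t,u], ![a,b,g,c,d,h,e,i,l,j,m,p,n,q,f,s,k,o,r,t,u], ![a,b,g,c,d,h,e,i,l,j,m,p,n,q,s,f,k,o,r,t,u], ![a,b,g,c,d,h,i,e,f,j,k,l,m,p,n,o,q,r,s,t,u],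
 ![a,b,g,c,d,h,i,e,f,j,k,l,m,p,n,q,o,r,s,t,u], ![a,b,g,c,d,h,i,e,f,j,l,k,m,p,n,o,q,r,s,t,u], ![a,b,g,c,d,h,i,e,f,j,l,k,m,p,n,q,o,r,s,t,u], ![a,b,g,c,d,h,i,e,f,j,l,m,k,p,n,q,o,r,s,t,u],
 ![a,b,g,c,d,h,i,e,f,j,l,m,p,k,n,q,o,r,s,t,u], ![a,b,g,c,d,h,i,e,f,l,j,k,m,p,n,o,q,r,s,t,u], ![a,b,g,c,d,h,i,e,f,l,j,m,k,p,n,o,q,r,s,t,u], ![a,b,g,c,d,h,i,e,f,l,j,m,k,p,n,q,o,r,s,t,u],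
 ![a,b,g,c,d,h,i,e,f,l,j,m,p,k,n,q,o,r,s,t,u], ![a,b,g,c,d,h,i,e,f,l,m,j,k,p,n,o,q,r,s,t,u], ![a,b,g,c,d,h,i,e,f,l,m,j,p,k,n,o,q,r,s,t,u], ![a,b,g,c,d,h,i,e,f,l,m,j,p,k,n,q,o,r,s,t,u] ]
 else
 if N < 121 then
 [ -- block 120: chambers 1920…1935, four per line
 ![a,b,g,c,d,h,i,e,f,l,m,p,j,k,n,o,q,r,s,t,u], ![a,b,g,c,d,h,i,e,f,l,m,p,j,k,n,q,o,r,s,t,u], ![a,b,g,c,d,h,i,e,j,f,k,l,m,p,n,q,o,r,s,t,u], ![a,b,g,c,d,h,i,e,j,f,k,l,m,p,n,q,o,s,r,t,u],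
 ![a,b,g,c,d,h,i,e,j,f,k,l,m,p,n,q,s,o,r,t,u], ![a,b,g,c,d,h,i,e,j,f,l,k,m,p,n,q,o,r,s,t,u], ![a,b,g,c,d,h,i,e,j,f,l,k,m,p,n,q,o,s,r,t,u], ![a,b,g,c,d,h,i,e,j,f,l,k,m,p,n,q,s,o,r,t,u],
 ![a,b,g,c,d,h,i,e,j,f,l,m,k,p,n,q,o,r,s,t,u], ![a,b,g,c,d,h,i,e,j,f,l,m,k,p,n,q,o,s,r,t,u], ![a,b,g,c,d,h,i,e,j,f,l,m,k,p,n,q,s,o,r,t,u], ![a,b,g,c,d,h,i,e,j,f,l,m,p,k,n,q,o,r,s,t,u],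
 ![a,b,g,c,d,h,i,e,j,f,l,m,p,k,n,q,o,s,r,t,u], ![a,b,g,c,d,h,i,e,j,f,l,m,p,k,n,q,s,o,r,t,u], ![a,b,g,c,d,h,i,e,j,l,f,m,k,p,n,q,o,r,s,t,u], ![a,b,g,c,d,h,i,e,j,l,f,m,k,p,n,q,o,s,r,t,u] ]
 else
 [ -- block 121: chambers 1936…1951, four per line
 ![a,b,g,c,d,h,i,e,j,l,f,m,k,p,n,q,s,o,r,t,u], ![a,b,g,c,d,h,i,e,j,l,f,m,p,k,n,q,o,r,s,t,u], ![a,b,g,c,d,h,i,e,j,l,f,m,p,k,n,q,o,s,r,t,u], ![a,b,g,c,d,h,i,e,j,l,f,m,p,k,n,q,s,o,r,t,u],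
 ![a,b,g,c,d,h,i,e,j,l,m,f,p,k,n,q,o,r,s,t,u], ![a,b,g,c,d,h,i,e,j,l,m,f,p,k,n,q,o,s,r,t,u], ![a,b,g,c,d,h,i,e,j,l,m,f,p,k,n,q,s,o,r,t,u], ![a,b,g,c,d,h,i,e,j,l,m,f,p,n,k,q,s,o,r,t,u],
 ![a,b,g,c,d,h,i,e,j,l,m,p,f,k,n,q,o,r,s,t,u], ![a,b,g,c,d,h,i,e,j,l,m,p,f,k,n,q,o,s,r,t,u], ![a,b,g,c,d,h,i,e,j,l,m,p,f,k,n,q,s,o,r,t,u], ![a,b,g,c,d,h,i,e,j,l,m,p,f,n,k,q,s,o,r,t,u],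
 ![a,b,g,c,d,h,i,e,j,l,m,p,f,n,q,k,s,o,r,t,u], ![a,b,g,c,d,h,i,e,j,l,m,p,n,f,q,k,s,o,r,t,u], ![a,b,g,c,d,h,i,e,j,l,m,p,n,q,f,k,s,o,r,t,u], ![a,b,g,c,d,h,i,e,j,l,m,p,n,q,f,s,k,o,r,t,u] ]
 else
 if N < 142 then
 if N < 132 then
 if N < 127 then
 if N < 124 then
 if N < 123 then
 [ -- block 122: chambers 1952…1967, four per line
 ![a,b,g,c,d,h,i,e,j,l,m,p,n,q,s,f,k,o,r,t,u], ![a,b,g,c,d,h,i,e,l,f,j,m,k,p,n,o,q,r,s,t,u], ![a,b,g,c,d,h,i,e,l,f,j,m,k,p,n,q,o,r,s,t,u], ![a,b,g,c,d,h,i,e,l,f,j,m,p,k,n,q,o,r,s,t,u],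
 ![a,b,g,c,d,h,i,e,l,f,m,j,k,p,n,o,q,r,s,t,u], ![a,b,g,c,d,h,i,e,l,f,m,j,p,k,n,o,q,r,s,t,u], ![a,b,g,c,d,h,i,e,l,f,m,j,p,k,n,q,o,r,s,t,u], ![a,b,g,c,d,h,i,e,l,f,m,p,j,k,n,o,q,r,s,t,u],
 ![a,b,g,c,d,h,i,e,l,f,m,p,j,k,n,q,o,r,s,t,u], ![a,b,g,c,d,h,i,e,l,j,f,m,k,p,n,q,o,r,s,t,u], ![a,b,g,c,d,h,i,e,l,j,f,m,k,p,n,q,o,s,r,t,u], ![a,b,g,c,d,h,i,e,l,j,f,m,p,k,n,q,o,r,s,t,u],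
 ![a,b,g,c,d,h,i,e,l,j,f,m,p,k,n,q,o,s,r,t,u], ![a,b,g,c,d,h,i,e,l,j,m,f,p,k,n,q,o,r,s,t,u], ![a,b,g,c,d,h,i,e,l,j,m,f,p,k,n,q,o,s,r,t,u], ![a,b,g,c,d,h,i,e,l,j,m,f,p,n,k,q,o,s,r,t,u] ]
 else
 [ -- block 123: chambers 1968…1983, four per line
 ![a,b,g,c,d,h,i,e,l,j,m,f,p,n,k,q,s,o,r,t,u], ![a,b,g,c,d,h,i,e,l,j,m,p,f,k,n,q,o,r,s,t,u], ![a,b,g,c,d,h,i,e,l,j,m,p,f,k,n,q,o,s,r,t,u], ![a,b,g,c,d,h,i,e,l,j,m,p,f,n,k,q,o,s,r,t,u],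
 ![a,b,g,c,d,h,i,e,l,j,m,p,f,n,k,q,s,o,r,t,u], ![a,b,g,c,d,h,i,e,l,j,m,p,f,n,q,k,s,o,r,t,u], ![a,b,g,c,d,h,i,e,l,j,m,p,n,f,q,k,s,o,r,t,u], ![a,b,g,c,d,h,i,e,l,j,m,p,n,q,f,k,s,o,r,t,u],
 ![a,b,g,c,d,h,i,e,l,j,m,p,n,q,f,s,k,o,r,t,u], ![a,b,g,c,d,h,i,e,l,j,m,p,n,q,s,f,k,o,r,t,u], ![a,b,g,c,d,h,i,e,l,m,f,j,p,k,n,q,o,r,s,t,u], ![a,b,g,c,d,h,i,e,l,m,f,p,j,k,n,q,o,r,s,t,u],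
 ![a,b,g,c,d,h,i,e,l,m,j,f,p,k,n,q,o,r,s,t,u], ![a,b,g,c,d,h,i,e,l,m,j,f,p,n,k,q,o,r,s,t,u], ![a,b,g,c,d,h,i,e,l,m,j,f,p,n,k,q,o,s,r,t,u], ![a,b,g,c,d,h,i,e,l,m,j,p,f,k,n,q,o,r,s,t,u] ]
 else
 if N < 125 then
 [ -- block 124: chambers 1984…1999, four per line
 ![a,b,g,c,d,h,i,e,l,m,j,p,f,n,k,q,o,r,s,t,u], ![a,b,g,c,d,h,i,e,l,m,j,p,f,n,k,q,o,s,r,t,u], ![a,b,g,c,d,h,i,e,l,m,j,p,f,n,q,k,o,s,r,t,u], ![a,b,g,c,d,h,i,e,l,m,j,p,f,n,q,k,s,o,r,t,u],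
 ![a,b,g,c,d,h,i,e,l,m,j,p,n,f,q,k,s,o,r,t,u], ![a,b,g,c,d,h,i,e,l,m,j,p,n,q,f,k,s,o,r,t,u], ![a,b,g,c,d,h,i,e,l,m,j,p,n,q,f,s,k,o,r,t,u], ![a,b,g,c,d,h,i,e,l,m,j,p,n,q,s,f,k,o,r,t,u],
 ![a,b,g,c,d,h,i,e,l,m,p,f,j,k,n,q,o,r,s,t,u], ![a,b,g,c,d,h,i,e,l,m,p,j,f,k,n,q,o,r,s,t,u], ![a,b,g,c,d,h,i,e,l,m,p,j,f,n,k,q,o,r,s,t,u], ![a,b,g,c,d,h,i,e,l,m,p,j,f,n,q,k,o,r,s,t,u],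
 ![a,b,g,c,d,h,i,e,l,m,p,j,f,n,q,k,o,s,r,t,u], ![a,b,g,c,d,h,i,e,l,m,p,j,f,n,q,k,s,o,r,t,u], ![a,b,g,c,d,h,i,e,l,m,p,j,n,f,q,k,s,o,r,t,u], ![a,b,g,c,d,h,i,e,l,m,p,j,n,q,f,k,s,o,r,t,u] ]
 else
 if N < 126 then
 [ -- block 125: chambers 2000…2015, four per line
 ![a,b,g,c,d,h,i,e,l,m,p,j,n,q,f,s,k,o,r,t,u], ![a,b,g,c,d,h,i,e,l,m,p,j,n,q,s,f,k,o,r,t,u], ![a,b,g,c,d,h,i,l,e,f,m,j,k,p,n,o,q,r,s,t,u], ![a,b,g,c,d,h,i,l,e,f,m,j,p,k,n,o,q,r,s,t,u],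
 ![a,b,g,c,d,h,i,l,e,f,m,p,j,k,n,o,q,r,s,t,u], ![a,b,g,c,d,h,i,l,e,m,f,j,p,k,n,o,q,r,s,t,u], ![a,b,g,c,d,h,i,l,e,m,f,j,p,k,n,q,o,r,s,t,u], ![a,b,g,c,d,h,i,l,e,m,f,p,j,k,n,o,q,r,s,t,u],
 ![a,b,g,c,d,h,i,l,e,m,f,p,j,k,n,q,o,r,s,t,u], ![a,b,g,c,d,h,i,l,e,m,j,f,p,k,n,q,o,r,s,t,u], ![a,b,g,c,d,h,i,l,e,m,j,f,p,n,k,q,o,r,s,t,u], ![a,b,g,c,d,h,i,l,e,m,j,f,p,n,k,q,o,s,r,t,u],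
 ![a,b,g,c,d,h,i,l,e,m,j,p,f,k,n,q,o,r,s,t,u], ![a,b,g,c,d,h,i,l,e,m,j,p,f,n,k,q,o,r,s,t,u], ![a,b,g,c,d,h,i,l,e,m,j,p,f,n,k,q,o,s,r,t,u], ![a,b,g,c,d,h,i,l,e,m,j,p,f,n,q,k,o,s,r,t,u] ]
 else
 [ -- block 126: chambers 2016…2031, four per line
 ![a,b,g,c,d,h,i,l,e,m,j,p,n,f,q,k,o,s,r,t,u], ![a,b,g,c,d,h,i,l,e,m,j,p,n,f,q,k,s,o,r,t,u], ![a,b,g,c,d,h,i,l,e,m,j,p,n,q,f,k,s,o,r,t,u], ![a,b,g,c,d,h,i,l,e,m,j,p,n,q,f,s,k,o,r,t,u],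
 ![a,b,g,c,d,h,i,l,e,m,j,p,n,q,s,f,k,o,r,t,u], ![a,b,g,c,d,h,i,l,e,m,p,f,j,k,n,q,o,r,s,t,u], ![a,b,g,c,d,h,i,l,e,m,p,j,f,k,n,q,o,r,s,t,u], ![a,b,g,c,d,h,i,l,e,m,p,j,f,n,k,q,o,r,s,t,u],
 ![a,b,g,c,d,h,i,l,e,m,p,j,f,n,q,k,o,r,s,t,u], ![a,b,g,c,d,h,i,l,e,m,p,j,f,n,q,k,o,s,r,t,u], ![a,b,g,c,d,h,i,l,e,m,p,j,n,f,q,k,o,s,r,t,u], ![a,b,g,c,d,h,i,l,e,m,p,j,n,f,q,k,s,o,r,t,u],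
 ![a,b,g,c,d,h,i,l,e,m,p,j,n,q,f,k,s,o,r,t,u], ![a,b,g,c,d,h,i,l,e,m,p,j,n,q,f,s,k,o,r,t,u], ![a,b,g,c,d,h,i,l,e,m,p,j,n,q,s,f,k,o,r,t,u], ![a,b,g,c,d,h,i,l,m,e,f,p,j,k,n,o,q,r,s,t,u] ]
 else
 if N < 129 then
 if N < 128 then
 [ -- block 127: chambers 2032…2047, four per line
 ![a,b,g,c,d,h,i,l,m,e,p,f,j,k,n,o,q,r,s,t,u], ![a,b,g,c,d,h,i,l,m,e,p,f,j,k,n,q,o,r,s,t,u], ![a,b,g,c,d,h,i,l,m,e,p,j,f,k,n,q,o,r,s,t,u], ![a,b,g,c,d,h,i,l,m,e,p,j,f,n,k,q,o,r,s,t,u],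
 ![a,b,g,c,d,h,i,l,m,e,p,j,f,n,q,k,o,r,s,t,u], ![a,b,g,c,d,h,i,l,m,e,p,j,n,f,q,k,o,r,s,t,u], ![a,b,g,c,d,h,i,l,m,e,p,j,n,f,q,k,o,s,r,t,u], ![a,b,g,c,d,h,i,l,m,e,p,j,n,q,f,k,o,s,r,t,u],
 ![a,b,g,c,d,h,i,l,m,e,p,j,n,q,f,k,s,o,r,t,u], ![a,b,g,c,d,h,i,l,m,e,p,j,n,q,f,s,k,o,r,t,u], ![a,b,g,c,d,h,i,l,m,e,p,j,n,q,s,f,k,o,r,t,u], ![a,b,g,c,d,h,i,l,m,p,e,f,j,k,n,o,q,r,s,t,u],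
 ![a,b,g,c,d,h,i,l,m,p,e,f,j,k,n,q,o,r,s,t,u], ![a,b,g,c,d,h,i,l,m,p,e,j,f,k,n,q,o,r,s,t,u], ![a,b,g,c,d,h,i,l,m,p,e,j,f,n,k,q,o,r,s,t,u], ![a,b,g,c,d,h,i,l,m,p,e,j,f,n,q,k,o,r,s,t,u] ]
 else
 [ -- block 128: chambers 2048…2063, four per line
 ![a,b,g,c,d,h,i,l,m,p,e,j,n,f,q,k,o,r,s,t,u], ![a,b,g,c,d,h,i,l,m,p,e,j,n,q,f,k,o,r,s,t,u], ![a,b,g,c,d,h,i,l,m,p,e,j,n,q,f,k,o,s,r,t,u], ![a,b,g,c,d,h,i,l,m,p,e,j,n,q,f,k,s,o,r,t,u],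
 ![a,b,g,c,d,h,i,l,m,p,e,j,n,q,f,s,k,o,r,t,u], ![a,b,g,c,d,h,i,l,m,p,e,j,n,q,s,f,k,o,r,t,u], ![a,b,g,c,h,d,e,f,i,j,k,l,m,n,o,p,q,r,s,t,u], ![a,b,g,c,h,d,e,f,i,j,k,l,m,n,o,p,q,s,r,t,u],
 ![a,b,g,c,h,d,e,f,i,j,l,k,m,n,o,p,q,r,s,t,u], ![a,b,g,c,h,d,e,f,i,j,l,k,m,n,o,p,q,s,r,t,u], ![a,b,g,c,h,d,e,f,i,l,j,k,m,n,o,p,q,r,s,t,u], ![a,b,g,c,h,d,e,f,i,l,j,k,m,n,o,p,q,s,r,t,u],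
 ![a,b,g,c,h,d,e,f,l,i,j,k,m,n,o,p,q,r,s,t,u], ![a,b,g,c,h,d,e,f,l,i,j,k,m,n,o,p,q,s,r,t,u], ![a,b,g,c,h,d,e,i,f,j,k,l,m,n,o,p,q,r,s,t,u], ![a,b,g,c,h,d,e,i,f,j,k,l,m,n,o,p,q,s,r,t,u] ]
 else
 if N < 130 then
 [ -- block 129: chambers 2064…2079, four per line
 ![a,b,g,c,h,d,e,i,f,j,k,l,m,n,p,o,q,r,s,t,u], ![a,b,g,c,h,d,e,i,f,j,k,l,m,n,p,o,q,s,r,t,u], ![a,b,g,c,h,d,e,i,f,j,l,k,m,n,o,p,q,r,s,t,u], ![a,b,g,c,h,d,e,i,f,j,l,k,m,n,o,p,q,s,r,t,u],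
 ![a,b,g,c,h,d,e,i,f,j,l,k,m,n,p,o,q,r,s,t,u], ![a,b,g,c,h,d,e,i,f,j,l,k,m,n,p,o,q,s,r,t,u], ![a,b,g,c,h,d,e,i,f,l,j,k,m,n,o,p,q,r,s,t,u], ![a,b,g,c,h,d,e,i,f,l,j,k,m,n,o,p,q,s,r,t,u],
 ![a,b,g,c,h,d,e,i,f,l,j,k,m,n,p,o,q,r,s,t,u], ![a,b,g,c,h,d,e,i,f,l,j,k,m,n,p,o,q,s,r,t,u], ![a,b,g,c,h,d,e,i,j,f,k,l,m,n,o,p,q,s,r,t,u], ![a,b,g,c,h,d,e,i,j,f,k,l,m,n,p,o,q,s,r,t,u],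
 ![a,b,g,c,h,d,e,i,j,f,k,l,m,n,p,q,o,s,r,t,u], ![a,b,g,c,h,d,e,i,j,f,k,l,m,n,p,q,s,o,r,t,u], ![a,b,g,c,h,d,e,i,j,f,l,k,m,n,o,p,q,s,r,t,u], ![a,b,g,c,h,d,e,i,j,f,l,k,m,n,p,o,q,s,r,t,u] ]
 else
 if N < 131 then
 [ -- block 130: chambers 2080…2095, four per line
 ![a,b,g,c,h,d,e,i,j,f,l,k,m,n,p,q,o,s,r,t,u], ![a,b,g,c,h,d,e,i,j,f,l,k,m,n,p,q,s,o,r,t,u], ![a,b,g,c,h,d,e,i,j,l,f,k,m,n,o,p,q,s,r,t,u], ![a,b,g,c,h,d,e,i,j,l,f,k,m,n,p,o,q,s,r,t,u],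
 ![a,b,g,c,h,d,e,i,j,l,f,k,m,n,p,q,o,s,r,t,u], ![a,b,g,c,h,d,e,i,j,l,f,k,m,n,p,q,s,o,r,t,u], ![a,b,g,c,h,d,e,i,j,l,f,m,k,n,p,q,o,s,r,t,u], ![a,b,g,c,h,d,e,i,j,l,f,m,k,n,p,q,s,o,r,t,u],
 ![a,b,g,c,h,d,e,i,j,l,f,m,n,k,p,q,s,o,r,t,u], ![a,b,g,c,h,d,e,i,j,l,m,f,n,k,p,q,s,o,r,t,u], ![a,b,g,c,h,d,e,i,j,l,m,f,n,p,k,q,s,o,r,t,u], ![a,b,g,c,h,d,e,i,j,l,m,n,f,k,p,q,s,o,r,t,u],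
 ![a,b,g,c,h,d,e,i,j,l,m,n,f,p,k,q,s,o,r,t,u], ![a,b,g,c,h,d,e,i,j,l,m,n,f,p,q,k,s,o,r,t,u], ![a,b,g,c,h,d,e,i,j,l,m,n,f,p,q,s,k,o,r,t,u], ![a,b,g,c,h,d,e,i,j,l,m,n,p,f,q,k,s,o,r,t,u] ]
 else
 [ -- block 131: chambers 2096…2111, four per line
 ![a,b,g,c,h,d,e,i,j,l,m,n,p,f,q,s,k,o,r,t,u], ![a,b,g,c,h,d,e,i,j,l,m,n,p,q,f,s,k,o,r,t,u], ![a,b,g,c,h,d,e,i,j,l,m,n,p,q,s,f,k,o,r,t,u], ![a,b,g,c,h,d,e,i,l,f,j,k,m,n,o,p,q,r,s,t,u],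
 ![a,b,g,c,h,d,e,i,l,f,j,k,m,n,o,p,q,s,r,t,u], ![a,b,g,c,h,d,e,i,l,f,j,k,m,n,p,o,q,r,s,t,u], ![a,b,g,c,h,d,e,i,l,f,j,k,m,n,p,o,q,s,r,t,u], ![a,b,g,c,h,d,e,i,l,f,j,m,k,n,p,o,q,r,s,t,u],
 ![a,b,g,c,h,d,e,i,l,f,j,m,k,n,p,o,q,s,r,t,u], ![a,b,g,c,h,d,e,i,l,j,f,k,m,n,o,p,q,s,r,t,u], ![a,b,g,c,h,d,e,i,l,j,f,k,m,n,p,o,q,s,r,t,u], ![a,b,g,c,h,d,e,i,l,j,f,m,k,n,p,o,q,s,r,t,u],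
 ![a,b,g,c,h,d,e,i,l,j,f,m,k,n,p,q,o,s,r,t,u], ![a,b,g,c,h,d,e,i,l,j,f,m,n,k,p,q,o,s,r,t,u], ![a,b,g,c,h,d,e,i,l,j,f,m,n,k,p,q,s,o,r,t,u], ![a,b,g,c,h,d,e,i,l,j,m,f,n,k,p,q,o,s,r,t,u] ]
 else
 if N < 137 then
 if N < 134 then
 if N < 133 then
 [ -- block 132: chambers 2112…2127, four per line
 ![a,b,g,c,h,d,e,i,l,j,m,f,n,k,p,q,s,o,r,t,u], ![a,b,g,c,h,d,e,i,l,j,m,f,n,p,k,q,o,s,r,t,u], ![a,b,g,c,h,d,e,i,l,j,m,f,n,p,k,q,s,o,r,t,u], ![a,b,g,c,h,d,e,i,l,j,m,n,f,k,p,q,s,o,r,t,u],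
 ![a,b,g,c,h,d,e,i,l,j,m,n,f,p,k,q,s,o,r,t,u], ![a,b,g,c,h,d,e,i,l,j,m,n,f,p,q,k,s,o,r,t,u], ![a,b,g,c,h,d,e,i,l,j,m,n,f,p,q,s,k,o,r,t,u], ![a,b,g,c,h,d,e,i,l,j,m,n,p,f,q,k,s,o,r,t,u],
 ![a,b,g,c,h,d,e,i,l,j,m,n,p,f,q,s,k,o,r,t,u], ![a,b,g,c,h,d,e,i,l,j,m,n,p,q,f,s,k,o,r,t,u], ![a,b,g,c,h,d,e,i,l,j,m,n,p,q,s,f,k,o,r,t,u], ![a,b,g,c,h,d,e,l,f,i,j,k,m,n,o,p,q,r,s,t,u],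
 ![a,b,g,c,h,d,e,l,f,i,j,k,m,n,o,p,q,s,r,t,u], ![a,b,g,c,h,d,e,l,i,f,j,k,m,n,o,p,q,r,s,t,u], ![a,b,g,c,h,d,e,l,i,f,j,k,m,n,o,p,q,s,r,t,u], ![a,b,g,c,h,d,e,l,i,f,j,m,k,n,o,p,q,r,s,t,u] ]
 else
 [ -- block 133: chambers 2128…2143, four per line
 ![a,b,g,c,h,d,e,l,i,f,j,m,k,n,o,p,q,s,r,t,u], ![a,b,g,c,h,d,e,l,i,f,j,m,k,n,p,o,q,r,s,t,u], ![a,b,g,c,h,d,e,l,i,f,j,m,k,n,p,o,q,s,r,t,u], ![a,b,g,c,h,d,e,l,i,j,f,k,m,n,o,p,q,s,r,t,u],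
 ![a,b,g,c,h,d,e,l,i,j,f,m,k,n,o,p,q,s,r,t,u], ![a,b,g,c,h,d,e,l,i,j,f,m,k,n,p,o,q,s,r,t,u], ![a,b,g,c,h,d,e,l,i,j,f,m,n,k,o,p,q,s,r,t,u], ![a,b,g,c,h,d,e,l,i,j,f,m,n,k,p,o,q,s,r,t,u],
 ![a,b,g,c,h,d,e,l,i,j,f,m,n,k,p,q,o,s,r,t,u], ![a,b,g,c,h,d,e,l,i,j,f,m,n,k,p,q,s,o,r,t,u], ![a,b,g,c,h,d,e,l,i,j,m,f,n,k,p,q,o,s,r,t,u], ![a,b,g,c,h,d,e,l,i,j,m,f,n,k,p,q,s,o,r,t,u],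
 ![a,b,g,c,h,d,e,l,i,j,m,f,n,p,k,q,o,s,r,t,u], ![a,b,g,c,h,d,e,l,i,j,m,f,n,p,k,q,s,o,r,t,u], ![a,b,g,c,h,d,e,l,i,j,m,n,f,k,p,q,s,o,r,t,u], ![a,b,g,c,h,d,e,l,i,j,m,n,f,p,k,q,s,o,r,t,u] ]
 else
 if N < 135 then
 [ -- block 134: chambers 2144…2159, four per line
 ![a,b,g,c,h,d,e,l,i,j,m,n,f,p,q,k,s,o,r,t,u], ![a,b,g,c,h,d,e,l,i,j,m,n,f,p,q,s,k,o,r,t,u], ![a,b,g,c,h,d,e,l,i,j,m,n,p,f,q,k,s,o,r,t,u], ![a,b,g,c,h,d,e,l,i,j,m,n,p,f,q,s,k,o,r,t,u],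
 ![a,b,g,c,h,d,e,l,i,j,m,n,p,q,f,s,k,o,r,t,u], ![a,b,g,c,h,d,e,l,i,j,m,n,p,q,s,f,k,o,r,t,u], ![a,b,g,c,h,d,i,e,f,j,k,l,m,n,o,p,q,r,s,t,u], ![a,b,g,c,h,d,i,e,f,j,k,l,m,n,p,o,q,r,s,t,u],
 ![a,b,g,c,h,d,i,e,f,j,k,l,m,p,n,o,q,r,s,t,u], ![a,b,g,c,h,d,i,e,f,j,l,k,m,n,o,p,q,r,s,t,u], ![a,b,g,c,h,d,i,e,f,j,l,k,m,n,p,o,q,r,s,t,u], ![a,b,g,c,h,d,i,e,f,j,l,k,m,p,n,o,q,r,s,t,u],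
 ![a,b,g,c,h,d,i,e,f,l,j,k,m,n,o,p,q,r,s,t,u], ![a,b,g,c,h,d,i,e,f,l,j,k,m,n,p,o,q,r,s,t,u], ![a,b,g,c,h,d,i,e,f,l,j,k,m,p,n,o,q,r,s,t,u], ![a,b,g,c,h,d,i,e,j,f,k,l,m,n,o,p,q,r,s,t,u] ]
 else
 if N < 136 then
 [ -- block 135: chambers 2160…2175, four per line
 ![a,b,g,c,h,d,i,e,j,f,k,l,m,n,o,p,q,s,r,t,u], ![a,b,g,c,h,d,i,e,j,f,k,l,m,n,p,o,q,r,s,t,u], ![a,b,g,c,h,d,i,e,j,f,k,l,m,n,p,o,q,s,r,t,u], ![a,b,g,c,h,d,i,e,j,f,k,l,m,n,p,q,o,s,r,t,u],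
 ![a,b,g,c,h,d,i,e,j,f,k,l,m,n,p,q,s,o,r,t,u], ![a,b,g,c,h,d,i,e,j,f,k,l,m,p,n,o,q,r,s,t,u], ![a,b,g,c,h,d,i,e,j,f,k,l,m,p,n,q,o,r,s,t,u], ![a,b,g,c,h,d,i,e,j,f,k,l,m,p,n,q,o,s,r,t,u],
 ![a,b,g,c,h,d,i,e,j,f,k,l,m,p,n,q,s,o,r,t,u], ![a,b,g,c,h,d,i,e,j,f,l,k,m,n,o,p,q,r,s,t,u], ![a,b,g,c,h,d,i,e,j,f,l,k,m,n,o,p,q,s,r,t,u], ![a,b,g,c,h,d,i,e,j,f,l,k,m,n,p,o,q,r,s,t,u],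
 ![a,b,g,c,h,d,i,e,j,f,l,k,m,n,p,o,q,s,r,t,u], ![a,b,g,c,h,d,i,e,j,f,l,k,m,n,p,q,o,s,r,t,u], ![a,b,g,c,h,d,i,e,j,f,l,k,m,n,p,q,s,o,r,t,u], ![a,b,g,c,h,d,i,e,j,f,l,k,m,p,n,o,q,r,s,t,u] ]
 else
 [ -- block 136: chambers 2176…2191, four per line
 ![a,b,g,c,h,d,i,e,j,f,l,k,m,p,n,q,o,r,s,t,u], ![a,b,g,c,h,d,i,e,j,f,l,k,m,p,n,q,o,s,r,t,u], ![a,b,g,c,h,d,i,e,j,f,l,k,m,p,n,q,s,o,r,t,u], ![a,b,g,c,h,d,i,e,j,l,f,k,m,n,o,p,q,r,s,t,u],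
 ![a,b,g,c,h,d,i,e,j,l,f,k,m,n,o,p,q,s,r,t,u], ![a,b,g,c,h,d,i,e,j,l,f,k,m,n,p,o,q,r,s,t,u], ![a,b,g,c,h,d,i,e,j,l,f,k,m,n,p,o,q,s,r,t,u], ![a,b,g,c,h,d,i,e,j,l,f,k,m,n,p,q,o,s,r,t,u],
 ![a,b,g,c,h,d,i,e,j,l,f,k,m,n,p,q,s,o,r,t,u], ![a,b,g,c,h,d,i,e,j,l,f,k,m,p,n,o,q,r,s,t,u], ![a,b,g,c,h,d,i,e,j,l,f,k,m,p,n,q,o,r,s,t,u], ![a,b,g,c,h,d,i,e,j,l,f,k,m,p,n,q,o,s,r,t,u],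
 ![a,b,g,c,h,d,i,e,j,l,f,k,m,p,n,q,s,o,r,t,u], ![a,b,g,c,h,d,i,e,j,l,f,m,k,n,p,q,o,s,r,t,u], ![a,b,g,c,h,d,i,e,j,l,f,m,k,n,p,q,s,o,r,t,u], ![a,b,g,c,h,d,i,e,j,l,f,m,k,p,n,q,o,r,s,t,u] ]
 else
 if N < 139 then
 if N < 138 then
 [ -- block 137: chambers 2192…2207, four per line
 ![a,b,g,c,h,d,i,e,j,l,f,m,k,p,n,q,o,s,r,t,u], ![a,b,g,c,h,d,i,e,j,l,f,m,k,p,n,q,s,o,r,t,u], ![a,b,g,c,h,d,i,e,j,l,m,f,k,n,p,q,o,s,r,t,u], ![a,b,g,c,h,d,i,e,j,l,m,f,k,n,p,q,s,o,r,t,u],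
 ![a,b,g,c,h,d,i,e,j,l,m,f,k,p,n,q,o,r,s,t,u], ![a,b,g,c,h,d,i,e,j,l,m,f,k,p,n,q,o,s,r,t,u], ![a,b,g,c,h,d,i,e,j,l,m,f,k,p,n,q,s,o,r,t,u], ![a,b,g,c,h,d,i,e,j,l,m,f,n,k,p,q,s,o,r,t,u],
 ![a,b,g,c,h,d,i,e,j,l,m,f,n,p,k,q,s,o,r,t,u], ![a,b,g,c,h,d,i,e,j,l,m,f,p,k,n,q,o,r,s,t,u], ![a,b,g,c,h,d,i,e,j,l,m,f,p,k,n,q,o,s,r,t,u], ![a,b,g,c,h,d,i,e,j,l,m,f,p,k,n,q,s,o,r,t,u],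
 ![a,b,g,c,h,d,i,e,j,l,m,f,p,n,k,q,s,o,r,t,u], ![a,b,g,c,h,d,i,e,j,l,m,n,f,k,p,q,s,o,r,t,u], ![a,b,g,c,h,d,i,e,j,l,m,n,f,p,k,q,s,o,r,t,u], ![a,b,g,c,h,d,i,e,j,l,m,n,p,f,k,q,s,o,r,t,u] ]
 else
 [ -- block 138: chambers 2208…2223, four per line
 ![a,b,g,c,h,d,i,e,j,l,m,n,p,f,q,k,s,o,r,t,u], ![a,b,g,c,h,d,i,e,j,l,m,n,p,q,f,k,s,o,r,t,u], ![a,b,g,c,h,d,i,e,j,l,m,n,p,q,f,s,k,o,r,t,u], ![a,b,g,c,h,d,i,e,j,l,m,n,p,q,s,f,k,o,r,t,u],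
 ![a,b,g,c,h,d,i,e,j,l,m,p,f,k,n,q,o,r,s,t,u], ![a,b,g,c,h,d,i,e,j,l,m,p,f,k,n,q,o,s,r,t,u], ![a,b,g,c,h,d,i,e,j,l,m,p,f,k,n,q,s,o,r,t,u], ![a,b,g,c,h,d,i,e,j,l,m,p,f,n,k,q,s,o,r,t,u],
 ![a,b,g,c,h,d,i,e,j,l,m,p,n,f,k,q,s,o,r,t,u], ![a,b,g,c,h,d,i,e,j,l,m,p,n,f,q,k,s,o,r,t,u], ![a,b,g,c,h,d,i,e,j,l,m,p,n,q,f,k,s,o,r,t,u], ![a,b,g,c,h,d,i,e,j,l,m,p,n,q,f,s,k,o,r,t,u],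
 ![a,b,g,c,h,d,i,e,j,l,m,p,n,q,s,f,k,o,r,t,u], ![a,b,g,c,h,d,i,e,l,f,j,k,m,n,o,p,q,r,s,t,u], ![a,b,g,c,h,d,i,e,l,f,j,k,m,n,p,o,q,r,s,t,u], ![a,b,g,c,h,d,i,e,l,f,j,k,m,p,n,o,q,r,s,t,u] ]
 else
 if N < 140 then
 [ -- block 139: chambers 2224…2239, four per line
 ![a,b,g,c,h,d,i,e,l,f,j,m,k,n,p,o,q,r,s,t,u], ![a,b,g,c,h,d,i,e,l,f,j,m,k,p,n,o,q,r,s,t,u], ![a,b,g,c,h,d,i,e,l,j,f,k,m,n,o,p,q,r,s,t,u], ![a,b,g,c,h,d,i,e,l,j,f,k,m,n,o,p,q,s,r,t,u],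
 ![a,b,g,c,h,d,i,e,l,j,f,k,m,n,p,o,q,r,s,t,u], ![a,b,g,c,h,d,i,e,l,j,f,k,m,n,p,o,q,s,r,t,u], ![a,b,g,c,h,d,i,e,l,j,f,k,m,p,n,o,q,r,s,t,u], ![a,b,g,c,h,d,i,e,l,j,f,m,k,n,p,o,q,r,s,t,u],
 ![a,b,g,c,h,d,i,e,l,j,f,m,k,n,p,o,q,s,r,t,u], ![a,b,g,c,h,d,i,e,l,j,f,m,k,n,p,q,o,s,r,t,u], ![a,b,g,c,h,d,i,e,l,j,f,m,k,p,n,o,q,r,s,t,u], ![a,b,g,c,h,d,i,e,l,j,f,m,k,p,n,q,o,r,s,t,u],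
 ![a,b,g,c,h,d,i,e,l,j,f,m,k,p,n,q,o,s,r,t,u], ![a,b,g,c,h,d,i,e,l,j,m,f,k,n,p,q,o,s,r,t,u], ![a,b,g,c,h,d,i,e,l,j,m,f,k,p,n,q,o,r,s,t,u], ![a,b,g,c,h,d,i,e,l,j,m,f,k,p,n,q,o,s,r,t,u] ]
 else
 if N < 141 then
 [ -- block 140: chambers 2240…2255, four per line
 ![a,b,g,c,h,d,i,e,l,j,m,f,n,k,p,q,o,s,r,t,u], ![a,b,g,c,h,d,i,e,l,j,m,f,n,k,p,q,s,o,r,t,u], ![a,b,g,c,h,d,i,e,l,j,m,f,n,p,k,q,o,s,r,t,u], ![a,b,g,c,h,d,i,e,l,j,m,f,n,p,k,q,s,o,r,t,u],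
 ![a,b,g,c,h,d,i,e,l,j,m,f,p,k,n,q,o,r,s,t,u], ![a,b,g,c,h,d,i,e,l,j,m,f,p,k,n,q,o,s,r,t,u], ![a,b,g,c,h,d,i,e,l,j,m,f,p,n,k,q,o,s,r,t,u], ![a,b,g,c,h,d,i,e,l,j,m,f,p,n,k,q,s,o,r,t,u],
 ![a,b,g,c,h,d,i,e,l,j,m,n,f,k,p,q,s,o,r,t,u], ![a,b,g,c,h,d,i,e,l,j,m,n,f,p,k,q,s,o,r,t,u], ![a,b,g,c,h,d,i,e,l,j,m,n,p,f,k,q,s,o,r,t,u], ![a,b,g,c,h,d,i,e,l,j,m,n,p,f,q,k,s,o,r,t,u],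
 ![a,b,g,c,h,d,i,e,l,j,m,n,p,q,f,k,s,o,r,t,u], ![a,b,g,c,h,d,i,e,l,j,m,n,p,q,f,s,k,o,r,t,u], ![a,b,g,c,h,d,i,e,l,j,m,n,p,q,s,f,k,o,r,t,u], ![a,b,g,c,h,d,i,e,l,j,m,p,f,k,n,q,o,r,s,t,u] ]
 else
 [ -- block 141: chambers 2256…2271, four per line
 ![a,b,g,c,h,d,i,e,l,j,m,p,f,k,n,q,o,s,r,t,u], ![a,b,g,c,h,d,i,e,l,j,m,p,f,n,k,q,o,s,r,t,u], ![a,b,g,c,h,d,i,e,l,j,m,p,f,n,k,q,s,o,r,t,u], ![a,b,g,c,h,d,i,e,l,j,m,p,n,f,k,q,s,o,r,t,u],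
 ![a,b,g,c,h,d,i,e,l,j,m,p,n,f,q,k,s,o,r,t,u], ![a,b,g,c,h,d,i,e,l,j,m,p,n,q,f,k,s,o,r,t,u], ![a,b,g,c,h,d,i,e,l,j,m,p,n,q,f,s,k,o,r,t,u], ![a,b,g,c,h,d,i,e,l,j,m,p,n,q,s,f,k,o,r,t,u],
 ![a,b,g,c,h,d,i,l,e,f,j,k,m,n,o,p,q,r,s,t,u], ![a,b,g,c,h,d,i,l,e,f,j,k,m,n,p,o,q,r,s,t,u], ![a,b,g,c,h,d,i,l,e,f,j,k,m,p,n,o,q,r,s,t,u], ![a,b,g,c,h,d,i,l,e,f,j,m,k,n,p,o,q,r,s,t,u],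
 ![a,b,g,c,h,d,i,l,e,f,j,m,k,p,n,o,q,r,s,t,u], ![a,b,g,c,h,d,i,l,e,f,m,j,k,p,n,o,q,r,s,t,u], ![a,b,g,c,h,d,i,l,e,j,f,k,m,n,o,p,q,r,s,t,u], ![a,b,g,c,h,d,i,l,e,j,f,k,m,n,o,p,q,s,r,t,u] ]
 else
 if N < 152 then
 if N < 147 then
 if N < 144 then
 if N < 143 then
 [ -- block 142: chambers 2272…2287, four per line
 ![a,b,g,c,h,d,i,l,e,j,f,k,m,n,p,o,q,r,s,t,u], ![a,b,g,c,h,d,i,l,e,j,f,k,m,n,p,o,q,s,r,t,u], ![a,b,g,c,h,d,i,l,e,j,f,k,m,p,n,o,q,r,s,t,u], ![a,b,g,c,h,d,i,l,e,j,f,m,k,n,p,o,q,r,s,t,u],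
 ![a,b,g,c,h,d,i,l,e,j,f,m,k,n,p,o,q,s,r,t,u], ![a,b,g,c,h,d,i,l,e,j,f,m,k,p,n,o,q,r,s,t,u], ![a,b,g,c,h,d,i,l,e,j,m,f,k,n,p,o,q,r,s,t,u], ![a,b,g,c,h,d,i,l,e,j,m,f,k,n,p,o,q,s,r,t,u],
 ![a,b,g,c,h,d,i,l,e,j,m,f,k,n,p,q,o,s,r,t,u], ![a,b,g,c,h,d,i,l,e,j,m,f,k,p,n,o,q,r,s,t,u], ![a,b,g,c,h,d,i,l,e,j,m,f,k,p,n,q,o,r,s,t,u], ![a,b,g,c,h,d,i,l,e,j,m,f,k,p,n,q,o,s,r,t,u],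
 ![a,b,g,c,h,d,i,l,e,j,m,f,n,k,p,q,o,s,r,t,u], ![a,b,g,c,h,d,i,l,e,j,m,f,n,p,k,q,o,s,r,t,u], ![a,b,g,c,h,d,i,l,e,j,m,f,p,k,n,q,o,r,s,t,u], ![a,b,g,c,h,d,i,l,e,j,m,f,p,k,n,q,o,s,r,t,u] ]
 else
 [ -- block 143: chambers 2288…2303, four per line
 ![a,b,g,c,h,d,i,l,e,j,m,f,p,n,k,q,o,s,r,t,u], ![a,b,g,c,h,d,i,l,e,j,m,n,f,k,p,q,o,s,r,t,u], ![a,b,g,c,h,d,i,l,e,j,m,n,f,k,p,q,s,o,r,t,u], ![a,b,g,c,h,d,i,l,e,j,m,n,f,p,k,q,o,s,r,t,u],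
 ![a,b,g,c,h,d,i,l,e,j,m,n,f,p,k,q,s,o,r,t,u], ![a,b,g,c,h,d,i,l,e,j,m,n,p,f,k,q,o,s,r,t,u], ![a,b,g,c,h,d,i,l,e,j,m,n,p,f,k,q,s,o,r,t,u], ![a,b,g,c,h,d,i,l,e,j,m,n,p,f,q,k,s,o,r,t,u],
 ![a,b,g,c,h,d,i,l,e,j,m,n,p,q,f,k,s,o,r,t,u], ![a,b,g,c,h,d,i,l,e,j,m,n,p,q,f,s,k,o,r,t,u], ![a,b,g,c,h,d,i,l,e,j,m,n,p,q,s,f,k,o,r,t,u], ![a,b,g,c,h,d,i,l,e,j,m,p,f,k,n,q,o,r,s,t,u],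
 ![a,b,g,c,h,d,i,l,e,j,m,p,f,k,n,q,o,s,r,t,u], ![a,b,g,c,h,d,i,l,e,j,m,p,f,n,k,q,o,s,r,t,u], ![a,b,g,c,h,d,i,l,e,j,m,p,n,f,k,q,o,s,r,t,u], ![a,b,g,c,h,d,i,l,e,j,m,p,n,f,k,q,s,o,r,t,u] ]
 else
 if N < 145 then
 [ -- block 144: chambers 2304…2319, four per line
 ![a,b,g,c,h,d,i,l,e,j,m,p,n,f,q,k,s,o,r,t,u], ![a,b,g,c,h,d,i,l,e,j,m,p,n,q,f,k,s,o,r,t,u], ![a,b,g,c,h,d,i,l,e,j,m,p,n,q,f,s,k,o,r,t,u], ![a,b,g,c,h,d,i,l,e,j,m,p,n,q,s,f,k,o,r,t,u],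
 ![a,b,g,c,h,d,i,l,e,m,f,j,k,p,n,o,q,r,s,t,u], ![a,b,g,c,h,d,i,l,e,m,f,j,p,k,n,o,q,r,s,t,u], ![a,b,g,c,h,d,i,l,e,m,j,f,k,p,n,o,q,r,s,t,u], ![a,b,g,c,h,d,i,l,e,m,j,f,p,k,n,o,q,r,s,t,u],
 ![a,b,g,c,h,d,i,l,e,m,j,f,p,k,n,q,o,r,s,t,u], ![a,b,g,c,h,d,i,l,e,m,j,f,p,n,k,q,o,r,s,t,u], ![a,b,g,c,h,d,i,l,e,m,j,f,p,n,k,q,o,s,r,t,u], ![a,b,g,c,h,d,i,l,e,m,j,p,f,k,n,q,o,r,s,t,u],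
 ![a,b,g,c,h,d,i,l,e,m,j,p,f,n,k,q,o,r,s,t,u], ![a,b,g,c,h,d,i,l,e,m,j,p,f,n,k,q,o,s,r,t,u], ![a,b,g,c,h,d,i,l,e,m,j,p,n,f,k,q,o,s,r,t,u], ![a,b,g,c,h,d,i,l,e,m,j,p,n,f,q,k,o,s,r,t,u] ]
 else
 if N < 146 then
 [ -- block 145: chambers 2320…2335, four per line
 ![a,b,g,c,h,d,i,l,e,m,j,p,n,f,q,k,s,o,r,t,u], ![a,b,g,c,h,d,i,l,e,m,j,p,n,q,f,k,s,o,r,t,u], ![a,b,g,c,h,d,i,l,e,m,j,p,n,q,f,s,k,o,r,t,u], ![a,b,g,c,h,d,i,l,e,m,j,p,n,q,s,f,k,o,r,t,u],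
 ![a,b,g,c,h,d,i,l,m,e,f,j,k,p,n,o,q,r,s,t,u], ![a,b,g,c,h,d,i,l,m,e,f,j,p,k,n,o,q,r,s,t,u], ![a,b,g,c,h,d,i,l,m,e,f,p,j,k,n,o,q,r,s,t,u], ![a,b,g,c,h,d,i,l,m,e,j,f,k,p,n,o,q,r,s,t,u],
 ![a,b,g,c,h,d,i,l,m,e,j,f,p,k,n,o,q,r,s,t,u], ![a,b,g,c,h,d,i,l,m,e,j,p,f,k,n,o,q,r,s,t,u], ![a,b,g,c,h,d,i,l,m,e,j,p,f,k,n,q,o,r,s,t,u], ![a,b,g,c,h,d,i,l,m,e,j,p,f,n,k,q,o,r,s,t,u],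
 ![a,b,g,c,h,d,i,l,m,e,j,p,n,f,k,q,o,r,s,t,u], ![a,b,g,c,h,d,i,l,m,e,j,p,n,f,k,q,o,s,r,t,u], ![a,b,g,c,h,d,i,l,m,e,j,p,n,f,q,k,o,s,r,t,u], ![a,b,g,c,h,d,i,l,m,e,j,p,n,q,f,k,o,s,r,t,u] ]
 else
 [ -- block 146: chambers 2336…2351, four per line
 ![a,b,g,c,h,d,i,l,m,e,j,p,n,q,f,k,s,o,r,t,u], ![a,b,g,c,h,d,i,l,m,e,j,p,n,q,f,s,k,o,r,t,u], ![a,b,g,c,h,d,i,l,m,e,j,p,n,q,s,f,k,o,r,t,u], ![a,b,g,c,h,d,i,l,m,e,p,f,j,k,n,o,q,r,s,t,u],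
 ![a,b,g,c,h,d,i,l,m,e,p,j,f,k,n,o,q,r,s,t,u], ![a,b,g,c,h,d,i,l,m,e,p,j,f,k,n,q,o,r,s,t,u], ![a,b,g,c,h,d,i,l,m,e,p,j,f,n,k,q,o,r,s,t,u], ![a,b,g,c,h,d,i,l,m,e,p,j,n,f,k,q,o,r,s,t,u],
 ![a,b,g,c,h,d,i,l,m,e,p,j,n,f,q,k,o,r,s,t,u], ![a,b,g,c,h,d,i,l,m,e,p,j,n,f,q,k,o,s,r,t,u], ![a,b,g,c,h,d,i,l,m,e,p,j,n,q,f,k,o,s,r,t,u], ![a,b,g,c,h,d,i,l,m,e,p,j,n,q,f,k,s,o,r,t,u],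
 ![a,b,g,c,h,d,i,l,m,e,p,j,n,q,f,s,k,o,r,t,u], ![a,b,g,c,h,d,i,l,m,e,p,j,n,q,s,f,k,o,r,t,u], ![a,b,g,c,h,d,i,l,m,p,e,f,j,k,n,o,q,r,s,t,u], ![a,b,g,c,h,d,i,l,m,p,e,j,f,k,n,o,q,r,s,t,u] ]
 else
 if N < 149 then
 if N < 148 then
 [ -- block 147: chambers 2352…2367, four per line
 ![a,b,g,c,h,d,i,l,m,p,e,j,f,k,n,q,o,r,s,t,u], ![a,b,g,c,h,d,i,l,m,p,e,j,f,n,k,q,o,r,s,t,u], ![a,b,g,c,h,d,i,l,m,p,e,j,n,f,k,q,o,r,s,t,u], ![a,b,g,c,h,d,i,l,m,p,e,j,n,f,q,k,o,r,s,t,u],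
 ![a,b,g,c,h,d,i,l,m,p,e,j,n,q,f,k,o,r,s,t,u], ![a,b,g,c,h,d,i,l,m,p,e,j,n,q,f,k,o,s,r,t,u], ![a,b,g,c,h,d,i,l,m,p,e,j,n,q,f,k,s,o,r,t,u], ![a,b,g,c,h,d,i,l,m,p,e,j,n,q,f,s,k,o,r,t,u],
 ![a,b,g,c,h,d,i,l,m,p,e,j,n,q,s,f,k,o,r,t,u], ![a,b,g,c,h,d,l,e,f,i,j,k,m,n,o,p,q,r,s,t,u], ![a,b,g,c,h,d,l,e,f,i,j,k,m,n,o,p,q,s,r,t,u], ![a,b,g,c,h,d,l,e,i,f,j,k,m,n,o,p,q,r,s,t,u],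
 ![a,b,g,c,h,d,l,e,i,f,j,k,m,n,o,p,q,s,r,t,u], ![a,b,g,c,h,d,l,e,i,f,j,m,k,n,o,p,q,r,s,t,u], ![a,b,g,c,h,d,l,e,i,f,j,m,k,n,o,p,q,s,r,t,u], ![a,b,g,c,h,d,l,e,i,f,j,m,k,n,p,o,q,r,s,t,u] ]
 else
 [ -- block 148: chambers 2368…2383, four per line
 ![a,b,g,c,h,d,l,e,i,f,j,m,k,n,p,o,q,s,r,t,u], ![a,b,g,c,h,d,l,e,i,j,f,k,m,n,o,p,q,s,r,t,u], ![a,b,g,c,h,d,l,e,i,j,f,m,k,n,o,p,q,s,r,t,u], ![a,b,g,c,h,d,l,e,i,j,f,m,k,n,p,o,q,s,r,t,u],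
 ![a,b,g,c,h,d,l,e,i,j,f,m,n,k,o,p,q,s,r,t,u], ![a,b,g,c,h,d,l,e,i,j,f,m,n,k,p,o,q,s,r,t,u], ![a,b,g,c,h,d,l,e,i,j,m,f,n,k,p,o,q,s,r,t,u], ![a,b,g,c,h,d,l,e,i,j,m,f,n,k,p,q,o,s,r,t,u],
 ![a,b,g,c,h,d,l,e,i,j,m,f,n,p,k,q,o,s,r,t,u], ![a,b,g,c,h,d,l,e,i,j,m,n,f,k,p,q,o,s,r,t,u], ![a,b,g,c,h,d,l,e,i,j,m,n,f,k,p,q,s,o,r,t,u], ![a,b,g,c,h,d,l,e,i,j,m,n,f,p,k,q,o,s,r,t,u],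
 ![a,b,g,c,h,d,l,e,i,j,m,n,f,p,k,q,s,o,r,t,u], ![a,b,g,c,h,d,l,e,i,j,m,n,f,p,q,k,s,o,r,t,u], ![a,b,g,c,h,d,l,e,i,j,m,n,f,p,q,s,k,o,r,t,u], ![a,b,g,c,h,d,l,e,i,j,m,n,p,f,q,k,s,o,r,t,u] ]
 else
 if N < 150 then
 [ -- block 149: chambers 2384…2399, four per line
 ![a,b,g,c,h,d,l,e,i,j,m,n,p,f,q,s,k,o,r,t,u], ![a,b,g,c,h,d,l,e,i,j,m,n,p,q,f,s,k,o,r,t,u], ![a,b,g,c,h,d,l,e,i,j,m,n,p,q,s,f,k,o,r,t,u], ![a,b,g,c,h,d,l,i,e,f,j,k,m,n,o,p,q,r,s,t,u],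
 ![a,b,g,c,h,d,l,i,e,f,j,m,k,n,o,p,q,r,s,t,u], ![a,b,g,c,h,d,l,i,e,f,j,m,k,n,p,o,q,r,s,t,u], ![a,b,g,c,h,d,l,i,e,f,m,j,k,n,o,p,q,r,s,t,u], ![a,b,g,c,h,d,l,i,e,f,m,j,k,n,p,o,q,r,s,t,u],
 ![a,b,g,c,h,d,l,i,e,f,m,j,k,p,n,o,q,r,s,t,u], ![a,b,g,c,h,d,l,i,e,j,f,k,m,n,o,p,q,r,s,t,u], ![a,b,g,c,h,d,l,i,e,j,f,k,m,n,o,p,q,s,r,t,u], ![a,b,g,c,h,d,l,i,e,j,f,m,k,n,o,p,q,r,s,t,u],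
 ![a,b,g,c,h,d,l,i,e,j,f,m,k,n,o,p,q,s,r,t,u], ![a,b,g,c,h,d,l,i,e,j,f,m,k,n,p,o,q,r,s,t,u], ![a,b,g,c,h,d,l,i,e,j,f,m,k,n,p,o,q,s,r,t,u], ![a,b,g,c,h,d,l,i,e,j,m,f,k,n,p,o,q,r,s,t,u] ]
 else
 if N < 151 then
 [ -- block 150: chambers 2400…2415, four per line
 ![a,b,g,c,h,d,l,i,e,j,m,f,k,n,p,o,q,s,r,t,u], ![a,b,g,c,h,d,l,i,e,j,m,f,n,k,p,o,q,s,r,t,u], ![a,b,g,c,h,d,l,i,e,j,m,f,n,k,p,q,o,s,r,t,u], ![a,b,g,c,h,d,l,i,e,j,m,f,n,p,k,q,o,s,r,t,u],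
 ![a,b,g,c,h,d,l,i,e,j,m,n,f,k,p,q,o,s,r,t,u], ![a,b,g,c,h,d,l,i,e,j,m,n,f,k,p,q,s,o,r,t,u], ![a,b,g,c,h,d,l,i,e,j,m,n,f,p,k,q,o,s,r,t,u], ![a,b,g,c,h,d,l,i,e,j,m,n,f,p,k,q,s,o,r,t,u],
 ![a,b,g,c,h,d,l,i,e,j,m,n,p,f,k,q,o,s,r,t,u], ![a,b,g,c,h,d,l,i,e,j,m,n,p,f,k,q,s,o,r,t,u], ![a,b,g,c,h,d,l,i,e,j,m,n,p,f,q,k,s,o,r,t,u], ![a,b,g,c,h,d,l,i,e,j,m,n,p,q,f,k,s,o,r,t,u],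
 ![a,b,g,c,h,d,l,i,e,j,m,n,p,q,f,s,k,o,r,t,u], ![a,b,g,c,h,d,l,i,e,j,m,n,p,q,s,f,k,o,r,t,u], ![a,b,g,c,h,d,l,i,e,m,f,j,k,n,p,o,q,r,s,t,u], ![a,b,g,c,h,d,l,i,e,m,f,j,k,p,n,o,q,r,s,t,u] ]
 else
 [ -- block 151: chambers 2416…2431, four per line
 ![a,b,g,c,h,d,l,i,e,m,f,j,p,k,n,o,q,r,s,t,u], ![a,b,g,c,h,d,l,i,e,m,j,f,k,n,p,o,q,r,s,t,u], ![a,b,g,c,h,d,l,i,e,m,j,f,k,p,n,o,q,r,s,t,u], ![a,b,g,c,h,d,l,i,e,m,j,f,n,k,p,o,q,r,s,t,u],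
 ![a,b,g,c,h,d,l,i,e,m,j,f,n,k,p,o,q,s,r,t,u], ![a,b,g,c,h,d,l,i,e,m,j,f,n,p,k,o,q,r,s,t,u], ![a,b,g,c,h,d,l,i,e,m,j,f,n,p,k,o,q,s,r,t,u], ![a,b,g,c,h,d,l,i,e,m,j,f,n,p,k,q,o,s,r,t,u],
 ![a,b,g,c,h,d,l,i,e,m,j,f,p,k,n,o,q,r,s,t,u], ![a,b,g,c,h,d,l,i,e,m,j,f,p,n,k,o,q,r,s,t,u], ![a,b,g,c,h,d,l,i,e,m,j,f,p,n,k,q,o,r,s,t,u], ![a,b,g,c,h,d,l,i,e,m,j,f,p,n,k,q,o,s,r,t,u],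
 ![a,b,g,c,h,d,l,i,e,m,j,n,f,p,k,q,o,s,r,t,u], ![a,b,g,c,h,d,l,i,e,m,j,n,p,f,k,q,o,s,r,t,u], ![a,b,g,c,h,d,l,i,e,m,j,n,p,f,q,k,o,s,r,t,u], ![a,b,g,c,h,d,l,i,e,m,j,n,p,f,q,k,s,o,r,t,u] ]
 else
 if N < 157 then
 if N < 154 then
 if N < 153 then
 [ -- block 152: chambers 2432…2447, four per line
 ![a,b,g,c,h,d,l,i,e,m,j,n,p,q,f,k,s,o,r,t,u], ![a,b,g,c,h,d,l,i,e,m,j,n,p,q,f,s,k,o,r,t,u], ![a,b,g,c,h,d,l,i,e,m,j,n,p,q,s,f,k,o,r,t,u], ![a,b,g,c,h,d,l,i,e,m,j,p,f,n,k,q,o,r,s,t,u],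
 ![a,b,g,c,h,d,l,i,e,m,j,p,f,n,k,q,o,s,r,t,u], ![a,b,g,c,h,d,l,i,e,m,j,p,n,f,k,q,o,s,r,t,u], ![a,b,g,c,h,d,l,i,e,m,j,p,n,f,q,k,o,s,r,t,u], ![a,b,g,c,h,d,l,i,e,m,j,p,n,f,q,k,s,o,r,t,u],
 ![a,b,g,c,h,d,l,i,e,m,j,p,n,q,f,k,s,o,r,t,u], ![a,b,g,c,h,d,l,i,e,m,j,p,n,q,f,s,k,o,r,t,u], ![a,b,g,c,h,d,l,i,e,m,j,p,n,q,s,f,k,o,r,t,u], ![a,b,g,c,h,d,l,i,m,e,f,j,k,p,n,o,q,r,s,t,u],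
 ![a,b,g,c,h,d,l,i,m,e,f,j,p,k,n,o,q,r,s,t,u], ![a,b,g,c,h,d,l,i,m,e,f,p,j,k,n,o,q,r,s,t,u], ![a,b,g,c,h,d,l,i,m,e,j,f,k,p,n,o,q,r,s,t,u], ![a,b,g,c,h,d,l,i,m,e,j,f,p,k,n,o,q,r,s,t,u] ]
 else
 [ -- block 153: chambers 2448…2463, four per line
 ![a,b,g,c,h,d,l,i,m,e,j,f,p,n,k,o,q,r,s,t,u], ![a,b,g,c,h,d,l,i,m,e,j,p,f,k,n,o,q,r,s,t,u], ![a,b,g,c,h,d,l,i,m,e,j,p,f,n,k,o,q,r,s,t,u], ![a,b,g,c,h,d,l,i,m,e,j,p,f,n,k,q,o,r,s,t,u],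
 ![a,b,g,c,h,d,l,i,m,e,j,p,n,f,k,q,o,r,s,t,u], ![a,b,g,c,h,d,l,i,m,e,j,p,n,f,k,q,o,s,r,t,u], ![a,b,g,c,h,d,l,i,m,e,j,p,n,f,q,k,o,s,r,t,u], ![a,b,g,c,h,d,l,i,m,e,j,p,n,q,f,k,o,s,r,t,u],
 ![a,b,g,c,h,d,l,i,m,e,j,p,n,q,f,k,s,o,r,t,u], ![a,b,g,c,h,d,l,i,m,e,j,p,n,q,f,s,k,o,r,t,u], ![a,b,g,c,h,d,l,i,m,e,j,p,n,q,s,f,k,o,r,t,u], ![a,b,g,c,h,d,l,i,m,e,p,f,j,k,n,o,q,r,s,t,u],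
 ![a,b,g,c,h,d,l,i,m,e,p,j,f,k,n,o,q,r,s,t,u], ![a,b,g,c,h,d,l,i,m,e,p,j,f,n,k,o,q,r,s,t,u], ![a,b,g,c,h,d,l,i,m,e,p,j,f,n,k,q,o,r,s,t,u], ![a,b,g,c,h,d,l,i,m,e,p,j,n,f,k,q,o,r,s,t,u] ]
 else
 if N < 155 then
 [ -- block 154: chambers 2464…2479, four per line
 ![a,b,g,c,h,d,l,i,m,e,p,j,n,f,q,k,o,r,s,t,u], ![a,b,g,c,h,d,l,i,m,e,p,j,n,f,q,k,o,s,r,t,u], ![a,b,g,c,h,d,l,i,m,e,p,j,n,q,f,k,o,s,r,t,u], ![a,b,g,c,h,d,l,i,m,e,p,j,n,q,f,k,s,o,r,t,u],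
 ![a,b,g,c,h,d,l,i,m,e,p,j,n,q,f,s,k,o,r,t,u], ![a,b,g,c,h,d,l,i,m,e,p,j,n,q,s,f,k,o,r,t,u], ![a,b,g,c,h,d,l,i,m,p,e,f,j,k,n,o,q,r,s,t,u], ![a,b,g,c,h,d,l,i,m,p,e,j,f,k,n,o,q,r,s,t,u],
 ![a,b,g,c,h,d,l,i,m,p,e,j,f,n,k,o,q,r,s,t,u], ![a,b,g,c,h,d,l,i,m,p,e,j,f,n,k,q,o,r,s,t,u], ![a,b,g,c,h,d,l,i,m,p,e,j,n,f,k,q,o,r,s,t,u], ![a,b,g,c,h,d,l,i,m,p,e,j,n,f,q,k,o,r,s,t,u],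
 ![a,b,g,c,h,d,l,i,m,p,e,j,n,q,f,k,o,r,s,t,u], ![a,b,g,c,h,d,l,i,m,p,e,j,n,q,f,k,o,s,r,t,u], ![a,b,g,c,h,d,l,i,m,p,e,j,n,q,f,k,s,o,r,t,u], ![a,b,g,c,h,d,l,i,m,p,e,j,n,q,f,s,k,o,r,t,u] ]
 else
 if N < 156 then
 [ -- block 155: chambers 2480…2495, four per line
 ![a,b,g,c,h,d,l,i,m,p,e,j,n,q,s,f,k,o,r,t,u], ![a,b,g,c,h,l,d,e,f,i,j,k,m,n,o,p,q,r,s,t,u], ![a,b,g,c,h,l,d,e,f,i,j,k,m,n,o,p,q,s,r,t,u], ![a,b,g,c,h,l,d,e,i,f,j,k,m,n,o,p,q,r,s,t,u],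
 ![a,b,g,c,h,l,d,e,i,f,j,k,m,n,o,p,q,s,r,t,u], ![a,b,g,c,h,l,d,e,i,f,j,m,k,n,o,p,q,r,s,t,u], ![a,b,g,c,h,l,d,e,i,f,j,m,k,n,o,p,q,s,r,t,u], ![a,b,g,c,h,l,d,e,i,j,f,k,m,n,o,p,q,s,r,t,u],
 ![a,b,g,c,h,l,d,e,i,j,f,m,k,n,o,p,q,s,r,t,u], ![a,b,g,c,h,l,d,e,i,j,f,m,n,k,o,p,q,s,r,t,u], ![a,b,g,c,h,l,d,e,i,j,m,f,n,k,o,p,q,s,r,t,u], ![a,b,g,c,h,l,d,e,i,j,m,f,n,k,p,o,q,s,r,t,u],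
 ![a,b,g,c,h,l,d,e,i,j,m,n,f,k,o,p,q,s,r,t,u], ![a,b,g,c,h,l,d,e,i,j,m,n,f,k,p,o,q,s,r,t,u], ![a,b,g,c,h,l,d,e,i,j,m,n,f,k,p,q,o,s,r,t,u], ![a,b,g,c,h,l,d,e,i,j,m,n,f,k,p,q,s,o,r,t,u] ]
 else
 [ -- block 156: chambers 2496…2511, four per line
 ![a,b,g,c,h,l,d,e,i,j,m,n,f,p,k,q,o,s,r,t,u], ![a,b,g,c,h,l,d,e,i,j,m,n,f,p,k,q,s,o,r,t,u], ![a,b,g,c,h,l,d,e,i,j,m,n,f,p,q,k,s,o,r,t,u], ![a,b,g,c,h,l,d,e,i,j,m,n,f,p,q,s,k,o,r,t,u],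
 ![a,b,g,c,h,l,d,e,i,j,m,n,p,f,q,k,s,o,r,t,u], ![a,b,g,c,h,l,d,e,i,j,m,n,p,f,q,s,k,o,r,t,u], ![a,b,g,c,h,l,d,e,i,j,m,n,p,q,f,s,k,o,r,t,u], ![a,b,g,c,h,l,d,e,i,j,m,n,p,q,s,f,k,o,r,t,u],
 ![a,b,g,c,h,l,d,i,e,f,j,k,m,n,o,p,q,r,s,t,u], ![a,b,g,c,h,l,d,i,e,f,j,m,k,n,o,p,q,r,s,t,u], ![a,b,g,c,h,l,d,i,e,f,m,j,k,n,o,p,q,r,s,t,u], ![a,b,g,c,h,l,d,i,e,j,f,k,m,n,o,p,q,r,s,t,u],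
 ![a,b,g,c,h,l,d,i,e,j,f,k,m,n,o,p,q,s,r,t,u], ![a,b,g,c,h,l,d,i,e,j,f,m,k,n,o,p,q,r,s,t,u], ![a,b,g,c,h,l,d,i,e,j,f,m,k,n,o,p,q,s,r,t,u], ![a,b,g,c,h,l,d,i,e,j,m,f,k,n,o,p,q,r,s,t,u] ]
 else
 if N < 160 then
 if N < 158 then
 [ -- block 157: chambers 2512…2527, four per line
 ![a,b,g,c,h,l,d,i,e,j,m,f,k,n,o,p,q,s,r,t,u], ![a,b,g,c,h,l,d,i,e,j,m,f,k,n,p,o,q,r,s,t,u], ![a,b,g,c,h,l,d,i,e,j,m,f,k,n,p,o,q,s,r,t,u], ![a,b,g,c,h,l,d,i,e,j,m,f,n,k,o,p,q,s,r,t,u],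
 ![a,b,g,c,h,l,d,i,e,j,m,f,n,k,p,o,q,s,r,t,u], ![a,b,g,c,h,l,d,i,e,j,m,n,f,k,o,p,q,s,r,t,u], ![a,b,g,c,h,l,d,i,e,j,m,n,f,k,p,o,q,s,r,t,u], ![a,b,g,c,h,l,d,i,e,j,m,n,f,k,p,q,o,s,r,t,u],
 ![a,b,g,c,h,l,d,i,e,j,m,n,f,k,p,q,s,o,r,t,u], ![a,b,g,c,h,l,d,i,e,j,m,n,f,p,k,q,o,s,r,t,u], ![a,b,g,c,h,l,d,i,e,j,m,n,f,p,k,q,s,o,r,t,u], ![a,b,g,c,h,l,d,i,e,j,m,n,p,f,k,q,o,s,r,t,u],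
 ![a,b,g,c,h,l,d,i,e,j,m,n,p,f,k,q,s,o,r,t,u], ![a,b,g,c,h,l,d,i,e,j,m,n,p,f,q,k,s,o,r,t,u], ![a,b,g,c,h,l,d,i,e,j,m,n,p,q,f,k,s,o,r,t,u], ![a,b,g,c,h,l,d,i,e,j,m,n,p,q,f,s,k,o,r,t,u] ]
 else
 if N < 159 then
 [ -- block 158: chambers 2528…2543, four per line
 ![a,b,g,c,h,l,d,i,e,j,m,n,p,q,s,f,k,o,r,t,u], ![a,b,g,c,h,l,d,i,e,m,f,j,k,n,o,p,q,r,s,t,u], ![a,b,g,c,h,l,d,i,e,m,f,j,k,n,p,o,q,r,s,t,u], ![a,b,g,c,h,l,d,i,e,m,j,f,k,n,o,p,q,r,s,t,u],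
 ![a,b,g,c,h,l,d,i,e,m,j,f,k,n,p,o,q,r,s,t,u], ![a,b,g,c,h,l,d,i,e,m,j,f,n,k,o,p,q,r,s,t,u], ![a,b,g,c,h,l,d,i,e,m,j,f,n,k,o,p,q,s,r,t,u], ![a,b,g,c,h,l,d,i,e,m,j,f,n,k,p,o,q,r,s,t,u],
 ![a,b,g,c,h,l,d,i,e,m,j,f,n,k,p,o,q,s,r,t,u], ![a,b,g,c,h,l,d,i,e,m,j,f,n,p,k,o,q,r,s,t,u], ![a,b,g,c,h,l,d,i,e,m,j,f,n,p,k,o,q,s,r,t,u], ![a,b,g,c,h,l,d,i,e,m,j,n,f,k,o,p,q,s,r,t,u],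
 ![a,b,g,c,h,l,d,i,e,m,j,n,f,k,p,o,q,s,r,t,u], ![a,b,g,c,h,l,d,i,e,m,j,n,f,p,k,o,q,s,r,t,u], ![a,b,g,c,h,l,d,i,e,m,j,n,f,p,k,q,o,s,r,t,u], ![a,b,g,c,h,l,d,i,e,m,j,n,p,f,k,q,o,s,r,t,u] ]
 else
 [ -- block 159: chambers 2544…2559, four per line
 ![a,b,g,c,h,l,d,i,e,m,j,n,p,f,q,k,o,s,r,t,u], ![a,b,g,c,h,l,d,i,e,m,j,n,p,f,q,k,s,o,r,t,u], ![a,b,g,c,h,l,d,i,e,m,j,n,p,q,f,k,s,o,r,t,u], ![a,b,g,c,h,l,d,i,e,m,j,n,p,q,f,s,k,o,r,t,u],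
 ![a,b,g,c,h,l,d,i,e,m,j,n,p,q,s,f,k,o,r,t,u], ![a,b,g,c,h,l,d,i,m,e,f,j,k,n,o,p,q,r,s,t,u], ![a,b,g,c,h,l,d,i,m,e,f,j,k,n,p,o,q,r,s,t,u], ![a,b,g,c,h,l,d,i,m,e,f,j,k,p,n,o,q,r,s,t,u],
 ![a,b,g,c,h,l,d,i,m,e,f,j,p,k,n,o,q,r,s,t,u], ![a,b,g,c,h,l,d,i,m,e,f,p,j,k,n,o,q,r,s,t,u], ![a,b,g,c,h,l,d,i,m,e,j,f,k,n,o,p,q,r,s,t,u], ![a,b,g,c,h,l,d,i,m,e,j,f,k,n,p,o,q,r,s,t,u],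
 ![a,b,g,c,h,l,d,i,m,e,j,f,k,p,n,o,q,r,s,t,u], ![a,b,g,c,h,l,d,i,m,e,j,f,n,k,o,p,q,r,s,t,u], ![a,b,g,c,h,l,d,i,m,e,j,f,n,k,p,o,q,r,s,t,u], ![a,b,g,c,h,l,d,i,m,e,j,f,n,p,k,o,q,r,s,t,u] ]
 else
 if N < 161 then
 [ -- block 160: chambers 2560…2575, four per line
 ![a,b,g,c,h,l,d,i,m,e,j,f,p,k,n,o,q,r,s,t,u], ![a,b,g,c,h,l,d,i,m,e,j,f,p,n,k,o,q,r,s,t,u], ![a,b,g,c,h,l,d,i,m,e,j,n,f,k,o,p,q,r,s,t,u], ![a,b,g,c,h,l,d,i,m,e,j,n,f,k,o,p,q,s,r,t,u],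
 ![a,b,g,c,h,l,d,i,m,e,j,n,f,k,p,o,q,r,s,t,u], ![a,b,g,c,h,l,d,i,m,e,j,n,f,k,p,o,q,s,r,t,u], ![a,b,g,c,h,l,d,i,m,e,j,n,f,p,k,o,q,r,s,t,u], ![a,b,g,c,h,l,d,i,m,e,j,n,f,p,k,o,q,s,r,t,u],
 ![a,b,g,c,h,l,d,i,m,e,j,n,p,f,k,o,q,r,s,t,u], ![a,b,g,c,h,l,d,i,m,e,j,n,p,f,k,o,q,s,r,t,u], ![a,b,g,c,h,l,d,i,m,e,j,n,p,f,k,q,o,s,r,t,u], ![a,b,g,c,h,l,d,i,m,e,j,n,p,f,q,k,o,s,r,t,u],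
 ![a,b,g,c,h,l,d,i,m,e,j,n,p,q,f,k,o,s,r,t,u], ![a,b,g,c,h,l,d,i,m,e,j,n,p,q,f,k,s,o,r,t,u], ![a,b,g,c,h,l,d,i,m,e,j,n,p,q,f,s,k,o,r,t,u], ![a,b,g,c,h,l,d,i,m,e,j,n,p,q,s,f,k,o,r,t,u] ]
 else
 if N < 162 then
 [ -- block 161: chambers 2576…2591, four per line
 ![a,b,g,c,h,l,d,i,m,e,j,p,f,k,n,o,q,r,s,t,u], ![a,b,g,c,h,l,d,i,m,e,j,p,f,n,k,o,q,r,s,t,u], ![a,b,g,c,h,l,d,i,m,e,j,p,n,f,k,o,q,r,s,t,u], ![a,b,g,c,h,l,d,i,m,e,j,p,n,f,k,q,o,r,s,t,u],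
 ![a,b,g,c,h,l,d,i,m,e,j,p,n,f,k,q,o,s,r,t,u], ![a,b,g,c,h,l,d,i,m,e,j,p,n,f,q,k,o,s,r,t,u], ![a,b,g,c,h,l,d,i,m,e,j,p,n,q,f,k,o,s,r,t,u], ![a,b,g,c,h,l,d,i,m,e,j,p,n,q,f,k,s,o,r,t,u],
 ![a,b,g,c,h,l,d,i,m,e,j,p,n,q,f,s,k,o,r,t,u], ![a,b,g,c,h,l,d,i,m,e,j,p,n,q,s,f,k,o,r,t,u], ![a,b,g,c,h,l,d,i,m,e,p,f,j,k,n,o,q,r,s,t,u], ![a,b,g,c,h,l,d,i,m,e,p,j,f,k,n,o,q,r,s,t,u],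
 ![a,b,g,c,h,l,d,i,m,e,p,j,f,n,k,o,q,r,s,t,u], ![a,b,g,c,h,l,d,i,m,e,p,j,n,f,k,o,q,r,s,t,u], ![a,b,g,c,h,l,d,i,m,e,p,j,n,f,k,q,o,r,s,t,u], ![a,b,g,c,h,l,d,i,m,e,p,j,n,f,q,k,o,r,s,t,u] ]
 else
 [ -- block 162: chambers 2592…2607, four per line
 ![a,b,g,c,h,l,d,i,m,e,p,j,n,f,q,k,o,s,r,t,u], ![a,b,g,c,h,l,d,i,m,e,p,j,n,q,f,k,o,s,r,t,u], ![a,b,g,c,h,l,d,i,m,e,p,j,n,q,f,k,s,o,r,t,u], ![a,b,g,c,h,l,d,i,m,e,p,j,n,q,f,s,k,o,r,t,u],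
 ![a,b,g,c,h,l,d,i,m,e,p,j,n,q,s,f,k,o,r,t,u], ![a,b,g,c,h,l,d,i,m,p,e,f,j,k,n,o,q,r,s,t,u], ![a,b,g,c,h,l,d,i,m,p,e,j,f,k,n,o,q,r,s,t,u], ![a,b,g,c,h,l,d,i,m,p,e,j,f,n,k,o,q,r,s,t,u],
 ![a,b,g,c,h,l,d,i,m,p,e,j,n,f,k,o,q,r,s,t,u], ![a,b,g,c,h,l,d,i,m,p,e,j,n,f,k,q,o,r,s,t,u], ![a,b,g,c,h,l,d,i,m,p,e,j,n,f,q,k,o,r,s,t,u], ![a,b,g,c,h,l,d,i,m,p,e,j,n,q,f,k,o,r,s,t,u],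
 ![a,b,g,c,h,l,d,i,m,p,e,j,n,q,f,k,o,s,r,t,u], ![a,b,g,c,h,l,d,i,m,p,e,j,n,q,f,k,s,o,r,t,u], ![a,b,g,c,h,l,d,i,m,p,e,j,n,q,f,s,k,o,r,t,u], ![a,b,g,c,h,l,d,i,m,p,e,j,n,q,s,f,k,o,r,t,u] ]

/-- **Chamber `n` of `(2,6)`** (`n < 2608`): the order `σₙ : Fin 21 → Fin 6 × Fin 6` of the 21 canonical pairs `(i, j)`, `i ≤ j`,
by increasing pair sum `dᵢ + dⱼ` on chamber `n` of theory g6's table — the id used by the landed rows `doorA26_on_chamber<n>`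
(e.g. `chamber 1002` is the `σ` of `…CensusChamber1002.lean` and `chamber 1002 = ![(0,0),(0,1),…]` holds by `rfl`, so a landed
row closes the instance `n = 1002` of a chamber-indexed statement by plain application).  The count `2 608 = |χ_𝒜(−1)|/6!`
(theory-2 CHAMBERS-COUNT-t2.md §2, Zaslavsky + 21 good primes; theory g6 exact-rational BFS; box enumeration `d₅ ≤ 80`) is NOT
asserted here; completeness of the table is the statement `stub_chamberCover` of the crux line `Cruxes/DoorA26/Lines/census.lean`.
Junk value for `n ≥ 2608`: an entry of block 162.  Bookkeeping definition, nothing asserted. [folklore] -/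
noncomputable def chamber (n : ℕ) : Fin 21 → Fin 6 × Fin 6 := (chamberBlock (n / 16)).getD (n % 16) (fun _ => (0, 0))

/-- Usage / sanity: `chamber 1002` is verbatim the `σ` of the landed row `doorA26_on_chamber1002`, definitionally. [folklore] -/
example : chamber 1002 = ![(0, 0), (0, 1), (0, 2), (1, 1), (0, 3), (0, 4), (1, 2), (0, 5), (1, 3), (2, 2), (1, 4),
    (2, 3), (1, 5), (2, 4), (3, 3), (2, 5), (3, 4), (4, 4), (3, 5), (4, 5), (5, 5)] := rfl

/-- Sanity: the first and the last entry. [folklore] -/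
example : chamber 0 = ![(0, 0), (0, 1), (0, 2), (0, 3), (0, 4), (0, 5), (1, 1), (1, 2), (1, 3), (1, 4), (1, 5),
    (2, 2), (2, 3), (2, 4), (2, 5), (3, 3), (3, 4), (3, 5), (4, 4), (4, 5), (5, 5)] ∧
  chamber 2607 = ![(0, 0), (0, 1), (1, 1), (0, 2), (1, 2), (2, 2), (0, 3), (1, 3), (2, 3), (3, 3), (0, 4),
    (1, 4), (2, 4), (3, 4), (4, 4), (0, 5), (1, 5), (2, 5), (3, 5), (4, 5), (5, 5)] := ⟨rfl, rfl⟩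

/-- **WINDOW-4 BAND LAW** (typed witness-free; a named `Prop`, nothing asserted — it is the statement of `stub_w4Band` of the
crux line `census`; door-p2 g7 FACTS 1–3, THINK-g7.md §5–§7).  The tree has the WITNESS form
`fourNomial_interlacing_of_three_posRoots{,'}` and, for every quadruple of monomials of a Descartes-sharp fewnomial,
`window_four_rule`, whose conclusion is EXACTLY the hypothesis block below (`u, v, w` = the exponent gaps, `a, b, c, e` = the
absolute twisted coefficients), so a consumer chains `window_four_rule` into this law with no re-derivation.  With
`T₂(x) = u·b − (u+v)·c·x^v + (u+v+w)·e·x^(v+w)` (`x^(u−1)·T₂ = −g'` for `g = a − b x^u + c x^(u+v) − e x^(u+v+w)`),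
`T₁(x) = (u+v+w)·a − (v+w)·b·x^u + w·c·x^(u+v)` and `Φ(x) = u·a − v·c·x^(u+v) + (v+w)·e·x^(u+v+w)`: `T₂` and `Φ` share the
critical abscissa `x_c`, `x_c^w = v(u+v)c / ((v+w)(u+v+w)e)`, both strictly decreasing on `(0, x_c]` and strictly increasing on
`[x_c, ∞)`.  HYPOTHESIS: `0 < s₁ < s₂`, `T₂(s₁) = T₂(s₂) = 0`, `T₁(s₁) < 0 < T₁(s₂)` (⟺ `Φ(s₁) < 0 < Φ(s₂)`, by
`(u+v+w)·Φ = u·T₁ + (v+w)·x^u·T₂`).  CONCLUSION, at ANY test abscissa `t > 0` (both rows are implications between forms LINEAR in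
`(a, b, c, e)` at fixed `t` — what a finite certificate can use, the witnesses being unknown algebraic numbers): LEFT of centre
(`(v+w)(u+v+w)·e·t^w ≤ v(u+v)·c`): `T₂(t) ≤ 0 ⟹ Φ(t) < 0`; RIGHT of centre: `Φ(t) ≤ 0 ⟹ T₂(t) < 0`.  (Paper proof: `s₁ < x_c < s₂`;
left: `t ≤ x_c ∧ T₂(t) ≤ 0 ⟹ s₁ ≤ t ⟹ Φ(t) ≤ Φ(s₁) < 0`; right: `t ≥ x_c ∧ Φ(t) ≤ 0 ⟹ t < s₂ ⟹ T₂(t) < T₂(s₂) = 0`.  Given two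
roots each, the rows over all `t` are equivalent to the interlacing `φ₁ < s₁ < φ₂ < s₂`, i.e. to the band
`F₁(σ_BCD) < σ_ACD < F₂(σ_BCD)`.  Numerically self-tested: 400 three-root 4-nomials × 200 abscissae, 0 failures.) [folklore] -/
def W4BandLaw : Prop :=
  ∀ (u v w : ℕ), 0 < u → 0 < v → 0 < w →
  ∀ (a b c e : ℝ), 0 < c → 0 < e →
  ∀ (s₁ s₂ : ℝ), 0 < s₁ → s₁ < s₂ →
    (u : ℝ) * b - ((u : ℝ) + v) * c * s₁ ^ v + ((u : ℝ) + v + w) * e * s₁ ^ (v + w) = 0 →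
    (u : ℝ) * b - ((u : ℝ) + v) * c * s₂ ^ v + ((u : ℝ) + v + w) * e * s₂ ^ (v + w) = 0 →
    ((u : ℝ) + v + w) * a - ((v : ℝ) + w) * b * s₁ ^ u + (w : ℝ) * c * s₁ ^ (u + v) < 0 →
    0 < ((u : ℝ) + v + w) * a - ((v : ℝ) + w) * b * s₂ ^ u + (w : ℝ) * c * s₂ ^ (u + v) →
    ∀ t : ℝ, 0 < t →
      ((((v : ℝ) + w) * ((u : ℝ) + v + w) * e * t ^ w ≤ (v : ℝ) * ((u : ℝ) + v) * c →
          (u : ℝ) * b - ((u : ℝ) + v) * c * t ^ v + ((u : ℝ) + v + w) * e * t ^ (v + w) ≤ 0 →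
            (u : ℝ) * a - (v : ℝ) * c * t ^ (u + v) + ((v : ℝ) + w) * e * t ^ (u + v + w) < 0) ∧
        ((v : ℝ) * ((u : ℝ) + v) * c ≤ ((v : ℝ) + w) * ((u : ℝ) + v + w) * e * t ^ w →
          (u : ℝ) * a - (v : ℝ) * c * t ^ (u + v) + ((v : ℝ) + w) * e * t ^ (u + v + w) ≤ 0 →
            (u : ℝ) * b - ((u : ℝ) + v) * c * t ^ v + ((u : ℝ) + v + w) * e * t ^ (v + w) < 0))

end Summit.ValiantsHypothesis.ValiantsHypothesis.Theorems.LacunarySymmetroidMatrixDescartes.Census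

namespace Summit.ValiantsHypothesis.ValiantsHypothesis.Cruxes.DoorA26.Census

open Polynomial
open Summit.ValiantsHypothesis.ValiantsHypothesis.Theorems.LacunarySymmetroidMatrixDescartes (PosRootLawOn)
open Summit.ValiantsHypothesis.ValiantsHypothesis.Theorems.LacunarySymmetroidMatrixDescartes.Census
  (chamber W4BandLaw doorA26_item_of doorA26_iff_strictMono posRootLawOn_of_chamberRows)


/-! ## The stub STATEMENTS — precise named `Prop`s `Stmt.stub_<name>` (what a prover restates verbatim in a `Theorems/` file,
over `Census.chamber` / `Census.W4BandLaw` once the table file has landed); the registered stubs below assert them with `sorry`. -/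

/-- `Stmt.stub_chamberCover` (registered stub `stub_chamberCover`) — **COMPLETENESS OF THE TABLE** (size M; finite combinatorics, no analysis).  For every sorted generic
support `0 = d₀ < d₁ < ⋯ < d₅` (generic = the 21 canonical pair sums are distinct, which is what a covering `σ` with
`StrictMono (pairSum ∘ σ)` says) the pair-sum order is one of the 2 608 LISTED orders.  Why plausibly true: the table is theory
g6's exact-rational BFS of the chamber graph of the arrangement `{dᵢ+dⱼ = dₖ+dₗ}` on the cone, its count matches Zaslavsky's
`|χ_𝒜(−1)|/6! = 1 877 760/720 = 2 608` (theory-2, 21/21 good primes) and all 11 946 394 generic integer supports with `d₅ ≤ 80`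
realise exactly these orders (theory g6 `boxmin.py`).  Proof plans: (i) decide the order type from the SIGN VECTOR of the
`C(21,2) = 210` pair-sum comparisons and show by a terminating case analysis (`omega` leaves) that every consistent sign vector is
listed; (ii) cheaper: induct on the insertion position of `d₅` (resp. `d₁`, by mirror) over the `(2,5)` table of 244 orders …
no: of the `(2,5)` chambers, each refined by the linear extensions compatible with the new sums — all leaves `omega`/`decide`.
Why it might fail: only by a defect of the table (then the fix is to extend the table `chamber` and the bound 2608; `DoorA26_of` is index-agnostic).
Leans on: nothing in the tree beyond `Fin`/`List`; `Census.exists_chamberOrder_of_injOn` is the converse direction, already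
used inside `posRootLawOn_of_chamberRows`.  Seats: any idle prover; engine seats may generate the case tree. -/
def Stmt.stub_chamberCover : Prop :=
    ∀ d : Fin 6 → ℕ, StrictMono d → d 0 = 0 →
      ∀ σ : Fin 21 → Fin 6 × Fin 6, (∀ p : Fin 6 × Fin 6, ∃ t : Fin 21, σ t = p ∨ σ t = p.swap) →
        StrictMono ((fun p : Fin 6 × Fin 6 => d p.1 + d p.2) ∘ σ) →
          ∃ n < 2608, StrictMono ((fun p : Fin 6 × Fin 6 => d p.1 + d p.2) ∘ chamber n)

/-- `Stmt.stub_easyChambers` (registered stub `stub_easyChambers`) — **THE 2 604 NON-HARD CHAMBERS CARRY THE DOOR-A ROW** (size L by volume, routine per chamber).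
Statement: for every listed chamber `n ∉ [1, 954, 1706, 1709]` and every support `d` in it, `PosRootLawOn 2 6 19 d`.  Why plausibly true /
state of record: 931 of these instances are ALREADY kernel theorems `Census.doorA26_on_chamber<n>` (list:
`HOME/lead/g21/census/chambers_byfile.txt`; classes: parity 462, L-tri/J₁ 262, sign-only Λ/Π, magnitude leaves NC/AM-GM/dom2/dom3/
dom-frac/row-assisted/piecewise domination, mirror transport), each closing its instance here by `exact doorA26_on_chamber<n> d hd`
since `chamber n` is definitionally the landed literal; the remaining ≈ 1 673 are door-p2's filer queue (same instrument
`Census.posRootLawOn_of_chamber_cell` + the magnitude-leaf lemmas) — a chamber found immune to every landed class is MOVED to the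
hard list by the lead (header, RESHAPING RULE), so this stub is by construction the routine part.  Assembly of the instances:
`intro n hn; interval_cases n` is too slow at 2 608 — bisect `n < 2608` into dyadic blocks with `omega` and close blocks of ≤ 64 by
`interval_cases`/`decide`-driven dispatch to the per-chamber rows.  Why it might fail: a non-hard chamber needing the band law
(then it is re-labelled hard, not a failure of the line).  Leans on: `Census.posRootLawOn_of_chamber_cell`, `…ChamberSignCell`,
`…ChamberSymmetry` (mirror), the 931 landed `…CensusChamber<n>` / `…Chambers…` files.  Seats: door-p2 (filer), door-p3/p4, engines. -/
def Stmt.stub_easyChambers : Prop :=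
    ∀ n < 2608, n ∉ [1, 954, 1706, 1709] →
      ∀ d : Fin 6 → ℕ, StrictMono ((fun p : Fin 6 × Fin 6 => d p.1 + d p.2) ∘ chamber n) → PosRootLawOn 2 6 19 d

/-- `Stmt.stub_w4Band` (registered stub `stub_w4Band`) — **THE WINDOW-4 BAND LAW HOLDS** (size S/M; one-variable real analysis).  See `W4BandLaw`: strict
monotonicity of the trinomials `T₂` and `Φ` on either side of their common critical abscissa, `s₁ < x_c < s₂`, and the identity
`(u+v+w)·Φ = u·T₁ + (v+w)·x^u·T₂` at the roots of `T₂` (verbatim the `key` step of `Census.fourNomial_interlacing_of_three_posRoots'`).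
Why plausibly true: proved on paper (header) and self-tested numerically; it is the monotone repackaging of a landed theorem.
Why it might fail: only by a typing slip in `W4BandLaw` (then re-type; the consumers' shape is fixed by `window_four_rule`).
Leans on: `Census.fourNomial_interlacing_of_three_posRoots'` (pattern), Mathlib `HasDerivAt`, `Census.deriv_sign_of_no_critical`
(`…WindowFourInterlacing`), `strictMonoOn_of_deriv_pos` / `strictAntiOn_of_deriv_neg`.  Seats: door-p3 or any idle prover. -/
def Stmt.stub_w4Band : Prop :=
    W4BandLaw

/-- `Stmt.stub_hardChambers` (registered stub `stub_hardChambers`) — **THE HARD CHAMBERS `[1, 954, 1706, 1709]` CARRY THE DOOR-A ROW, USING THE BAND LAW** (size XL;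
THE CRUX OF THE LINE).  Statement: `W4BandLaw →` for each hard chamber and every support in it, `PosRootLawOn 2 6 19 d`.
Why a new input is forced: the kernel pseudo-twenties p549496 (chamber 1706), p551561 / p551757 (chamber 954) satisfy every row whose
root-side input is signs + Newton cone C25 (+ the recorded Gram rows) — any proof of these instances MUST use a root-side row
beyond C25; the band rows of `W4BandLaw` (via `Census.window_four_rule`, all `C(21,4)` quadruples available, not only consecutive
windows — door-p1 g8: the barrier cells violate the window-4 row on 14 of their 18 consecutive windows) are that input, combined
with PENCIL-SIDE magnitude rows (M4 / Gram: door-p1 g9 located the apex zone `σ₉ ≤ 1.28·10⁻³` of `(0,2,3,8,19,33)⁺` dead by M4 term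
domination; above it the W4 bands bite; desk R2223/R2227).  Proof shape per chamber: contrapositive (`20` roots ⇒ Descartes-sharp
⇒ sign class + strict alternation, `…ChamberSignClass`), then a FINITE tree of test abscissae `t` (rational, or `t^w` rational) at
which the band rows' case split `T₂(t) > 0 ∨ Φ(t) < 0` (left) / `Φ(t) > 0 ∨ T₂(t) < 0` (right) contradicts the pencil-side rows by
`linarith`/`nlinarith` — engine-1/2 search the trees (LP with disjunctions = small MILP per chamber), door-p1/p4 type them; chamber
`1` / `1709` by mirror transport from each other where `…ChamberSymmetry` applies.  Why it might fail: (a) a hard chamber may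
contain a TRUE twenty (then `DoorA26` is false and `Census.not_doorA26_iff` fires — informative either way); (b) the band rows at
finitely many abscissae might still leave a pseudo-solution (then deeper root-side rows — window-5, or the full discriminant
locus — are needed and this stub is re-cut by the lead).  Leans on: `W4BandLaw` (h), `Census.window_four_rule`,
`Census.newton_cone`, `…ChamberSignClass/SignCell`, `…GramConstraint`-type pencil rows, `Census.posRootLawOn_of_chamber_cell`.
Seats: door-p1 (lead on 1706/954), door-p4, engine-1/2 (`--supports stmt-ValiantsHypothesis-19979` sub-lemmas citing this stub). -/
def Stmt.stub_hardChambers : Prop :=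
    W4BandLaw → ∀ n ∈ [1, 954, 1706, 1709],
      ∀ d : Fin 6 → ℕ, StrictMono ((fun p : Fin 6 × Fin 6 => d p.1 + d p.2) ∘ chamber n) → PosRootLawOn 2 6 19 d

/-! ## The registered stubs (the ONLY `sorry`s of this file) -/

/-- Registered stub 1 = `Stmt.stub_chamberCover` (completeness of the 2 608-chamber table; size M). -/
theorem stub_chamberCover : Stmt.stub_chamberCover := by
  sorry

/-- Registered stub 2 = `Stmt.stub_easyChambers` (the 2 604 non-hard chambers carry the door-A row; size L by volume;
931 instances already landed as `Census.doorA26_on_chamber<n>`). -/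
theorem stub_easyChambers : Stmt.stub_easyChambers := by
  sorry

/-- Registered stub 3 = `Stmt.stub_w4Band` (`Census.W4BandLaw`; size S/M). -/
theorem stub_w4Band : Stmt.stub_w4Band := by
  sorry

/-- Registered stub 4 = `Stmt.stub_hardChambers` (the hard chambers `[1, 954, 1706, 1709]` from the band law; size XL —
THE crux of the line). -/
theorem stub_hardChambers : Stmt.stub_hardChambers := by
  sorry

/-! ## The composition (kernel-checked, no `sorry` of its own) -/

/-- **`DoorA26` from the four stub statements.**  `doorA26_item_of ∘ doorA26_iff_strictMono.mpr`; support by support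
`posRootLawOn_of_chamberRows` (which also disposes of the non-generic supports — a pair-sum collision costs a monomial,
`posRootLawOn_of_pairSum_collision`); the cover puts the support in a listed chamber; hard / easy case split on the index. -/
theorem DoorA26_of :
    Stmt.stub_chamberCover → Stmt.stub_easyChambers → Stmt.stub_w4Band → Stmt.stub_hardChambers →
      Summit.ValiantsHypothesis.ValiantsHypothesis.Theses.LacunarySymmetroid.DoorA26 := by
  intro h₁ h₂ h₃ h₄
  refine doorA26_item_of (doorA26_iff_strictMono.mpr ?_)
  intro d hd h0
  refine posRootLawOn_of_chamberRows d ?_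
  intro σ hcov hmono
  obtain ⟨n, hn, hτ⟩ := h₁ d hd h0 σ hcov hmono
  by_cases hh : n ∈ [1, 954, 1706, 1709]
  · exact h₄ h₃ n hh d hτ
  · exact h₂ n hn hh d hτ

/-- **The crux from the registered stubs** (layer-invariant shape `…_proof : <crux decl> := …_of stub₁ … stub_k`; depends on
the four `sorry`s above and on nothing else — it BECOMES the proof of `DoorA26` when the last stub is discharged; until then
`DoorA26` is OPEN and nothing here asserts it). -/
theorem DoorA26_proof : Summit.ValiantsHypothesis.ValiantsHypothesis.Theses.LacunarySymmetroid.DoorA26 :=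
  DoorA26_of stub_chamberCover stub_easyChambers stub_w4Band stub_hardChambers

end Summit.ValiantsHypothesis.ValiantsHypothesis.Cruxes.DoorA26.Census
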